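import Literature.MathematicalPhysics.QuantumFieldTheory.Balaban1983to89.T4ActivityLipschitz
import Literature.MathematicalPhysics.QuantumFieldTheory.Balaban1983to89.T4InputCauchyRateData

/-!
# T⁴-continuum spine estimate NE5 (node U3), polymer-activity route, HISTORY-HONEST form:
# the activity-level input pencil with coupling-history insertion, closing through the recursive block budget

Cell `pub-balaban`, T⁴-continuum fan-out, node U3 / estimate NE5, prover seat P2 (assigned technique: *polymer-activity
Lipschitz route — bound output differences by activity differences via the printed convergence criteria (Kotecký–Preiss
norm)*), lineage generation 3; FILE v1.4 (generation 7, ADDITIVE §9; v1.3 = generation 6, ADDITIVE §8 + one provenance-tag fix; v1.2 = generation 5, ADDITIVE §7; v1.1 = generation 4, ADDITIVE §5–§6 + two docstring fixes; see VERSIONS).  This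
leaf is ADDITIVE to the tree: it imports the seat's `T4ActivityLipschitz` (the
cluster representation `ClusterRep`, the pinned KP pencil bound `norm_clusterSum_sub_le_of_family`, the affine input
pencil `inputPencil`) and the sibling seat P1's `T4InputCauchyRate` / `T4InputCauchyRateData` (the recursive block
budget `RecursiveRate`, its renewal closure `ne5_of_recursiveRate`, the output tables `tableA` / `tableB`) BY NAME and
modifies nothing.

HONEST FRAMING.  The cell's T4 target is rung (B)+1 (existence AND uniqueness of the `ε → 0` limit of Bałaban's
unit-scale effective densities on the finite torus T⁴) — NOT infinite volume, NOT a mass gap, NOT the Clay problem.  The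
conditionals (BetaPertH, (B), (B^μ)) are explicit BY NAME in the cell records and live here inside the window `W` and
the hypothesis shapes of whoever instantiates the model; nothing is hidden in a definition.  This file asserts NOTHING
about Bałaban's functionals: every declaration is either `[folklore]` bookkeeping proved in the kernel or a
`def … : Prop` HYPOTHESIS SHAPE consumed as a binder.  NE5 itself is NOT PRINTED in [Bałaban 1983–89] and is NOT
proved here; what is proved is an implication.

WHY THIS LEAF (the sibling's caution, cell journal l.48012; the carver's `t4/T4-DAG.md` v17 §6 NE5).  Generation 2's
`ClusterRep.ne5_of_inputKP` closed NE5 from INPUT-KP (the activities are holomorphic functions of the inputs on a margin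
ball, under a one-run KP majorant) and a constant-`D` INPUT RATE (the two runs' inputs differ by `Dθ^{scale X}`
margins).  For the flow of B12–B14 the input of a step-`k` activity carries, besides the operators / backgrounds of the
step (whose two-run discrepancy IS the cell's NE2 ∧ NE3), the COUPLING HISTORY, inserted through the earlier effective
actions (B13 (1.33) p. 9, (1.41) p. 11: the fluctuation action is assembled from the previous actions; B12 (0.29)–(0.30));
the two runs' histories differ by the accumulated OUTPUT discrepancies of the earlier steps — a quantity of the same kind
as NE5.  A constant-`D` input rate for the whole input point therefore hides NE5_{<k}.  The honest form makes the history
enter through FIXED insertion maps of the two runs' output tables (P1's `StepModel` data discipline, here transplanted to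
the activity level), lets the pencil radius CARRY the inherited discrepancies, and closes through P1's recursive budget:
the two seats' kernels MEET in `T4InputCauchyRate.RecursiveRate` as common currency.

CONTENT.
§1  The affine input pencil through a two-margin BOX `ball p.1 ϱ₁ ×ˢ ball p.2 ϱ₂` of a product input space: componentwise
    it is the one-species pencil of `T4ActivityLipschitz` §8, so radius × species discrepancy ≤ species margin keeps it in
    the box (`inputPencil_mem_box`); with radius = 1 ∕ (relative discrepancy `‖Δ₁‖/ϱ₁ + ‖Δ₂‖/ϱ₂`) it always fits
    (`inputPencil_mem_box_of_relDisc`).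
§2  Two pointwise forms of the `ClusterRep` bounds of `T4ActivityLipschitz` (no window, no global radius): the pinned
    pencil bound at ONE `(g, U, X)` (`norm_out_sub_le_of_pencil`: endpoints, holomorphy on `‖z‖ < Rz`, majorant `m` uniform
    in `z`, KP for `m` ⇒ `‖outA − outB‖ ≤ a(pin X)e^{−δ_X}/(Rz − 1)`) and the one-run bound (`norm_clusterSum_clus_le_of_kp`).
§3  HYPOTHESIS-CARRYING DATA `InputModel R Op Hist` over a cluster representation `R` (no inequality inside): per domain
    `X`, the activities `Ψ g U X γ : Op × Hist → ℂ` of the polymers of the step volume as functions of a TWO-SPECIES input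
    (operator part `Op`, inserted-history part `Hist`; the common data `(g, U)` are parameters, not coordinates), the two
    runs' operator inputs `opA` / `opB`, their history INSERTION maps `insA` / `insB` (output table ↦ inserted history), a
    one-run admissible class `Base`, and the two margins `ϱOp X`, `ϱHist X`.  HYPOTHESIS SHAPES (each flagged NOT PRINTED
    where it is not): `Realizes` (the representation's activities ARE the values of `Ψ` at the runs' own input points —
    two-run bookkeeping, cell MI-R), `InBase`, `BoxKP` (= the activity-level face G-ne5p2-3 of the cell's one located input
    gap ≡ G-ne5p1-1′: on the two-margin complex box around every admissible point the activities are holomorphic and under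
    ONE one-run majorant `m` obeying the `d`-weighted KP condition — "B13 Lemma 3 (2.38) on a complex neighbourhood of the
    inputs"; printed TYPE: (2.14) and p. 15, printed one-run SIZE: Lemma 3 p. 20; NOT PRINTED as a statement), `OperatorRate`
    (NE2 ∧ NE3 in operator-margin units), `InsertionRate` (the two runs' insertion maps on decaying tables differ at rate
    `δ′θ^k` history margins), `InsertionDamped` (= cell MI-3a: run A's insertion is damped-Lipschitz in the table,
    `c·Σ_{j<k} ω^{k−j}D_j` history margins, reading only scales `< k`).
§4  THE STEP (kernel): `recursiveRate_of_model` — the hypotheses of §3 with the representation's DECAY / PIN bookkeeping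
    and the two one-run envelopes give EXACTLY P1's `RecursiveRate EA EB W κ θ ω (4A(δ + δ′)) (4Ac)`: at `X` of scale `k`
    the relative input discrepancy is `ρ ≤ δθ^k + δ′θ^k + cΣ_{j<k} ω^{k−j}D_j`; if `ρ ≤ ½` the KP pencil of radius `1/ρ`
    through the box gives `‖outA − outB‖ ≤ a(pin)e^{−δ_X}/(1/ρ − 1) ≤ 2ρ·A e^{−κd(X)}` (NO window hypothesis); if
    `ρ > ½` the two one-run bounds give `2A e^{−κd} < 4ρA e^{−κd}`.  THE CLOSURE: `ne5_of_model` =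
    `T4InputCauchyRate.ne5_of_recursiveRate` under the smallness `(1 + 4Ac)ω < θ`, constant
    `C₅ = 4A(δ + δ′)(θ − ω) ∕ (θ − (1 + 4Ac)ω)`; `decayBound_of_model` (run B's one-run bound is implied by the box data);
    `ne5_of_model_blind` (history-blind insertion, `c = 0`: `C₅ = 4A(δ + δ′)`, generation 2's situation).
§5  (file v1.1, ADDITIVE) `ne5_of_model_env` (no free run-B level: `InsertionRate` asked on tables under the pin budget
    `A`, run B's one-run bound being `decayBound_of_model`); the PRINTED AGE NORMALISATION — the newest previous action
    enters the next step UNDAMPED (B13 p. 8: in Σ_{j≤k}(6L)⁴Lʲη ≤ 2(6L)⁴ the term j = k has Lᵏη = 1; [I] = B12 (0.30)), so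
    the natural damped-Lipschitz shape is `InsertionDampedNat` (weights `ω^{k−1−j}`, NATURAL gain `c`), converted to the
    model's normalisation inside the closures (model gain `c/ω`, the sibling's `mul_sum_age_shift` BY NAME — the sibling's
    `StepModel.insertionDamped_of_nat` / `insertionDampedNat_mono` are the step-indexed twins and are not restated), and
    the closure `ne5_of_model_nat` carries the smallness in the form that can be read against print: `ω + 4Ac < θ`.
§6  (file v1.1, ADDITIVE) THE NEAR REGIME (the activity-level twin of the sibling's `T4InputCauchyRateData` §7):
    `recursiveRate_of_model_near` — the input pencil of radius `1/ρ` is used for EVERY relative discrepancy `ρ < 1` (not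
    only `ρ ≤ ½`), where the pinned KP pencil bound has the EXACT constant `a(pin)e^{−δ_X}/(1/ρ − 1) = a(pin)e^{−δ_X}·ρ/(1 − ρ)`;
    the inherited levels are capped a priori by the two one-run decay levels (`min(D_j, A₀ + E₀)`), so for scales `k ≥ k₀`
    `ρ ≤ ρ₀ := (δ + δ′)θ^{k₀} + c(A₀ + E₀)ω/(1 − ω) < 1` WITHOUT using the induction, and the first scales cost a constant
    `B`, never the rate: `RecursiveRate EA EB W κ θ ω (A(δ + δ′)/(1 − ρ₀) + B) (Ac/(1 − ρ₀))` — the `4A` of §4 becomes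
    `A/(1 − ρ₀) → A`.  Closures `ne5_of_model_near` (smallness `(1 + Ac/(1 − ρ₀))ω < θ`) and `ne5_of_model_near_nat`
    (printed age normalisation: `ω + Ac/(1 − ρ₀) < θ`).
§7  (file v1.2, ADDITIVE) SCALE RESOLUTION at the activity level (the twin of the sibling's `T4InputCauchyRateData` v4
    §9, whose generic `sliceAt`/`belowScale`/`belowScale_eq_sum_sliceAt` are used BY NAME): hypothesis shapes
    `InsAffine` (printed structure, (1.33)), `InsBlind` (causality), `InsHomog` (real homogeneity), `InsScaleBoundLevel`
    (the displayed SINGLE-SCALE one-run term with levels) and `InsScaleBound` (the same at ONE reference level `E₁` —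
    the activity-level reading of the cell gap G-ne5p1-3a″); `insBlind_of_insertionDampedNat` and
    `insScaleBoundLevel_of_insertionDampedNat` (causality and the single-scale term are CONTAINED in MI-3a),
    `insertionDampedNat_of_scaleBoundLevel` (affine + blind + single-scale ⟹ MI-3a in the printed age normalisation),
    hence `insertionDampedNat_iff_of_affine` : for affine insertions `InsertionDampedNat κ c ω ⟺ InsBlind ∧
    InsScaleBoundLevel κ c ω`; `insScaleBoundLevel_iff_of_homog` (levels ⟺ one level `E₁ > 0` for real-homogeneous
    table-driven parts), hence `insertionDampedNat_iff_of_affine_homog` : `InsertionDampedNat κ c ω ⟺ InsBlind ∧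
    InsScaleBound κ E₁ c ω` — granted printed linearity, the discrepancy wall is EXACTLY causality plus the one-run
    single-scale term at one level, nothing two-run hides in it; `insertionDampedNat_of_scaleBound` and the closure
    `ne5_of_model_scale_near_nat` (= `ne5_of_model_near_nat` with `InsertionDampedNat` replaced by `InsAffine ∧
    InsBlind ∧ InsHomog ∧ InsScaleBound κ E₁ c ω`, `E₁ > 0`; same smallness, same constant).
§8  (file v1.3, ADDITIVE) THE LIPSCHITZ CURRENCY AT THE ACTIVITY LEVEL — the analytic box wall RE-TYPED.  Generations 2–5
    typed the seat's located wall as HOLOMORPHY of the activities on a neighbourhood of the input segment (`PencilKP` →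
    `InputKP` → `BoxKP`) only because the activity rate was computed by the Cauchy estimate IN THE INPUTS; the technique's
    own consumer (`T4ActivityLipschitz` v3.1's `norm_clusterSum_sub_le_of_family`) needs no holomorphy of `Ψ` at all — it runs along the ACTIVITY
    pencil `ζ ↦ (1 − ζ)ρ_B + ζρ_A`, which is ENTIRE.  §8.1 `norm_clusterSum_sub_le_of_actLip` (generic, over any finite
    list): majorant `m` for run B, activity differences `≤ ε·m`, KP for the INFLATED majorant `(1 + s)m` with `ε < s`
    ⟹ the pinned, decay-weighted two-run cluster-sum bound with rate `ε/(s − ε)`.  §8.2 the three hypothesis shapes that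
    replace `BoxKP`: `BaseMajorant m` (one-run majorant AT THE ADMISSIBLE INPUT POINTS only — printed kind (2.38)),
    `KPInflated s` (KP for `(1 + s)m` — printed kind, one more ε₁-restriction; `T4ActivityLipschitz`'s `KPMajorant` is `s = 1`) and
    `ActivityLipschitz Λ ρ₀` (NOT PRINTED, cell G-ne5p2-3′: a two-point activity-Lipschitz datum in margin units,
    `‖Ψ(q) − Ψ(p)‖ ≤ Λ·ρ(q,p)·m` for `ρ(q,p) ≤ ρ₀` — no complex neighbourhood, no analyticity); the key rate
    `disc_le_of_actLip` (`disc ≤ AΛ/(s − Λρ₀)·ρ·e^{−κd}`), the near-regime bookkeeping isolated once as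
    `recursiveRate_of_keyRate` (any key rate `K·ρ` on `ρ ≤ ρ₀` ⟹ `RecursiveRate … (K(δ + δ′) + B) (Kc)`), the recursion
    `recursiveRate_of_model_actLip` and the closures `ne5_of_model_actLip` / `_nat` / `_scale_nat` (smallness
    `ω + AΛc♮/(s − Λρ₀) < θ` in the printed age normalisation).  §8.3 PRODUCERS (new wall ⇐ old wall, kernel):
    `baseMajorant_of_boxKP`, `kpInflated_zero_of_boxKP`, `activityLipschitz_of_boxKP` (`BoxKP ⟹ ActivityLipschitz
    (1/(1 − ρ₀)) ρ₀` for `ρ₀ < 1`, one-variable Cauchy along the input pencil) and `recursiveRate_of_boxKP_inflated`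
    (§6 recovered from `BoxKP ∧ KPInflated s` up to the constant `A(1/(1 − ρ₀))/(s − ρ₀/(1 − ρ₀))` vs `A/(1 − ρ₀)`).
    The exchange is honest, not a normalisation: holomorphy of `Ψ` on a box is traded for a Lipschitz datum at real reach
    `ρ₀` plus one printed-kind KP inflation; the witness file's toy has exact modulus `Λ = ½` at every reach where Cauchy
    gives `1/(1 − ρ₀)`.
§9  (file v1.4, ADDITIVE) §9.1 THE LIPSCHITZ CURRENCY IN B13's PRINTED LETTERS: `norm_locE_sub_locE_le_of_actLip_small`
    — the third member of the family `T4ActivityLipschitz.norm_locE_sub_locE_le_of_small` (v1: both activity families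
    under the (2.38)-majorant, KP for the doubled majorant, `8ε`) / `…_of_pencil_small` (v2: holomorphic pencil,
    `1/(Rz − 1)`): (1.26), (2.30), footprint-local incompatibility, (2.27), rate `r₁ + 2κ₀ + 2 ≤ R`, ONE family under the
    (2.38)-type envelope `A e^{−Rd}`, the other within RELATIVE discrepancy `ε < s` of it (the ONE number of the statement
    that is not printed), one-run smallness for the inflated envelope `(1 + s)A e^{b+1}K₀νc₁ ≤ 1` ⟹
    `|E_{wA}(X) − E_{wB}(X)| ≤ (e ν c₁ K₀²)(1 + s)A e^{−r₁d(X)}·ε/(s − ε)` (proof: v2's pencil form along the ENTIRE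
    activity pencil); `…_of_actLip_one` (`s = 1`: v1's smallness `2A e^{b+1}K₀νc₁ ≤ 1`, constant factor `2ε/(1 − ε)`
    against v1's `8ε`, one endpoint instead of two).  §9.2 TWO SPECIES: the shape `ActivityLipschitz₂ Λop Λhist ρ₀`
    (separate moduli for the operator and the inserted-history displacement; NOT PRINTED, = G-ne5p2-3′ read with two
    moduli), the operator-margin REGAUGE `regaugeOp l` of a model (a unit choice; every other datum unchanged),
    `activityLipschitz_regaugeOp_of_activityLipschitz₂` (species datum = single datum with modulus `Λhist` of the model
    regauged by `l = Λhist/Λop`, reach converted by `max(l, 1)`), `operatorRate_regaugeOp` (`δ ↦ δ/l`), and the closure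
    `ne5_of_model_actLip₂_scale_nat` = §8's closure on the regauged model: smallness `ω + AΛhist c♮/(s − Λhist ρ₀′) < θ`
    — ONLY the history modulus meets the feedback gain, the operator modulus enters the constant
    `(A/(s − Λhist ρ₀′))(Λop δ + Λhist δ′) + B` and the near condition.  This answers, at the activity level and without
    a second recursion, the junction question put by the sibling (its `T4InputCauchyRateSpecies`: exponent-critical census
    `{θ_op, ω, A·Ghist·c}`); here the KP inflation `s` is the one extra letter.

VERSIONS.  v1 = p185249 (generation 3).  v1.1 (generation 4): every v1 declaration byte-identical; the `open` of the
sibling's namespace extended by `mul_sum_age_shift`, `sum_pow_age_le`; two docstring fixes owed to the cross-read of v1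
(cell GAPS C-pv19g4-3): O1 — the gloss of the smallness in `ne5_of_model` («NOT a small-coupling condition») is
WITHDRAWN: in the printed age normalisation the condition bounds the history GAIN by `θ − ω`, and in B13's bookkeeping
that gain is `K·ν` with `ν = O(1)C₃ε₁/E₀ ∝ ε₁`, of which print fixes only `ν ≤ ½` (p. 21 *"Next, we assume that
O(1)C₃ε₁ ≤ ½E₀"*) — an ADDITIONAL ε₁-restriction of the printed KIND (cell smallness item S-ne5p1-ν; the sibling's
`T4InputCauchyRateData` NUMBERS (c)–(d)); §6 lowers `K` from `4λ/(λ − 1)` to `λ/((λ − 1)(1 − ρ₀))` exactly as the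
sibling's §7 does, so the printed `ν ≤ ½` already leaves room for SOME positive rate exponent; O2 — the locator of the
volume bound (2.30) is p. 18 (not p. 19).  ADDITIVE §5–§6 as above.  Nothing printed is newly quoted except the p. 21
sentence just cited (render p021 of [B13], read for this version).  v1.2 (generation 5): every v1.1 declaration
byte-identical; ADDITIVE §7 as above (its docstrings' locators B13 (1.24) p. 7, p. 8, (1.33) p. 9, (1.41) p. 11 and B12
p. 258 (0.28)–(0.30), p. 280 (3.54) read on the renders for this version; the one newly quoted print string is B13 p. 8
*"This yields (6L)⁴Lʲη"*).  v1.3 (generation 6): every v1.2 declaration — statement AND proof — byte-identical; the only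
change above §8 besides this module docstring is DOCFIX-1 of cross-read C-pv08g4-6: the provenance TAG of `InsAffine` is
now `[folklore]` (a `[cite]` tag on a `def … : Prop` binder reads as «verbatim printed statement», which the printed
representation identity (1.33) p. 9 is not; its locators stay in the prose, as for `InsBlind`/`InsHomog` and the
sibling's `StepModel.InsAffine`); by the same convention the three new §8 shapes are tagged `[folklore]` with their
printed loci in prose.  ADDITIVE §8 as above.  Print read for this version: B13 p. 15 (the operator-replacement sentence
already quoted in `T4ActivityLipschitz`), p. 16 (2.16)–(2.22), p. 20 Lemma 3 (2.38) (renders p015, p016, p020); nothing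
printed is newly quoted — CORRECTION recorded for v1.4 (cross-read C-b01g22-3, INFO I6): v1.3 DID newly quote one
nine-word p. 21 phrase, *"for κ sufficiently large, and ε₁ sufficiently small"*, in `KPInflated`'s docstring (render
p021, verbatim; p. 21 was already in the loci list).  v1.4 (generation 7): every v1.3 declaration — statement AND proof
— byte-identical; ADDITIVE §9 as above (§9.1 over the printed-letter shapes `Ineq126` / `VolBound` / `Ineq227` / `locE`
of `B13FamilySum` / `B13Resummation` BY NAME, through `T4ActivityLipschitz.norm_locE_sub_locE_le_of_pencil_small`; §9.2
pure bookkeeping over §8).  Nothing printed is newly quoted in v1.4 (the loci named in §9's docstrings — (1.26) p. 8,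
(2.14)/(2.18) pp. 15–16, (2.16)–(2.22) p. 16, (2.27)/(2.30) p. 18, Lemma 3 (2.38) p. 20, (2.41) p. 21 — are those of
v1–v1.3 and of `T4ActivityLipschitz` v3.1).

REDUCTION RECORDED FOR THE CARVER (activity member of NE5, v17 §6 wording made literal in the kernel).
NE5 ⇐ NE5-REP (two-run, `Represents` ∧ `Realizes`, MI-R = G-ne5p2-2) ∧ BOX-KP (`InBase` ∧ `BoxKP`, G-ne5p2-3 ≡ G-ne5p1-1′,
LOCATED NOT PRINTED) ∧ OPERATOR RATE (NE2 ∧ NE3 by name, in margin units) ∧ INSERTION RATE (NE2-type, re-expression maps)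
∧ MI-3a (`InsertionDamped`) ∧ DECAY ∧ PIN ((2.27) p. 18, (2.30) p. 18 bookkeeping) ∧ the one-run envelopes of both runs
((2.41) p. 21, printed per run) ∧ smallness `(1 + 4Ac)ω < θ` — kernel `InputModel.ne5_of_model` (in the printed age
normalisation `ω + 4Ac♮ < θ`, `ne5_of_model_nat`; near regime `ω + Ac♮/(1 − ρ₀) < θ`, `ne5_of_model_near_nat`; MI-3a
resolved into printed structure + the single-scale one-level term `InsScaleBound`, `ne5_of_model_scale_near_nat`; and,
v1.3, BOX-KP re-typed WITHOUT ANALYTICITY as `BaseMajorant` (printed kind) ∧ `KPInflated s` (printed kind) ∧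
`ActivityLipschitz Λ ρ₀` (G-ne5p2-3′, NOT PRINTED), smallness `ω + AΛc♮/(s − Λρ₀) < θ`, kernel
`ne5_of_model_actLip_scale_nat`, the old wall implying the new datum by `activityLipschitz_of_boxKP`; v1.4: with TWO
SPECIES of activity sensitivity `ActivityLipschitz₂ Λop Λhist ρ₀` the smallness is `ω + AΛhist c♮/(s − Λhist ρ₀′) < θ` —
the operator modulus is exponent-neutral — kernel `ne5_of_model_actLip₂_scale_nat` = the single-modulus closure on the
operator-margin-regauged model; and the route's final statement in B13's printed letters with ONE non-printed number, the
relative two-run activity discrepancy, is `norm_locE_sub_locE_le_of_actLip_small`).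
Generation 2's
`ClusterRep.InputRate` / `ne5_of_inputKP` is the history-blind special case (no `Hist` coordinate).  Value = kernel
reduction + bookkeeping; NOT an estimate of NE5; NOT summit progress.

PRIOR ART / NOVELTY (D-0021, searched in generations 0–2 and recorded in `T4ActivityLipschitz`'s header): the device is
Dimock's *analyticity ⇒ Lipschitz* (`Dimock2015.AnalyticLipschitz`, [Dimock 2013–15]) and King's Prop. 3.8/3.9 rate
bookkeeping [King1986], composed with the Kotecký–Preiss bound along a holomorphic family; the recursion is P1's renewal
closure.  Nothing here is claimed new beyond the typing.  Grade: variant / new-combination at most.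

Citations (LOCATORS of printed TYPES and one-run SIZES; no two-run statement is printed): [Bałaban 1988, CMP 116 = B13]
(2.13) p. 14, (2.14) and *"We consider it as an analytic function of (𝐔, 𝐉) in the space 𝐔^c_{k+1}(X, α₀, α₁), and of
the complex parameters σ(Z), τ."* p. 15, *"Thus the activities in (2.13), and the whole sum E^{(k+1)}(X), are analytic
functions of (𝐔, 𝐉), on the space 𝐔^c_{k+1}(X, α₀, α₁). This is the analyticity statement in the inductive
assumptions."* p. 15, (1.22) p. 7, (1.33) p. 9, (1.41) p. 11, (2.16)–(2.22) p. 16, (2.27) p. 18, Lemma 3 (2.38) p. 20,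
(2.41) p. 21 with *"The inequality (2.41) and the assumptions imply the inequality (I.1.18)"* p. 21, *"Next, we assume
that O(1)C₃ε₁ ≤ ½E₀"* p. 21, (1.24) p. 7, p. 8 (the sum over j ≤ k of the age factors: *"This yields (6L)⁴Lʲη"*);
[Bałaban 1987, CMP 109 = B12] p. 258 (0.27), (0.28), (0.29)–(0.30), p. 280 (3.54).
-/

open Finset Metric Set
open scoped BigOperators

namespace Literature.MathematicalPhysics.QuantumFieldTheory.Balaban1983to89.T4ActivityRecursion

open Literature.Probability.LatticeModels
open Literature.MathematicalPhysics.QuantumFieldTheory.Balaban1983to89.T4OutputRate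
open Literature.MathematicalPhysics.QuantumFieldTheory.Balaban1983to89.T4InputCauchyRate
  (disc disc_nonneg BoundedAtScale RecursiveRate ne5_of_recursiveRate)
open Literature.MathematicalPhysics.QuantumFieldTheory.Balaban1983to89.T4InputCauchyRateData (tableA tableB mul_sum_age_shift
  sum_pow_age_le)
open Literature.MathematicalPhysics.QuantumFieldTheory.Balaban1983to89.T4ActivityLipschitz

/-! ## §1 The input pencil through a two-margin box -/

section Box

variable {E₁ E₂ : Type*} [NormedAddCommGroup E₁] [NormedSpace ℂ E₁] [NormedAddCommGroup E₂] [NormedSpace ℂ E₂]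

/-- The input pencil of a product space is the pair of the species pencils (first species). [folklore] -/
@[simp] theorem fst_inputPencil (pA pB : E₁ × E₂) (z : ℂ) :
    (inputPencil pA pB z).1 = inputPencil pA.1 pB.1 z := by
  simp [inputPencil]

/-- The input pencil of a product space is the pair of the species pencils (second species). [folklore] -/
@[simp] theorem snd_inputPencil (pA pB : E₁ × E₂) (z : ℂ) :
    (inputPencil pA pB z).2 = inputPencil pA.2 pB.2 z := by
  simp [inputPencil]

/-- RADIUS × SPECIES DISCREPANCY ≤ SPECIES MARGIN, for both species, keeps the pencil inside the two-margin box on the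
disc `‖z‖ < R` (the printed one-species model is (1.22) p. 7). [folklore] -/
theorem inputPencil_mem_box {pA pB : E₁ × E₂} {ϱ₁ ϱ₂ R : ℝ} (hϱ₁ : 0 < ϱ₁) (hϱ₂ : 0 < ϱ₂)
    (h₁ : R * ‖pA.1 - pB.1‖ ≤ ϱ₁) (h₂ : R * ‖pA.2 - pB.2‖ ≤ ϱ₂) {z : ℂ} (hz : ‖z‖ < R) :
    inputPencil pA pB z ∈ ball pB.1 ϱ₁ ×ˢ ball pB.2 ϱ₂ := by
  rw [Set.mem_prod, fst_inputPencil, snd_inputPencil]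
  exact ⟨inputPencil_mem_ball hϱ₁ h₁ hz, inputPencil_mem_ball hϱ₂ h₂ hz⟩

/-- The RELATIVE DISCREPANCY of two points of a two-species input space: the sum of the species discrepancies measured
in units of the species margins. [folklore] -/
noncomputable def relDisc (pA pB : E₁ × E₂) (ϱ₁ ϱ₂ : ℝ) : ℝ := ‖pA.1 - pB.1‖ / ϱ₁ + ‖pA.2 - pB.2‖ / ϱ₂

omit [NormedSpace ℂ E₁] [NormedSpace ℂ E₂] in
/-- The relative discrepancy is nonnegative. [folklore] -/
theorem relDisc_nonneg (pA pB : E₁ × E₂) {ϱ₁ ϱ₂ : ℝ} (hϱ₁ : 0 < ϱ₁) (hϱ₂ : 0 < ϱ₂) :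
    0 ≤ relDisc pA pB ϱ₁ ϱ₂ := by
  unfold relDisc; positivity

omit [NormedSpace ℂ E₁] [NormedSpace ℂ E₂] in
/-- Zero relative discrepancy means equal points. [folklore] -/
theorem eq_of_relDisc_eq_zero {pA pB : E₁ × E₂} {ϱ₁ ϱ₂ : ℝ} (hϱ₁ : 0 < ϱ₁) (hϱ₂ : 0 < ϱ₂)
    (h : relDisc pA pB ϱ₁ ϱ₂ = 0) : pA = pB := by
  unfold relDisc at h
  have h0 := (add_eq_zero_iff_of_nonneg (by positivity) (by positivity)).1 h
  have h1 : ‖pA.1 - pB.1‖ = 0 := by simpa [hϱ₁.ne'] using h0.1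
  have h2 : ‖pA.2 - pB.2‖ = 0 := by simpa [hϱ₂.ne'] using h0.2
  exact Prod.ext (sub_eq_zero.1 (norm_eq_zero.1 h1)) (sub_eq_zero.1 (norm_eq_zero.1 h2))

/-- With radius = 1 ∕ relative discrepancy the pencil fits in the box (each species pays at most the whole). [folklore] -/
theorem inputPencil_mem_box_of_relDisc {pA pB : E₁ × E₂} {ϱ₁ ϱ₂ : ℝ} (hϱ₁ : 0 < ϱ₁) (hϱ₂ : 0 < ϱ₂)
    (hρ : 0 < relDisc pA pB ϱ₁ ϱ₂) {z : ℂ} (hz : ‖z‖ < (relDisc pA pB ϱ₁ ϱ₂)⁻¹) :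
    inputPencil pA pB z ∈ ball pB.1 ϱ₁ ×ˢ ball pB.2 ϱ₂ := by
  refine inputPencil_mem_box hϱ₁ hϱ₂ ?_ ?_ hz
  · rw [inv_mul_le_iff₀ hρ]
    have : ‖pA.1 - pB.1‖ / ϱ₁ ≤ relDisc pA pB ϱ₁ ϱ₂ := le_add_of_nonneg_right (by positivity)
    rwa [div_le_iff₀ hϱ₁] at this
  · rw [inv_mul_le_iff₀ hρ]
    have : ‖pA.2 - pB.2‖ / ϱ₂ ≤ relDisc pA pB ϱ₁ ϱ₂ := le_add_of_nonneg_left (by positivity)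
    rwa [div_le_iff₀ hϱ₂] at this

end Box

/-! ## §2 Pointwise forms of the cluster-representation bounds -/

section Pointwise

variable {C : Carriers} (R : ClusterRep C)

/-- **The pinned pencil bound at one `(g, U, X)`** (the core of `ClusterRep.ne5_of_localPencil`, without budget): a
holomorphic family `z ↦ w z` of activities on the disc `‖z‖ < Rz`, `Rz > 1`, with endpoints run B's (`z = 0`) and run
A's (`z = 1`) activities on the step volume of `X`, under a `z`-uniform majorant `m` obeying the `d`-weighted KP
condition with size `a`, gives `‖outA − outB‖ ≤ a(pin X)·e^{−δ_X}/(Rz − 1)`. [folklore] -/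
theorem norm_out_sub_le_of_pencil {g : ℕ → ℝ} {U : C.BgB} {X : C.Dom} {w : ℂ → R.P → ℂ} {m a d : R.P → ℝ}
    {Rz δX : ℝ} (ha : ∀ γ, 0 ≤ a γ) (hd : ∀ γ, 0 ≤ d γ) (hRz : 1 < Rz)
    (hend : ∀ γ ∈ R.vol X, w 0 γ = R.ρB g U γ ∧ w 1 γ = R.ρA g U γ)
    (hhol : ∀ γ ∈ R.vol X, DifferentiableOn ℂ (fun z => w z γ) (ball (0 : ℂ) Rz))
    (hmaj : ∀ z : ℂ, ‖z‖ < Rz → ∀ γ ∈ R.vol X, ‖w z γ‖ ≤ m γ)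
    (hkp : ∀ γ ∈ R.vol X, ∑ γ' ∈ R.vol X with R.inc γ' γ, m γ' * Real.exp (a γ' + d γ') ≤ a γ)
    (hdec : ∀ K ∈ R.clus X, δX ≤ ∑ γ ∈ K, d γ) :
    ‖R.outA g U X - R.outB g U X‖ ≤ a (R.pin X) / (Rz - 1) * Real.exp (-δX) := by
  have hA1 : R.outA g U X = clusterSum R.inc (w 1) (R.clus X) :=
    clusterSum_congr fun K hK γ hγ => ((hend γ (R.clus_sub X K hK hγ)).2).symm
  have hB0 : R.outB g U X = clusterSum R.inc (w 0) (R.clus X) :=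
    clusterSum_congr fun K hK γ hγ => ((hend γ (R.clus_sub X K hK hγ)).1).symm
  have hKPz : ∀ z : ℂ, ‖z‖ < Rz → ∀ γ ∈ R.vol X,
      ∑ γ' ∈ R.vol X with R.inc γ' γ, ‖w z γ'‖ * Real.exp (a γ' + d γ') ≤ a γ := by
    intro z hz γ hγ
    refine le_trans (Finset.sum_le_sum fun γ' hγ' => ?_) (hkp γ hγ)
    exact mul_le_mul_of_nonneg_right (hmaj z hz γ' (Finset.mem_filter.1 hγ').1) (Real.exp_nonneg _)
  rw [hA1, hB0]
  exact norm_clusterSum_sub_le_of_family (inc := R.inc) (w := w) ha hd hRz hhol hKPz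
    (R.pin_mem X) (R.clus_sub X) (R.clus_pin X) hdec

/-- **The one-run bound at one `X`** ((2.39)–(2.41) in KP form): activities under a majorant obeying the `d`-weighted KP
condition give `‖E_w(clus X)‖ ≤ a(pin X)·e^{−δ_X}`. [folklore] -/
theorem norm_clusterSum_clus_le_of_kp {X : C.Dom} {w : R.P → ℂ} {m a d : R.P → ℝ} {δX : ℝ}
    (ha : ∀ γ, 0 ≤ a γ) (hd : ∀ γ, 0 ≤ d γ) (hmaj : ∀ γ ∈ R.vol X, ‖w γ‖ ≤ m γ)
    (hkp : ∀ γ ∈ R.vol X, ∑ γ' ∈ R.vol X with R.inc γ' γ, m γ' * Real.exp (a γ' + d γ') ≤ a γ)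
    (hdec : ∀ K ∈ R.clus X, δX ≤ ∑ γ ∈ K, d γ) :
    ‖clusterSum R.inc w (R.clus X)‖ ≤ a (R.pin X) * Real.exp (-δX) := by
  have hKP : ∀ γ ∈ R.vol X, ∑ γ' ∈ R.vol X with R.inc γ' γ, ‖w γ'‖ * Real.exp (a γ' + d γ') ≤ a γ := by
    intro γ hγ
    refine le_trans (Finset.sum_le_sum fun γ' hγ' => ?_) (hkp γ hγ)
    exact mul_le_mul_of_nonneg_right (hmaj γ' (Finset.mem_filter.1 hγ').1) (Real.exp_nonneg _)
  exact norm_clusterSum_le_of_kp ha hd hKP (R.pin_mem X) (R.clus_sub X) (R.clus_pin X) hdec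

end Pointwise

/-! ## §3 The two-species input model over a cluster representation and its hypothesis shapes -/

section Model

variable {C : Carriers}

/-- HYPOTHESIS-CARRYING DATA (no inequality inside): the TWO-SPECIES INPUT MODEL of a cluster representation `R`.
`Ψ g U X γ (o, h)` = the activity of the polymer `γ` (of the step volume of `X`) as a function of the operator input `o`
and the inserted history `h` read at `X`, at common data `(g, U)` (printed TYPE, one run: B13 (2.14) p. 15 — the
resummed activity is an analytic function of the configuration (𝐔, 𝐉) and of the complex parameters σ(Z), τ multiplying
the operators and the potentials, the potentials being the inserted earlier actions (1.33) p. 9 / (1.41) p. 11);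
`opA`, `opB` = the two runs' operator inputs at `X` (run A read at the transported background); `insA`, `insB` = the two
runs' HISTORY INSERTION maps at `X` (output table ↦ inserted history datum); `Base g U X` = the one-run admissible class
(B13's inductive hypotheses, conditions I.(i)–(iii) p. 15); `ϱOp X`, `ϱHist X` = the two analyticity MARGINS (operator
perturbations (2.16)–(2.17) p. 16; the radii |σ(Z)|, |τ(Y)| of the complex parameters of the potentials, (2.18) p. 16,
an inverse of the inductive bound (I.1.18) of the earlier actions, with slack).
The sibling's `T4InputCauchyRateData.StepModel` is the same discipline one level up (ONE output functional instead of
the activities). [folklore] -/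
structure InputModel (R : ClusterRep C) (Op Hist : Type*) [NormedAddCommGroup Op] [NormedSpace ℂ Op]
    [NormedAddCommGroup Hist] [NormedSpace ℂ Hist] where
  /-- the activities of the step volume of `X` as functions of the two-species input read at `X` -/
  Ψ : (ℕ → ℝ) → C.BgB → C.Dom → R.P → Op × Hist → ℂ
  /-- run A's operator input at `X` (at coupling sequence `g`, transported background) -/
  opA : (ℕ → ℝ) → C.BgB → C.Dom → Op
  /-- run B's operator input at `X` -/
  opB : (ℕ → ℝ) → C.BgB → C.Dom → Op
  /-- run A's history insertion at `X`: earlier-output table ↦ inserted history datum -/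
  insA : (ℕ → ℝ) → C.BgB → C.Dom → (C.Dom → ℝ) → Hist
  /-- run B's history insertion at `X` -/
  insB : (ℕ → ℝ) → C.BgB → C.Dom → (C.Dom → ℝ) → Hist
  /-- the one-run admissible class of inputs at `X` -/
  Base : (ℕ → ℝ) → C.BgB → C.Dom → Set (Op × Hist)
  /-- operator margin at `X` -/
  ϱOp : C.Dom → ℝ
  /-- history margin at `X` -/
  ϱHist : C.Dom → ℝ
  ϱOp_pos : ∀ X, 0 < ϱOp X
  ϱHist_pos : ∀ X, 0 < ϱHist X

namespace InputModel

variable {R : ClusterRep C} {Op Hist : Type*} [NormedAddCommGroup Op] [NormedSpace ℂ Op] [NormedAddCommGroup Hist]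
  [NormedSpace ℂ Hist] (M : InputModel R Op Hist)

/-- Run A's input point at `X`: its operator input and the insertion of its OWN output table. [folklore] -/
def pointA (EA : Functional C C.BgA) (g : ℕ → ℝ) (U : C.BgB) (X : C.Dom) : Op × Hist :=
  (M.opA g U X, M.insA g U X (tableA EA g U))

/-- Run B's input point at `X`. [folklore] -/
def pointB (EB : Functional C C.BgB) (g : ℕ → ℝ) (U : C.BgB) (X : C.Dom) : Op × Hist :=
  (M.opB g U X, M.insB g U X (tableB EB g U))

/-- The two-margin (open) box around an input point at `X`. [folklore] -/
def box (X : C.Dom) (p : Op × Hist) : Set (Op × Hist) := ball p.1 (M.ϱOp X) ×ˢ ball p.2 (M.ϱHist X)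

/-- A point lies in its own box. [folklore] -/
theorem mem_box_self (X : C.Dom) (p : Op × Hist) : p ∈ M.box X p :=
  Set.mem_prod.2 ⟨mem_ball_self (M.ϱOp_pos X), mem_ball_self (M.ϱHist_pos X)⟩

/-- HYPOTHESIS SHAPE `Realizes` (two-run bookkeeping, cell MI-R — NOT PRINTED for two runs; printed SUPPORT for one run:
B13 (2.13)–(2.14) pp. 14–15, the activities ARE functions of the step's operators and inserted potentials): on the
window, in the step volume of every `X`, the representation's run-B activities are the values of `Ψ` at run B's own
input point and its run-A activities (at the transported background) the values of THE SAME `Ψ` at run A's own input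
point — the two lattice spacings differ in the DATA, not in the functional form (B13 (1.5) p. 3: the construction depends
on the operators only through their bounds). [cite: Balaban1988RG2Cluster, (2.14) p.15] -/
def Realizes (EA : Functional C C.BgA) (EB : Functional C C.BgB) (W : Set (ℕ → ℝ)) : Prop :=
  ∀ g ∈ W, ∀ (U : C.BgB) (X : C.Dom), ∀ γ ∈ R.vol X,
    M.Ψ g U X γ (M.pointB EB g U X) = R.ρB g U γ ∧ M.Ψ g U X γ (M.pointA EA g U X) = R.ρA g U γ

/-- HYPOTHESIS SHAPE `InBase` (printed for ONE run: B13 p. 22 closes the inductive hypotheses for the new action; here a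
binder): run B's input point at every `X` is admissible. [cite: Balaban1988RG2Cluster, p.22] -/
def InBase (EB : Functional C C.BgB) (W : Set (ℕ → ℝ)) : Prop :=
  ∀ g ∈ W, ∀ (U : C.BgB) (X : C.Dom), M.pointB EB g U X ∈ M.Base g U X

/-- HYPOTHESIS SHAPE `BoxKP` (= the activity-level face G-ne5p2-3 of the cell's ONE located input gap ≡ G-ne5p1-1′;
NOT PRINTED as a statement, asserted nowhere).  Around EVERY admissible input point, on the two-margin complex box, the
activities of the step volume of `X` are complex differentiable in the input and bounded by ONE one-run majorant
`m g U γ`, which obeys the `d`-weighted Kotecký–Preiss condition with size function `a` in the step volume; `a, d ≥ 0`.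
Printed TYPE: B13 (2.14) p. 15 *"We consider it as an analytic function of (𝐔, 𝐉) in the space 𝐔^c_{k+1}(X, α₀, α₁),
and of the complex parameters σ(Z), τ."*; printed one-run SIZE: Lemma 3 (2.38) p. 20 *"|H(Z)| ≤ C₃ε₁ exp(−(1 − 8δ)½Lκ
d_{k+1}(Z))"* with *"The above lemma implies that sufficient conditions for convergence of the series (2.12), (2.13) are
satisfied"* (p. 20) — the tree certifies (2.38) ⇒ KP in the printed letters (`B13Resummation.kp_condition`).  What is NOT
printed is Lemma 3 RE-RUN for the activities as functions of complex two-species inputs filling the box between two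
lattice spacings. [cite: Balaban1988RG2Cluster, Lemma 3 (2.38) p.20] -/
def BoxKP (W : Set (ℕ → ℝ)) (m : (ℕ → ℝ) → C.BgB → R.P → ℝ) (a d : R.P → ℝ) : Prop :=
  (∀ γ, 0 ≤ a γ) ∧ (∀ γ, 0 ≤ d γ) ∧
    ∀ g ∈ W, ∀ (U : C.BgB) (X : C.Dom),
      (∀ p ∈ M.Base g U X,
        (∀ γ ∈ R.vol X, DifferentiableOn ℂ (M.Ψ g U X γ) (M.box X p)) ∧
        (∀ q ∈ M.box X p, ∀ γ ∈ R.vol X, ‖M.Ψ g U X γ q‖ ≤ m g U γ)) ∧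
      (∀ γ ∈ R.vol X, ∑ γ' ∈ R.vol X with R.inc γ' γ, m g U γ' * Real.exp (a γ' + d γ') ≤ a γ)

/-- HYPOTHESIS SHAPE `OperatorRate δ θ` (= the cell's NE2 ∧ NE3 read at `X` in OPERATOR-MARGIN units; NOT PRINTED — nodes
U1b / O3's): the two runs' operator inputs at `X` differ by at most `δθ^{scale X}` operator margins.  Printed MODEL of a
margin-unit rate in another setting: [King1986] Prop. 3.8/3.9. [cite: Balaban1988RG2Cluster, (2.16)-(2.17) p.16] -/
def OperatorRate (W : Set (ℕ → ℝ)) (δ θ : ℝ) : Prop :=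
  ∀ g ∈ W, ∀ (U : C.BgB) (X : C.Dom), ‖M.opA g U X - M.opB g U X‖ ≤ δ * θ ^ C.scale X * M.ϱOp X

/-- HYPOTHESIS SHAPE `InsertionRate κ E₀ δ′ θ` (NOT PRINTED; NE2-type: the η-dependence of the RE-EXPRESSION maps through
which an old action is written as a function of the new step's fields): on every table obeying the one-run decay bound,
the two runs' insertion maps at `X` differ by at most `δ′θ^{scale X}` history margins. [cite: Balaban1988RG2Cluster, (1.33) p.9] -/
def InsertionRate (W : Set (ℕ → ℝ)) (κ E₀ δ' θ : ℝ) : Prop :=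
  ∀ g ∈ W, ∀ (U : C.BgB) (X : C.Dom) (t : C.Dom → ℝ), (∀ Y, |t Y| ≤ E₀ * Real.exp (-(κ * C.d Y))) →
    ‖M.insA g U X t - M.insB g U X t‖ ≤ δ' * θ ^ C.scale X * M.ϱHist X

/-- HYPOTHESIS SHAPE `InsertionDamped κ c ω` (= cell MI-3a, NOT PRINTED for DISCREPANCIES; printed ingredients: the
insertion is built from the previous actions (B13 (1.33) p. 9, (1.41) p. 11) and a scale-`j` action enters step `k` with
the age factor Lʲη (B13 p. 9 *"the factor Lʲη, which controls the sum over j"*; B12 p. 258 (0.27))): run A's insertion at `X` is Lipschitz in the table with gain `c·ω^{scale X − j}` history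
margins per unit of scale-`j` discrepancy (weighted sup norm) and READS ONLY SCALES `< scale X`.  The sibling's
`StepModel.InsertionDamped` is the same shape indexed by the step.  The marginal (β-function) channel has NO damping and is
NOT covered: the coupling sequence `g` is common to both runs here (node U2 / NE4). [cite: Balaban1988RG2Cluster, (1.41) p.11] -/
def InsertionDamped (W : Set (ℕ → ℝ)) (κ c ω : ℝ) : Prop :=
  ∀ g ∈ W, ∀ (U : C.BgB) (X : C.Dom) (t t' : C.Dom → ℝ) (D : ℕ → ℝ), (∀ j < C.scale X, 0 ≤ D j) →
    (∀ Y, C.scale Y < C.scale X → |t Y - t' Y| ≤ D (C.scale Y) * Real.exp (-(κ * C.d Y))) →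
      ‖M.insA g U X t - M.insA g U X t'‖ ≤
        M.ϱHist X * (c * ∑ j ∈ range (C.scale X), ω ^ (C.scale X - j) * D j)

/-- ANTI-READ-OFF (as in the sibling's `StepModel.insA_eq_of_agree_below`): under `InsertionDamped` the insertion at `X`
is BLIND to the table at scales `≥ scale X`, so the degenerate reading "history input = the output table itself" is not
an instance. [folklore] -/
theorem insA_eq_of_agree_below {W : Set (ℕ → ℝ)} {κ c ω : ℝ} (h : M.InsertionDamped W κ c ω) {g : ℕ → ℝ}
    (hg : g ∈ W) (U : C.BgB) (X : C.Dom) {t t' : C.Dom → ℝ} (htt' : ∀ Y, C.scale Y < C.scale X → t Y = t' Y) :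
    M.insA g U X t = M.insA g U X t' := by
  have := h g hg U X t t' (fun _ => 0) (fun _ _ => le_rfl) (fun Y hY => by simp [htt' Y hY])
  simp only [mul_zero, sum_const_zero] at this
  exact eq_of_sub_eq_zero (norm_le_zero_iff.1 this)

/-! ## §4 The step and the closure -/

/-- **Run B's one-run bound from the box data** (kernel; (2.39)–(2.41) in KP form): `Represents` ∧ `Realizes` ∧ `InBase`
∧ `BoxKP` ∧ DECAY ∧ PIN ⇒ `DecayBound EB W A κ` (run B's input point is the centre of an admissible box). [folklore] -/
theorem decayBound_of_model {EA : Functional C C.BgA} {EB : Functional C C.BgB} {W : Set (ℕ → ℝ)}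
    {m : (ℕ → ℝ) → C.BgB → R.P → ℝ} {a d : R.P → ℝ} {δX : C.Dom → ℝ} {A κ : ℝ}
    (hrep : R.Represents EA EB) (hreal : M.Realizes EA EB W) (hbase : M.InBase EB W) (hKP : M.BoxKP W m a d)
    (hdec : R.DecayExtract δX d) (hpin : R.PinBudget a δX A κ) : DecayBound EB W A κ := by
  obtain ⟨ha, hd, hKP'⟩ := hKP
  intro g hg U X
  obtain ⟨hbox, hkp⟩ := hKP' g hg U X
  obtain ⟨-, hbd⟩ := hbox _ (hbase g hg U X)
  have hmaj : ∀ γ ∈ R.vol X, ‖R.ρB g U γ‖ ≤ m g U γ := fun γ hγ => by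
    rw [← (hreal g hg U X γ hγ).1]
    exact hbd _ (M.mem_box_self X _) γ hγ
  rw [hrep.2 g U X]
  calc |(R.outB g U X).re| ≤ ‖R.outB g U X‖ := Complex.abs_re_le_norm _
    _ ≤ a (R.pin X) * Real.exp (-(δX X)) := norm_clusterSum_clus_le_of_kp R ha hd hmaj hkp (hdec X)
    _ ≤ A * Real.exp (-(κ * C.d X)) := hpin X

/-- **THE STEP** (kernel; the two seats' kernels meet): the model hypotheses with the representation's DECAY / PIN
bookkeeping and run A's one-run envelope give the sibling's RECURSIVE BLOCK BUDGET
`RecursiveRate EA EB W κ θ ω (4A(δ + δ′)) (4Ac)`.  At a domain `X` of scale `k`, with inherited scale-`j` budgets `D_j`: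
the relative input discrepancy is `ρ ≤ δθ^k + (cΣ_{j<k} ω^{k−j}D_j + δ′θ^k)` (`OperatorRate`; `InsertionDamped` between the
two runs' tables, whose scale-`j` difference IS `D_j`; `InsertionRate` at run B's table); if `0 < ρ ≤ ½` the input pencil
of radius `1/ρ` stays in the admissible box around run B's point, the activities along it are holomorphic and under the
one-run majorant (`BoxKP`), and the pinned KP pencil bound gives `a(pin)e^{−δ_X}/(1/ρ − 1) ≤ 2ρ·A e^{−κd}`; if `ρ = 0`
the two runs' activities coincide on the step volume; if `ρ > ½` the two one-run bounds give `2A e^{−κd} < 4ρA e^{−κd}`.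
No window hypothesis is needed. [folklore] -/
theorem recursiveRate_of_model {EA : Functional C C.BgA} {EB : Functional C C.BgB} {W : Set (ℕ → ℝ)}
    {m : (ℕ → ℝ) → C.BgB → R.P → ℝ} {a d : R.P → ℝ} {δX : C.Dom → ℝ} {A A₀ E₀ κ θ δ δ' c ω : ℝ}
    (hrep : R.Represents EA EB) (hreal : M.Realizes EA EB W) (hbase : M.InBase EB W) (hKP : M.BoxKP W m a d)
    (hdec : R.DecayExtract δX d) (hpin : R.PinBudget a δX A κ)
    (hdA : DecayBound EA W A₀ κ) (hA₀ : A₀ ≤ A) (hdB : DecayBound EB W E₀ κ)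
    (hop : M.OperatorRate W δ θ) (hins : M.InsertionRate W κ E₀ δ' θ) (hdamp : M.InsertionDamped W κ c ω)
    (hω : 0 ≤ ω) : RecursiveRate EA EB W κ θ ω (4 * A * (δ + δ')) (4 * A * c) := by
  have hdB' : DecayBound EB W A κ := M.decayBound_of_model hrep hreal hbase hKP hdec hpin
  obtain ⟨ha, hd, hKP'⟩ := hKP
  intro k D hD g hg U X hX
  subst hX
  obtain ⟨hbox, hkp⟩ := hKP' g hg U X
  obtain ⟨hdiff, hbd⟩ := hbox _ (hbase g hg U X)
  have hϱ1 := M.ϱOp_pos X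
  have hϱ2 := M.ϱHist_pos X
  have hexp := Real.exp_pos (-(κ * C.d X))
  have henv : 0 ≤ A * Real.exp (-(κ * C.d X)) :=
    le_trans (mul_nonneg (ha _) (Real.exp_nonneg _)) (hpin X)
  have hA0 : 0 ≤ A := by
    by_contra hneg
    have : A * Real.exp (-(κ * C.d X)) < 0 := mul_neg_of_neg_of_pos (not_le.mp hneg) hexp
    linarith
  -- operator discrepancy in margin units (NE2 ∧ NE3 by name)
  have hxd : ‖(M.pointA EA g U X).1 - (M.pointB EB g U X).1‖ ≤ δ * θ ^ C.scale X * M.ϱOp X := hop g hg U X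
  -- history discrepancy in margin units: damped insertion of the inherited discrepancies + insertion rate
  set S := ∑ j ∈ range (C.scale X), ω ^ (C.scale X - j) * D j with hS
  have hS0 : 0 ≤ S := sum_nonneg fun j hj => mul_nonneg (pow_nonneg hω _) (hD j (mem_range.1 hj)).1
  have htab : ∀ Y, C.scale Y < C.scale X →
      |tableA EA g U Y - tableB EB g U Y| ≤ D (C.scale Y) * Real.exp (-(κ * C.d Y)) :=
    fun Y hY => (hD (C.scale Y) hY).2 g hg U Y rfl
  have hdamp' := hdamp g hg U X (tableA EA g U) (tableB EB g U) D (fun j hj => (hD j hj).1) htab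
  have hins' := hins g hg U X (tableB EB g U) (fun Y => hdB g hg U Y)
  have hyd : ‖(M.pointA EA g U X).2 - (M.pointB EB g U X).2‖ ≤ (c * S + δ' * θ ^ C.scale X) * M.ϱHist X :=
    calc ‖(M.pointA EA g U X).2 - (M.pointB EB g U X).2‖
        ≤ ‖M.insA g U X (tableA EA g U) - M.insA g U X (tableB EB g U)‖ +
            ‖M.insA g U X (tableB EB g U) - M.insB g U X (tableB EB g U)‖ :=
          norm_sub_le_norm_sub_add_norm_sub _ _ _
      _ ≤ M.ϱHist X * (c * S) + δ' * θ ^ C.scale X * M.ϱHist X := add_le_add hdamp' hins'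
      _ = (c * S + δ' * θ ^ C.scale X) * M.ϱHist X := by ring
  -- the relative discrepancy and its budget
  set ρ := relDisc (M.pointA EA g U X) (M.pointB EB g U X) (M.ϱOp X) (M.ϱHist X) with hρ_def
  have hρ0 : 0 ≤ ρ := relDisc_nonneg _ _ hϱ1 hϱ2
  have hρβ : ρ ≤ δ * θ ^ C.scale X + (c * S + δ' * θ ^ C.scale X) := by
    have h1 : ‖(M.pointA EA g U X).1 - (M.pointB EB g U X).1‖ / M.ϱOp X ≤ δ * θ ^ C.scale X := by
      rw [div_le_iff₀ hϱ1]; exact hxd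
    have h2 : ‖(M.pointA EA g U X).2 - (M.pointB EB g U X).2‖ / M.ϱHist X ≤ c * S + δ' * θ ^ C.scale X := by
      rw [div_le_iff₀ hϱ2]; exact hyd
    exact add_le_add h1 h2
  -- the two runs' outputs are the real parts of the representation's cluster sums
  have hdisc : disc EA EB g U X ≤ ‖R.outA g U X - R.outB g U X‖ := by
    unfold disc
    rw [hrep.1 g U X, hrep.2 g U X, ← Complex.sub_re]
    exact Complex.abs_re_le_norm _
  -- KEY: disc ≤ 4Aρ·e^{−κd}
  have key : disc EA EB g U X ≤ 4 * A * ρ * Real.exp (-(κ * C.d X)) := by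
    by_cases hρ : ρ ≤ 1 / 2
    · rcases hρ0.eq_or_lt with h0 | hpos
      · -- ρ = 0: the two input points coincide, hence so do the activities on the step volume
        have hpt : M.pointA EA g U X = M.pointB EB g U X := eq_of_relDisc_eq_zero hϱ1 hϱ2 h0.symm
        have hAB : R.outA g U X = R.outB g U X :=
          clusterSum_congr fun K hK γ hγ => by
            have h := hreal g hg U X γ (R.clus_sub X K hK hγ)
            rw [← h.2, ← h.1, hpt]
        calc disc EA EB g U X ≤ ‖R.outA g U X - R.outB g U X‖ := hdisc
          _ = 0 := by rw [hAB, sub_self, norm_zero]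
          _ ≤ 4 * A * ρ * Real.exp (-(κ * C.d X)) := by rw [← h0]; simp
      · -- 0 < ρ ≤ 1/2: the input pencil of radius 1/ρ through the admissible box
        have hRz : 1 < ρ⁻¹ := (one_lt_inv₀ hpos).2 (by linarith)
        have h2 : (2 : ℝ) ≤ ρ⁻¹ := by rw [le_inv_comm₀ two_pos hpos]; linarith
        have hmem : ∀ z : ℂ, ‖z‖ < ρ⁻¹ →
            inputPencil (M.pointA EA g U X) (M.pointB EB g U X) z ∈ M.box X (M.pointB EB g U X) :=
          fun z hz => inputPencil_mem_box_of_relDisc hϱ1 hϱ2 hpos hz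
        have hend : ∀ γ ∈ R.vol X,
            M.Ψ g U X γ (inputPencil (M.pointA EA g U X) (M.pointB EB g U X) 0) = R.ρB g U γ ∧
            M.Ψ g U X γ (inputPencil (M.pointA EA g U X) (M.pointB EB g U X) 1) = R.ρA g U γ := by
          intro γ hγ
          rw [inputPencil_zero, inputPencil_one]
          exact hreal g hg U X γ hγ
        have hhol : ∀ γ ∈ R.vol X, DifferentiableOn ℂ
            (fun z : ℂ => M.Ψ g U X γ (inputPencil (M.pointA EA g U X) (M.pointB EB g U X) z))
            (ball (0 : ℂ) ρ⁻¹) :=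
          fun γ hγ => (hdiff γ hγ).comp (differentiable_inputPencil _ _).differentiableOn
            fun z hz => hmem z (mem_ball_zero_iff.1 hz)
        have hmaj : ∀ z : ℂ, ‖z‖ < ρ⁻¹ → ∀ γ ∈ R.vol X,
            ‖M.Ψ g U X γ (inputPencil (M.pointA EA g U X) (M.pointB EB g U X) z)‖ ≤ m g U γ :=
          fun z hz γ hγ => hbd _ (hmem z hz) γ hγ
        have hnear := norm_out_sub_le_of_pencil R
          (w := fun z γ => M.Ψ g U X γ (inputPencil (M.pointA EA g U X) (M.pointB EB g U X) z))
          ha hd hRz hend hhol hmaj hkp (hdec X)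
        have hR1 : 0 < ρ⁻¹ - 1 := by linarith
        calc disc EA EB g U X ≤ ‖R.outA g U X - R.outB g U X‖ := hdisc
          _ ≤ a (R.pin X) / (ρ⁻¹ - 1) * Real.exp (-(δX X)) := hnear
          _ = (a (R.pin X) * Real.exp (-(δX X))) / (ρ⁻¹ - 1) := by ring
          _ ≤ (A * Real.exp (-(κ * C.d X))) / (ρ⁻¹ - 1) := div_le_div_of_nonneg_right (hpin X) hR1.le
          _ ≤ (A * Real.exp (-(κ * C.d X))) / (ρ⁻¹ / 2) :=
              div_le_div_of_nonneg_left henv (by positivity) (by linarith)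
          _ = 2 * ρ * (A * Real.exp (-(κ * C.d X))) := by
              rw [div_div_eq_mul_div, div_inv_eq_mul]; ring
          _ ≤ 4 * ρ * (A * Real.exp (-(κ * C.d X))) :=
              mul_le_mul_of_nonneg_right (by linarith) henv
          _ = 4 * A * ρ * Real.exp (-(κ * C.d X)) := by ring
    · push Not at hρ
      have hBout : |EB g U X| ≤ A * Real.exp (-(κ * C.d X)) := hdB' g hg U X
      calc disc EA EB g U X ≤ |EA g (C.transport U) X| + |EB g U X| := abs_sub _ _
        _ ≤ A₀ * Real.exp (-(κ * C.d X)) + A * Real.exp (-(κ * C.d X)) := add_le_add (hdA g hg _ X) hBout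
        _ ≤ 2 * (A * Real.exp (-(κ * C.d X))) := by
            have := mul_le_mul_of_nonneg_right hA₀ hexp.le
            linarith
        _ ≤ (4 * ρ) * (A * Real.exp (-(κ * C.d X))) := mul_le_mul_of_nonneg_right (by linarith) henv
        _ = 4 * A * ρ * Real.exp (-(κ * C.d X)) := by ring
  -- bookkeeping: 4Aρ ≤ 4A(δ + δ′)θ^k + Σ_j 4Ac·ω^{k−j}D_j
  have hsum : ∑ j ∈ range (C.scale X), 4 * A * c * ω ^ (C.scale X - j) * D j = 4 * A * c * S := by
    rw [hS, mul_sum]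
    exact sum_congr rfl fun j _ => by ring
  calc disc EA EB g U X ≤ 4 * A * ρ * Real.exp (-(κ * C.d X)) := key
    _ ≤ 4 * A * (δ * θ ^ C.scale X + (c * S + δ' * θ ^ C.scale X)) * Real.exp (-(κ * C.d X)) :=
        mul_le_mul_of_nonneg_right (mul_le_mul_of_nonneg_left hρβ (by positivity)) hexp.le
    _ = (4 * A * (δ + δ') * θ ^ C.scale X + ∑ j ∈ range (C.scale X), 4 * A * c * ω ^ (C.scale X - j) * D j) *
          Real.exp (-(κ * C.d X)) := by rw [hsum]; ring

/-- **NE5 FROM THE MODEL** (kernel; the closure is the sibling's `T4InputCauchyRate.ne5_of_recursiveRate`): with the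
smallness `(1 + 4Ac)·ω < θ` (in the model's normalisation of the history gain; in the PRINTED age normalisation —
newest previous action undamped, B13 p. 8, [I] (0.30) — the model's `c` is the natural gain divided by `ω` and the
condition reads `ω + 4Ac♮ < θ`, see `ne5_of_model_nat`: it bounds the history GAIN, which in B13's bookkeeping is `K·ν`,
`ν = O(1)C₃ε₁/E₀ ∝ ε₁`, print fixing only `ν ≤ ½` (p. 21) — an additional ε₁-restriction of the printed kind, cell
smallness item S-ne5p1-ν; v1's gloss «NOT a small-coupling condition» is withdrawn, cross-read C-pv19g4-3 O1), NE5
holds with the scale-uniform constant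
`C₅ = 4A(δ + δ′)(θ − ω) ∕ (θ − (1 + 4Ac)ω)`.  Every conditional of the cell ((B), (B^μ), BetaPertH-side windows) lives
INSIDE `W` and the hypothesis shapes of whoever instantiates the model. [folklore] -/
theorem ne5_of_model {EA : Functional C C.BgA} {EB : Functional C C.BgB} {W : Set (ℕ → ℝ)}
    {m : (ℕ → ℝ) → C.BgB → R.P → ℝ} {a d : R.P → ℝ} {δX : C.Dom → ℝ} {A A₀ E₀ κ θ δ δ' c ω : ℝ}
    (hrep : R.Represents EA EB) (hreal : M.Realizes EA EB W) (hbase : M.InBase EB W) (hKP : M.BoxKP W m a d)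
    (hdec : R.DecayExtract δX d) (hpin : R.PinBudget a δX A κ)
    (hdA : DecayBound EA W A₀ κ) (hA₀ : A₀ ≤ A) (hdB : DecayBound EB W E₀ κ)
    (hop : M.OperatorRate W δ θ) (hins : M.InsertionRate W κ E₀ δ' θ) (hdamp : M.InsertionDamped W κ c ω)
    (hA : 0 ≤ A) (hδ : 0 ≤ δ + δ') (hc : 0 ≤ c) (hω : 0 ≤ ω) (hsmall : (1 + 4 * A * c) * ω < θ) :
    NE5 EA EB W κ θ (4 * A * (δ + δ') * (θ - ω) / (θ - (1 + 4 * A * c) * ω)) :=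
  ne5_of_recursiveRate (by positivity) (by positivity) hω hsmall
    (M.recursiveRate_of_model hrep hreal hbase hKP hdec hpin hdA hA₀ hdB hop hins hdamp hω)

/-- **History-blind special case** (kernel): if run A's insertion does not read the table below the scale of `X` either
(`c = 0`), the budget has no memory term and NE5 holds with `C₅ = 4A(δ + δ′)` for any `0 ≤ ω < θ` — generation 2's
constant-rate situation (`ClusterRep.ne5_of_inputKP`, there with the sharper windowed constant `2DA`). [folklore] -/
theorem ne5_of_model_blind {EA : Functional C C.BgA} {EB : Functional C C.BgB} {W : Set (ℕ → ℝ)}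
    {m : (ℕ → ℝ) → C.BgB → R.P → ℝ} {a d : R.P → ℝ} {δX : C.Dom → ℝ} {A A₀ E₀ κ θ δ δ' ω : ℝ}
    (hrep : R.Represents EA EB) (hreal : M.Realizes EA EB W) (hbase : M.InBase EB W) (hKP : M.BoxKP W m a d)
    (hdec : R.DecayExtract δX d) (hpin : R.PinBudget a δX A κ)
    (hdA : DecayBound EA W A₀ κ) (hA₀ : A₀ ≤ A) (hdB : DecayBound EB W E₀ κ)
    (hop : M.OperatorRate W δ θ) (hins : M.InsertionRate W κ E₀ δ' θ) (hdamp : M.InsertionDamped W κ 0 ω)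
    (hA : 0 ≤ A) (hδ : 0 ≤ δ + δ') (hω : 0 ≤ ω) (hωθ : ω < θ) :
    NE5 EA EB W κ θ (4 * A * (δ + δ')) := by
  have hsmall : (1 + 4 * A * 0) * ω < θ := by simpa using hωθ
  have h := M.ne5_of_model hrep hreal hbase hKP hdec hpin hdA hA₀ hdB hop hins hdamp hA hδ le_rfl hω hsmall
  have hne : θ - ω ≠ 0 := sub_ne_zero.2 hωθ.ne'
  simpa [mul_div_assoc, div_self hne] using h

/-! ## §5 (file v1.1, ADDITIVE) No free run-B level; the PRINTED age normalisation (newest previous action UNDAMPED,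
## B13 p. 8 / [I] (0.30)): the smallness reads `ω + 4Ac < θ` -/

/-- **NE5 from the model without a free run-B level** (cross-read advisory A3 of v1): run B's one-run bound
`DecayBound EB W A κ` is implied by the box data (`decayBound_of_model`), so `InsertionRate` may be asked on tables under
the pin budget `A` and the hypothesis `hdB` disappears.  Same constant as `ne5_of_model`. [folklore] -/
theorem ne5_of_model_env {EA : Functional C C.BgA} {EB : Functional C C.BgB} {W : Set (ℕ → ℝ)}
    {m : (ℕ → ℝ) → C.BgB → R.P → ℝ} {a d : R.P → ℝ} {δX : C.Dom → ℝ} {A A₀ κ θ δ δ' c ω : ℝ}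
    (hrep : R.Represents EA EB) (hreal : M.Realizes EA EB W) (hbase : M.InBase EB W) (hKP : M.BoxKP W m a d)
    (hdec : R.DecayExtract δX d) (hpin : R.PinBudget a δX A κ)
    (hdA : DecayBound EA W A₀ κ) (hA₀ : A₀ ≤ A)
    (hop : M.OperatorRate W δ θ) (hins : M.InsertionRate W κ A δ' θ) (hdamp : M.InsertionDamped W κ c ω)
    (hA : 0 ≤ A) (hδ : 0 ≤ δ + δ') (hc : 0 ≤ c) (hω : 0 ≤ ω) (hsmall : (1 + 4 * A * c) * ω < θ) :
    NE5 EA EB W κ θ (4 * A * (δ + δ') * (θ - ω) / (θ - (1 + 4 * A * c) * ω)) :=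
  M.ne5_of_model hrep hreal hbase hKP hdec hpin hdA hA₀ (M.decayBound_of_model hrep hreal hbase hKP hdec hpin) hop hins
    hdamp hA hδ hc hω hsmall

/-- HYPOTHESIS SHAPE `InsertionDampedNat κ c ω` (the sibling's `StepModel.InsertionDampedNat` at the activity level; NOT
PRINTED for discrepancies, exactly as `InsertionDamped` = MI-3a): `InsertionDamped` with the PRINTED age exponent — the
scale-`j` table discrepancy enters run A's insertion at `X` with weight `ω^{scale X − 1 − j}`, so the NEWEST scale read
(`j = scale X − 1`) is UNDAMPED (B13 p. 8: in the sum over j ≤ k of the age factors the term j = k has Lᵏη = 1; [I] (0.30))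
and `c` is the NATURAL history gain (history margins per unit newest-scale discrepancy). [folklore] -/
def InsertionDampedNat (W : Set (ℕ → ℝ)) (κ c ω : ℝ) : Prop :=
  ∀ g ∈ W, ∀ (U : C.BgB) (X : C.Dom) (t t' : C.Dom → ℝ) (D : ℕ → ℝ), (∀ j < C.scale X, 0 ≤ D j) →
    (∀ Y, C.scale Y < C.scale X → |t Y - t' Y| ≤ D (C.scale Y) * Real.exp (-(κ * C.d Y))) →
      ‖M.insA g U X t - M.insA g U X t'‖ ≤
        M.ϱHist X * (c * ∑ j ∈ range (C.scale X), ω ^ (C.scale X - 1 - j) * D j)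

/-- **NE5 FROM THE MODEL IN THE PRINTED AGE NORMALISATION** (kernel).  With the natural history gain `c` and damping
`ω > 0` per unit of age, the load-bearing smallness is `ω + 4Ac < θ`: the artifact rate `θ` must beat the history damping
`ω` PLUS the output's Lipschitz modulus `4Ac` with respect to the newest previous action.  [analysis, cell records
`t4/T4-EST-U3-NE5-P2.md` §7 / `t4/T4-EST-NE5-P1.md` §10] In B13's bookkeeping `4Ac = K·ν` with `ν = O(1)C₃ε₁/E₀` (the
printed new-term/old-term ratio of p. 21, PROPORTIONAL TO ε₁), `K` a constant-tracking factor; print fixes only `ν ≤ ½`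
(p. 21 *"Next, we assume that O(1)C₃ε₁ ≤ ½E₀"*), so a rate `θ = L^{−a}` needs the ADDITIONAL printed-kind restriction
`Kν < L^{−a} − ω` on ε₁ (cell smallness item S-ne5p1-ν) — §6 lowers `K` by the factor `4(1 − ρ₀)`.  Constant
`C₅ = 4A(δ + δ′)(θ − ω)/(θ − (ω + 4Ac))`. [folklore] -/
theorem ne5_of_model_nat {EA : Functional C C.BgA} {EB : Functional C C.BgB} {W : Set (ℕ → ℝ)}
    {m : (ℕ → ℝ) → C.BgB → R.P → ℝ} {a d : R.P → ℝ} {δX : C.Dom → ℝ} {A A₀ E₀ κ θ δ δ' c ω : ℝ}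
    (hrep : R.Represents EA EB) (hreal : M.Realizes EA EB W) (hbase : M.InBase EB W) (hKP : M.BoxKP W m a d)
    (hdec : R.DecayExtract δX d) (hpin : R.PinBudget a δX A κ)
    (hdA : DecayBound EA W A₀ κ) (hA₀ : A₀ ≤ A) (hdB : DecayBound EB W E₀ κ)
    (hop : M.OperatorRate W δ θ) (hins : M.InsertionRate W κ E₀ δ' θ) (hdamp : M.InsertionDampedNat W κ c ω)
    (hA : 0 ≤ A) (hδ : 0 ≤ δ + δ') (hc : 0 ≤ c) (hω : 0 < ω) (hsmall : ω + 4 * A * c < θ) :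
    NE5 EA EB W κ θ (4 * A * (δ + δ') * (θ - ω) / (θ - (ω + 4 * A * c))) := by
  -- natural gain `c` at damping `ω > 0` is model gain `c/ω` (the sibling's algebraic age shift `mul_sum_age_shift`)
  have hdamp' : M.InsertionDamped W κ (c / ω) ω := fun g hg U X t t' D hD htt' => by
    have := hdamp g hg U X t t' D hD htt'
    rwa [mul_sum_age_shift hω.ne' c D] at this
  have h1 : (1 + 4 * A * (c / ω)) * ω = ω + 4 * A * c := by
    rw [add_mul, one_mul, mul_assoc (4 * A), div_mul_cancel₀ c hω.ne']
  have key := M.ne5_of_model hrep hreal hbase hKP hdec hpin hdA hA₀ hdB hop hins hdamp' hA hδ (div_nonneg hc hω.le) hω.le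
    (by rw [h1]; exact hsmall)
  rwa [h1] at key

/-! ## §6 (file v1.1, ADDITIVE) THE NEAR REGIME: the exact pencil constant `a(pin)e^{−δ_X}·ρ/(1 − ρ)` for every `ρ < 1`,
## and the recursion re-run with an A-PRIORI bound `ρ ≤ ρ₀ < 1` from the one-run decay levels — the constant `4A` of §4
## becomes `A/(1 − ρ₀)` (the activity-level twin of the sibling's `T4InputCauchyRateData` §7) -/

/-- **THE STEP IN THE NEAR REGIME** (kernel).  Same data and hypothesis shapes as `recursiveRate_of_model`, with run A's
one-run level `A₀` decoupled from the pin budget `A` (no comparison `A₀ ≤ A`); the two regimes are in the SCALE, not in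
`ρ`.  Every inherited discrepancy level may be CAPPED, `D_j ↦ min(D_j, A₀ + E₀)`, because the two one-run decay bounds
bound the table difference outright; so the history displacement at `X` of scale `k` is
`≤ cΣ_{j<k} ω^{k−j} min(D_j, A₀ + E₀) + δ′θ^k ≤ c(A₀ + E₀)ω/(1 − ω) + δ′θ^k` margins (`sum_pow_age_le`), and for `k ≥ k₀`
the relative input discrepancy is `ρ ≤ (δ + δ′)θ^{k₀} + c(A₀ + E₀)ω/(1 − ω) ≤ ρ₀ < 1` (hypothesis `hnear`).  For EVERY
`0 < ρ < 1` the input pencil of radius `1/ρ` stays in the admissible box around run B's point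
(`inputPencil_mem_box_of_relDisc`), the activities along it are holomorphic and under the one-run majorant (`BoxKP`), and the pinned KP pencil bound with
the EXACT radius (`norm_out_sub_le_of_pencil`) gives `‖outA − outB‖ ≤ a(pin)e^{−δ_X}/(1/ρ − 1) = a(pin)e^{−δ_X}·ρ/(1 − ρ)
≤ (A/(1 − ρ₀))·ρ·e^{−κd(X)}`; `ρ = 0` gives coinciding activities.  For `k < k₀` the one-run bounds give
`disc ≤ (A₀ + E₀)e^{−κd} ≤ Bθ^k e^{−κd}` (hypothesis `hfirst`; `k₀ = 0`, `B = 0` is allowed when `δ + δ′` is already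
small).  Result: `RecursiveRate EA EB W κ θ ω (A(δ + δ′)/(1 − ρ₀) + B) (Ac/(1 − ρ₀))` — the history constant `4Ac` of §4
divided by `4(1 − ρ₀)`; the first scales cost the constant `B`, never the rate. [folklore] -/
theorem recursiveRate_of_model_near {EA : Functional C C.BgA} {EB : Functional C C.BgB} {W : Set (ℕ → ℝ)}
    {m : (ℕ → ℝ) → C.BgB → R.P → ℝ} {a d : R.P → ℝ} {δX : C.Dom → ℝ} {A A₀ E₀ κ θ δ δ' c ω ρ₀ B : ℝ} {k₀ : ℕ}
    (hrep : R.Represents EA EB) (hreal : M.Realizes EA EB W) (hbase : M.InBase EB W) (hKP : M.BoxKP W m a d)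
    (hdec : R.DecayExtract δX d) (hpin : R.PinBudget a δX A κ)
    (hdA : DecayBound EA W A₀ κ) (hdB : DecayBound EB W E₀ κ)
    (hop : M.OperatorRate W δ θ) (hins : M.InsertionRate W κ E₀ δ' θ) (hdamp : M.InsertionDamped W κ c ω)
    (hδ : 0 ≤ δ + δ') (hθ : 0 ≤ θ) (hθ1 : θ ≤ 1) (hc : 0 ≤ c) (hω : 0 ≤ ω) (hω1 : ω < 1) (hρ₀ : ρ₀ < 1)
    (hnear : (δ + δ') * θ ^ k₀ + c * (A₀ + E₀) * (ω / (1 - ω)) ≤ ρ₀) (hB : 0 ≤ B)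
    (hfirst : ∀ k < k₀, A₀ + E₀ ≤ B * θ ^ k) :
    RecursiveRate EA EB W κ θ ω (A / (1 - ρ₀) * (δ + δ') + B) (A / (1 - ρ₀) * c) := by
  obtain ⟨ha, hd, hKP'⟩ := hKP
  intro k D hD g hg U X hX
  subst hX
  obtain ⟨hbox, hkp⟩ := hKP' g hg U X
  obtain ⟨hdiff, hbd⟩ := hbox _ (hbase g hg U X)
  have hϱ1 := M.ϱOp_pos X
  have hϱ2 := M.ϱHist_pos X
  have hexp := Real.exp_pos (-(κ * C.d X))
  have henv : 0 ≤ A * Real.exp (-(κ * C.d X)) :=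
    le_trans (mul_nonneg (ha _) (Real.exp_nonneg _)) (hpin X)
  have hA0 : 0 ≤ A := by
    by_contra hneg
    have : A * Real.exp (-(κ * C.d X)) < 0 := mul_neg_of_neg_of_pos (not_le.mp hneg) hexp
    linarith
  -- the one-run levels are nonnegative (read at the point at hand)
  have hEA₀ : 0 ≤ A₀ := by
    by_contra hneg
    have : A₀ * Real.exp (-(κ * C.d X)) < 0 := mul_neg_of_neg_of_pos (not_le.mp hneg) hexp
    linarith [abs_nonneg (EA g (C.transport U) X), hdA g hg (C.transport U) X]
  have hE₀ : 0 ≤ E₀ := by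
    by_contra hneg
    have : E₀ * Real.exp (-(κ * C.d X)) < 0 := mul_neg_of_neg_of_pos (not_le.mp hneg) hexp
    linarith [abs_nonneg (EB g U X), hdB g hg U X]
  have h1ρ₀ : 0 < 1 - ρ₀ := by linarith
  have hθk : 0 ≤ θ ^ C.scale X := pow_nonneg hθ _
  have hAρ : 0 ≤ A / (1 - ρ₀) := div_nonneg hA0 h1ρ₀.le
  set L := A₀ + E₀ with hL
  have hL0 : 0 ≤ L := add_nonneg hEA₀ hE₀
  -- operator discrepancy in margin units (NE2 ∧ NE3 by name)
  have hxd : ‖(M.pointA EA g U X).1 - (M.pointB EB g U X).1‖ ≤ δ * θ ^ C.scale X * M.ϱOp X := hop g hg U X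
  -- the inherited levels, capped by the one-run levels, and the two history sums
  set S := ∑ j ∈ range (C.scale X), ω ^ (C.scale X - j) * D j with hS
  set S' := ∑ j ∈ range (C.scale X), ω ^ (C.scale X - j) * min (D j) L with hS'
  have hS0 : 0 ≤ S := sum_nonneg fun j hj => mul_nonneg (pow_nonneg hω _) (hD j (mem_range.1 hj)).1
  have hS'S : S' ≤ S :=
    sum_le_sum fun j _ => mul_le_mul_of_nonneg_left (min_le_left _ _) (pow_nonneg hω _)
  have hS'L : S' ≤ L * (ω / (1 - ω)) :=
    calc S' ≤ ∑ j ∈ range (C.scale X), ω ^ (C.scale X - j) * L :=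
          sum_le_sum fun j _ => mul_le_mul_of_nonneg_left (min_le_right _ _) (pow_nonneg hω _)
      _ = (∑ j ∈ range (C.scale X), ω ^ (C.scale X - j)) * L := by rw [sum_mul]
      _ ≤ ω / (1 - ω) * L := mul_le_mul_of_nonneg_right (sum_pow_age_le hω hω1 _) hL0
      _ = L * (ω / (1 - ω)) := mul_comm _ _
  -- the two runs' tables differ by the given levels AND by the one-run levels
  have htab : ∀ Y, C.scale Y < C.scale X →
      |tableA EA g U Y - tableB EB g U Y| ≤ min (D (C.scale Y)) L * Real.exp (-(κ * C.d Y)) := by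
    intro Y hY
    have h1 : |tableA EA g U Y - tableB EB g U Y| ≤ D (C.scale Y) * Real.exp (-(κ * C.d Y)) :=
      (hD (C.scale Y) hY).2 g hg U Y rfl
    have h2 : |tableA EA g U Y - tableB EB g U Y| ≤ L * Real.exp (-(κ * C.d Y)) :=
      calc |tableA EA g U Y - tableB EB g U Y| ≤ |tableA EA g U Y| + |tableB EB g U Y| := abs_sub _ _
        _ ≤ A₀ * Real.exp (-(κ * C.d Y)) + E₀ * Real.exp (-(κ * C.d Y)) :=
            add_le_add (hdA g hg (C.transport U) Y) (hdB g hg U Y)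
        _ = L * Real.exp (-(κ * C.d Y)) := by rw [hL]; ring
    rw [min_mul_of_nonneg _ _ (Real.exp_nonneg _)]
    exact le_min h1 h2
  have hdamp' := hdamp g hg U X (tableA EA g U) (tableB EB g U) (fun j => min (D j) L)
    (fun j hj => le_min (hD j hj).1 hL0) htab
  have hins' := hins g hg U X (tableB EB g U) (fun Y => hdB g hg U Y)
  have hyd : ‖(M.pointA EA g U X).2 - (M.pointB EB g U X).2‖ ≤ (c * S' + δ' * θ ^ C.scale X) * M.ϱHist X :=
    calc ‖(M.pointA EA g U X).2 - (M.pointB EB g U X).2‖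
        ≤ ‖M.insA g U X (tableA EA g U) - M.insA g U X (tableB EB g U)‖ +
            ‖M.insA g U X (tableB EB g U) - M.insB g U X (tableB EB g U)‖ :=
          norm_sub_le_norm_sub_add_norm_sub _ _ _
      _ ≤ M.ϱHist X * (c * S') + δ' * θ ^ C.scale X * M.ϱHist X := add_le_add hdamp' hins'
      _ = (c * S' + δ' * θ ^ C.scale X) * M.ϱHist X := by ring
  -- the relative discrepancy and its two budgets (capped: a-priori size; uncapped: the recursion's currency)
  set ρ := relDisc (M.pointA EA g U X) (M.pointB EB g U X) (M.ϱOp X) (M.ϱHist X) with hρ_def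
  have hρ0 : 0 ≤ ρ := relDisc_nonneg _ _ hϱ1 hϱ2
  have hρβ' : ρ ≤ (δ + δ') * θ ^ C.scale X + c * S' := by
    have h1 : ‖(M.pointA EA g U X).1 - (M.pointB EB g U X).1‖ / M.ϱOp X ≤ δ * θ ^ C.scale X := by
      rw [div_le_iff₀ hϱ1]; exact hxd
    have h2 : ‖(M.pointA EA g U X).2 - (M.pointB EB g U X).2‖ / M.ϱHist X ≤ c * S' + δ' * θ ^ C.scale X := by
      rw [div_le_iff₀ hϱ2]; exact hyd
    have h12 : ρ ≤ δ * θ ^ C.scale X + (c * S' + δ' * θ ^ C.scale X) := add_le_add h1 h2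
    linarith
  have hρβ : ρ ≤ (δ + δ') * θ ^ C.scale X + c * S :=
    hρβ'.trans (by nlinarith [mul_le_mul_of_nonneg_left hS'S hc])
  -- the two runs' outputs are the real parts of the representation's cluster sums
  have hdisc : disc EA EB g U X ≤ ‖R.outA g U X - R.outB g U X‖ := by
    unfold disc
    rw [hrep.1 g U X, hrep.2 g U X, ← Complex.sub_re]
    exact Complex.abs_re_le_norm _
  -- the target is monotone in what we prove: it suffices to bound by (A/(1−ρ₀))((δ+δ′)θ^k + cS) + Bθ^k
  have hsum : ∑ j ∈ range (C.scale X), A / (1 - ρ₀) * c * ω ^ (C.scale X - j) * D j = A / (1 - ρ₀) * c * S := by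
    rw [hS, mul_sum]
    exact sum_congr rfl fun j _ => by ring
  have htarget : (A / (1 - ρ₀) * ((δ + δ') * θ ^ C.scale X + c * S) + B * θ ^ C.scale X) * Real.exp (-(κ * C.d X)) =
      ((A / (1 - ρ₀) * (δ + δ') + B) * θ ^ C.scale X +
        ∑ j ∈ range (C.scale X), A / (1 - ρ₀) * c * ω ^ (C.scale X - j) * D j) * Real.exp (-(κ * C.d X)) := by
    rw [hsum]; ring
  rw [← htarget]
  by_cases hk : C.scale X < k₀
  · -- first scales: the two one-run bounds, paid by the constant B
    calc disc EA EB g U X ≤ |EA g (C.transport U) X| + |EB g U X| := abs_sub _ _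
      _ ≤ A₀ * Real.exp (-(κ * C.d X)) + E₀ * Real.exp (-(κ * C.d X)) := add_le_add (hdA g hg _ X) (hdB g hg U X)
      _ = L * Real.exp (-(κ * C.d X)) := by rw [hL]; ring
      _ ≤ B * θ ^ C.scale X * Real.exp (-(κ * C.d X)) := mul_le_mul_of_nonneg_right (hfirst _ hk) hexp.le
      _ ≤ (A / (1 - ρ₀) * ((δ + δ') * θ ^ C.scale X + c * S) + B * θ ^ C.scale X) * Real.exp (-(κ * C.d X)) := by
          have h0 : 0 ≤ A / (1 - ρ₀) * ((δ + δ') * θ ^ C.scale X + c * S) :=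
            mul_nonneg hAρ (add_nonneg (mul_nonneg hδ hθk) (mul_nonneg hc hS0))
          exact mul_le_mul_of_nonneg_right (le_add_of_nonneg_left h0) hexp.le
  · -- scales k ≥ k₀: the a-priori near regime ρ ≤ ρ₀ < 1
    push Not at hk
    have hρρ₀ : ρ ≤ ρ₀ :=
      calc ρ ≤ (δ + δ') * θ ^ C.scale X + c * S' := hρβ'
        _ ≤ (δ + δ') * θ ^ k₀ + c * (L * (ω / (1 - ω))) :=
            add_le_add (mul_le_mul_of_nonneg_left (pow_le_pow_of_le_one hθ hθ1 hk) hδ)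
              (mul_le_mul_of_nonneg_left hS'L hc)
        _ = (δ + δ') * θ ^ k₀ + c * (A₀ + E₀) * (ω / (1 - ω)) := by rw [hL]; ring
        _ ≤ ρ₀ := hnear
    have key : disc EA EB g U X ≤ A / (1 - ρ₀) * ρ * Real.exp (-(κ * C.d X)) := by
      rcases hρ0.eq_or_lt with h0 | hpos
      · -- ρ = 0: the two input points coincide, hence so do the activities on the step volume
        have hpt : M.pointA EA g U X = M.pointB EB g U X := eq_of_relDisc_eq_zero hϱ1 hϱ2 h0.symm
        have hAB : R.outA g U X = R.outB g U X :=
          clusterSum_congr fun K hK γ hγ => by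
            have h := hreal g hg U X γ (R.clus_sub X K hK hγ)
            rw [← h.2, ← h.1, hpt]
        calc disc EA EB g U X ≤ ‖R.outA g U X - R.outB g U X‖ := hdisc
          _ = 0 := by rw [hAB, sub_self, norm_zero]
          _ ≤ A / (1 - ρ₀) * ρ * Real.exp (-(κ * C.d X)) := by rw [← h0]; simp
      · -- 0 < ρ ≤ ρ₀ < 1: the input pencil of the EXACT radius 1/ρ through the admissible box
        have hρ1 : ρ < 1 := hρρ₀.trans_lt hρ₀
        have hRz : 1 < ρ⁻¹ := (one_lt_inv₀ hpos).2 hρ1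
        have hmem : ∀ z : ℂ, ‖z‖ < ρ⁻¹ →
            inputPencil (M.pointA EA g U X) (M.pointB EB g U X) z ∈ M.box X (M.pointB EB g U X) :=
          fun z hz => inputPencil_mem_box_of_relDisc hϱ1 hϱ2 hpos hz
        have hend : ∀ γ ∈ R.vol X,
            M.Ψ g U X γ (inputPencil (M.pointA EA g U X) (M.pointB EB g U X) 0) = R.ρB g U γ ∧
            M.Ψ g U X γ (inputPencil (M.pointA EA g U X) (M.pointB EB g U X) 1) = R.ρA g U γ := by
          intro γ hγ
          rw [inputPencil_zero, inputPencil_one]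
          exact hreal g hg U X γ hγ
        have hhol : ∀ γ ∈ R.vol X, DifferentiableOn ℂ
            (fun z : ℂ => M.Ψ g U X γ (inputPencil (M.pointA EA g U X) (M.pointB EB g U X) z))
            (ball (0 : ℂ) ρ⁻¹) :=
          fun γ hγ => (hdiff γ hγ).comp (differentiable_inputPencil _ _).differentiableOn
            fun z hz => hmem z (mem_ball_zero_iff.1 hz)
        have hmaj : ∀ z : ℂ, ‖z‖ < ρ⁻¹ → ∀ γ ∈ R.vol X,
            ‖M.Ψ g U X γ (inputPencil (M.pointA EA g U X) (M.pointB EB g U X) z)‖ ≤ m g U γ :=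
          fun z hz γ hγ => hbd _ (hmem z hz) γ hγ
        have hpen := norm_out_sub_le_of_pencil R
          (w := fun z γ => M.Ψ g U X γ (inputPencil (M.pointA EA g U X) (M.pointB EB g U X) z))
          ha hd hRz hend hhol hmaj hkp (hdec X)
        have hR1 : 0 < ρ⁻¹ - 1 := by linarith
        have hinv : ρ⁻¹ - 1 = (1 - ρ) / ρ := by
          field_simp
        have h1ρ : 0 < 1 - ρ := by linarith
        calc disc EA EB g U X ≤ ‖R.outA g U X - R.outB g U X‖ := hdisc
          _ ≤ a (R.pin X) / (ρ⁻¹ - 1) * Real.exp (-(δX X)) := hpen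
          _ = (a (R.pin X) * Real.exp (-(δX X))) / (ρ⁻¹ - 1) := by ring
          _ ≤ (A * Real.exp (-(κ * C.d X))) / (ρ⁻¹ - 1) := div_le_div_of_nonneg_right (hpin X) hR1.le
          _ = (A * Real.exp (-(κ * C.d X))) * ρ / (1 - ρ) := by rw [hinv, div_div_eq_mul_div]
          _ ≤ (A * Real.exp (-(κ * C.d X))) * ρ / (1 - ρ₀) :=
              div_le_div_of_nonneg_left (mul_nonneg henv hρ0) h1ρ₀ (by linarith)
          _ = A / (1 - ρ₀) * ρ * Real.exp (-(κ * C.d X)) := by ring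
    calc disc EA EB g U X ≤ A / (1 - ρ₀) * ρ * Real.exp (-(κ * C.d X)) := key
      _ ≤ A / (1 - ρ₀) * ((δ + δ') * θ ^ C.scale X + c * S) * Real.exp (-(κ * C.d X)) :=
          mul_le_mul_of_nonneg_right (mul_le_mul_of_nonneg_left hρβ hAρ) hexp.le
      _ ≤ (A / (1 - ρ₀) * ((δ + δ') * θ ^ C.scale X + c * S) + B * θ ^ C.scale X) * Real.exp (-(κ * C.d X)) :=
          mul_le_mul_of_nonneg_right (le_add_of_nonneg_right (mul_nonneg hB hθk)) hexp.le

/-- **NE5 FROM THE MODEL, NEAR REGIME** (kernel).  Smallness `(1 + Ac/(1 − ρ₀))ω < θ` (model normalisation; `ω < 1`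
follows from it and `θ ≤ 1`) and, by the sibling's renewal closure `ne5_of_recursiveRate`, the scale-uniform constant
`C₅ = (A(δ + δ′)/(1 − ρ₀) + B)(θ − ω)/(θ − (1 + Ac/(1 − ρ₀))ω)`. [folklore] -/
theorem ne5_of_model_near {EA : Functional C C.BgA} {EB : Functional C C.BgB} {W : Set (ℕ → ℝ)}
    {m : (ℕ → ℝ) → C.BgB → R.P → ℝ} {a d : R.P → ℝ} {δX : C.Dom → ℝ} {A A₀ E₀ κ θ δ δ' c ω ρ₀ B : ℝ} {k₀ : ℕ}
    (hrep : R.Represents EA EB) (hreal : M.Realizes EA EB W) (hbase : M.InBase EB W) (hKP : M.BoxKP W m a d)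
    (hdec : R.DecayExtract δX d) (hpin : R.PinBudget a δX A κ)
    (hdA : DecayBound EA W A₀ κ) (hdB : DecayBound EB W E₀ κ)
    (hop : M.OperatorRate W δ θ) (hins : M.InsertionRate W κ E₀ δ' θ) (hdamp : M.InsertionDamped W κ c ω)
    (hA : 0 ≤ A) (hδ : 0 ≤ δ + δ') (hθ : 0 ≤ θ) (hθ1 : θ ≤ 1) (hc : 0 ≤ c) (hω : 0 ≤ ω) (hρ₀ : ρ₀ < 1)
    (hnear : (δ + δ') * θ ^ k₀ + c * (A₀ + E₀) * (ω / (1 - ω)) ≤ ρ₀) (hB : 0 ≤ B)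
    (hfirst : ∀ k < k₀, A₀ + E₀ ≤ B * θ ^ k) (hsmall : (1 + A / (1 - ρ₀) * c) * ω < θ) :
    NE5 EA EB W κ θ ((A / (1 - ρ₀) * (δ + δ') + B) * (θ - ω) / (θ - (1 + A / (1 - ρ₀) * c) * ω)) := by
  have h1ρ₀ : 0 < 1 - ρ₀ := by linarith
  have hb : 0 ≤ A / (1 - ρ₀) * c := mul_nonneg (div_nonneg hA h1ρ₀.le) hc
  have hω1 : ω < 1 := by nlinarith [mul_nonneg hb hω]
  exact ne5_of_recursiveRate (add_nonneg (mul_nonneg (div_nonneg hA h1ρ₀.le) hδ) hB) hb hω hsmall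
    (M.recursiveRate_of_model_near hrep hreal hbase hKP hdec hpin hdA hdB hop hins hdamp hδ hθ hθ1 hc hω hω1 hρ₀ hnear
      hB hfirst)

/-- **NE5 FROM THE MODEL IN THE PRINTED AGE NORMALISATION, NEAR REGIME** (kernel).  With the natural history gain `c`
(history margins per unit NEWEST-scale table discrepancy) at damping `ω > 0` per unit of age, the near hypothesis reads
`(δ + δ′)θ^{k₀} + c(A₀ + E₀)/(1 − ω) ≤ ρ₀ < 1` and the load-bearing smallness is `ω + Ac/(1 − ρ₀) < θ` (against
`ω + 4Ac < θ` of `ne5_of_model_nat`).  [analysis, cell records] In B13's bookkeeping `Ac/(1 − ρ₀) ≤ K′ν` with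
`K′ = λ/((λ − 1)(1 − ρ₀))` (the history box scaled by a constant factor `λ`; `→ 1⁺`), so the printed `ν ≤ ½` (p. 21)
already yields SOME positive rate exponent once the history-box scaling has room, and the ε₁-restriction of the cell's
smallness item S-ne5p1-ν sizes the exponent instead of conditioning the existence of a rate — the sibling's census v4,
reached here at the activity level with the same letters.  Constant
`C₅ = (A(δ + δ′)/(1 − ρ₀) + B)(θ − ω)/(θ − (ω + Ac/(1 − ρ₀)))`. [folklore] -/
theorem ne5_of_model_near_nat {EA : Functional C C.BgA} {EB : Functional C C.BgB} {W : Set (ℕ → ℝ)}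
    {m : (ℕ → ℝ) → C.BgB → R.P → ℝ} {a d : R.P → ℝ} {δX : C.Dom → ℝ} {A A₀ E₀ κ θ δ δ' c ω ρ₀ B : ℝ} {k₀ : ℕ}
    (hrep : R.Represents EA EB) (hreal : M.Realizes EA EB W) (hbase : M.InBase EB W) (hKP : M.BoxKP W m a d)
    (hdec : R.DecayExtract δX d) (hpin : R.PinBudget a δX A κ)
    (hdA : DecayBound EA W A₀ κ) (hdB : DecayBound EB W E₀ κ)
    (hop : M.OperatorRate W δ θ) (hins : M.InsertionRate W κ E₀ δ' θ) (hdamp : M.InsertionDampedNat W κ c ω)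
    (hA : 0 ≤ A) (hδ : 0 ≤ δ + δ') (hθ : 0 ≤ θ) (hθ1 : θ ≤ 1) (hc : 0 ≤ c) (hω : 0 < ω) (hρ₀ : ρ₀ < 1)
    (hnear : (δ + δ') * θ ^ k₀ + c * (A₀ + E₀) / (1 - ω) ≤ ρ₀) (hB : 0 ≤ B)
    (hfirst : ∀ k < k₀, A₀ + E₀ ≤ B * θ ^ k) (hsmall : ω + A / (1 - ρ₀) * c < θ) :
    NE5 EA EB W κ θ ((A / (1 - ρ₀) * (δ + δ') + B) * (θ - ω) / (θ - (ω + A / (1 - ρ₀) * c))) := by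
  have hdamp' : M.InsertionDamped W κ (c / ω) ω := fun g hg U X t t' D hD htt' => by
    have := hdamp g hg U X t t' D hD htt'
    rwa [mul_sum_age_shift hω.ne' c D] at this
  have h1 : (1 + A / (1 - ρ₀) * (c / ω)) * ω = ω + A / (1 - ρ₀) * c := by
    rw [add_mul, one_mul, mul_assoc (A / (1 - ρ₀)), div_mul_cancel₀ c hω.ne']
  have h2 : c / ω * (A₀ + E₀) * (ω / (1 - ω)) = c * (A₀ + E₀) / (1 - ω) := by
    rw [← mul_div_assoc, div_mul_eq_mul_div, div_mul_cancel₀ _ hω.ne']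
  have key := M.ne5_of_model_near hrep hreal hbase hKP hdec hpin hdA hdB hop hins hdamp' hA hδ hθ hθ1
    (div_nonneg hc hω.le) hω.le hρ₀ (by rw [h2]; exact hnear) hB hfirst (by rw [h1]; exact hsmall)
  rwa [h1] at key

end InputModel

end Model

/-! ## §7 (file v1.2, ADDITIVE) SCALE RESOLUTION at the activity level: the discrepancy shape `InsertionDampedNat`
## (MI-3a, printed age normalisation) ⟺ BLINDNESS ∧ the DISPLAYED SINGLE-SCALE TERM for affine insertions; NE5 from
## printed STRUCTURE (affinity, blindness, real homogeneity) + the single-scale term at ONE level (`InsScaleBound`) -/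

section ScaleResolution

variable {C : Carriers}

namespace InputModel

open Literature.MathematicalPhysics.QuantumFieldTheory.Balaban1983to89.T4InputCauchyRateData (sliceAt belowScale
  sliceAt_apply_of_eq sliceAt_apply_of_ne belowScale_apply_of_lt belowScale_eq_sum_sliceAt)

variable {R : ClusterRep C} {Op Hist : Type*} [NormedAddCommGroup Op] [NormedSpace ℂ Op] [NormedAddCommGroup Hist]
  [NormedSpace ℂ Hist] (M : InputModel R Op Hist)

/-- HYPOTHESIS SHAPE `InsAffine` (printed STRUCTURE, the sibling's `StepModel.InsAffine` at the activity level: the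
history insertion at `X` is AFFINE in the earlier-output table — B13 Lemma 1 (1.33) p. 9: the earlier actions enter the
fluctuation-field action as a SUM, and every localisation operation (1.22)–(1.24) p. 7 is linear in each E^{(j)}):
differences of inserted histories depend only on the difference of the tables. [folklore] -/
def InsAffine (W : Set (ℕ → ℝ)) : Prop :=
  ∀ g ∈ W, ∀ (U : C.BgB) (X : C.Dom) (t t' : C.Dom → ℝ),
    M.insA g U X t - M.insA g U X t' = M.insA g U X (t - t') - M.insA g U X 0

/-- HYPOTHESIS SHAPE `InsBlind` (printed STRUCTURE — causality of the recursion, the sibling's `StepModel.InsBlind` at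
the activity level: B13 Lemma 1 (1.33) p. 9, Lemma 2 (1.41) p. 11; B12 (0.28)–(0.30) p. 258): run A's insertion at `X`
reads only the table entries of scales `< scale X`.  A CONSEQUENCE of `InsertionDamped(Nat)` (`insA_eq_of_agree_below`,
`insBlind_of_insertionDampedNat`); the single-scale shapes below do not contain it, so it is a binder of its own.
[folklore] -/
def InsBlind (W : Set (ℕ → ℝ)) : Prop :=
  ∀ g ∈ W, ∀ (U : C.BgB) (X : C.Dom) (t t' : C.Dom → ℝ), (∀ Y, C.scale Y < C.scale X → t Y = t' Y) →
    M.insA g U X t = M.insA g U X t'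

/-- HYPOTHESIS SHAPE `InsHomog` (printed STRUCTURE, the sibling's `StepModel.InsHomog` at the activity level: with
`InsAffine`, the table-driven part `insA t − insA 0` is ℝ-LINEAR in the table — B13 (1.33)): real homogeneity of the
table-driven part (the real scalar acting on the complex history space through `ℝ ⊂ ℂ`). [folklore] -/
def InsHomog (W : Set (ℕ → ℝ)) : Prop :=
  ∀ g ∈ W, ∀ (U : C.BgB) (X : C.Dom) (a : ℝ) (t : C.Dom → ℝ),
    M.insA g U X (a • t) - M.insA g U X 0 = (a : ℂ) • (M.insA g U X t - M.insA g U X 0)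

/-- HYPOTHESIS SHAPE `InsScaleBoundLevel κ c ω` (the sibling's `StepModel.InsScaleBoundLevel` at the activity level:
the SINGLE-SCALE one-run size bound with an arbitrary level — the `j`-th TERM of the printed one-run sums with a
substituted level; NOT PRINTED as parametrised; printed for the actual earlier actions at the inductive level: B13 (1.24)
p. 7 (factor (Lʲη)⁵E₀), p. 8 *"This yields (6L)⁴Lʲη"*, B12 (0.29) p. 258, (3.54) p. 280): a table supported on ONE
scale `j < scale X` with entries `≤ T·e^{−κd}` displaces the history inserted at `X` by at most `c·ω^{scale X − 1 − j}·T`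
history margins. [folklore] -/
def InsScaleBoundLevel (W : Set (ℕ → ℝ)) (κ c ω : ℝ) : Prop :=
  ∀ g ∈ W, ∀ (U : C.BgB) (X : C.Dom) (t : C.Dom → ℝ) (j : ℕ) (T : ℝ), j < C.scale X → 0 ≤ T →
    (∀ Y, C.scale Y ≠ j → t Y = 0) → (∀ Y, C.scale Y = j → |t Y| ≤ T * Real.exp (-(κ * C.d Y))) →
      ‖M.insA g U X t - M.insA g U X 0‖ ≤ M.ϱHist X * (c * (ω ^ (C.scale X - 1 - j) * T))

/-- HYPOTHESIS SHAPE `InsScaleBound κ E₁ c ω` (the sibling's `StepModel.InsScaleBound` = cell gap G-ne5p1-3a″ read at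
the activity level — the residual of MI-3a after this section: the SINGLE-SCALE one-run size bound AT ONE REFERENCE
LEVEL `E₁`, in print the inductive level E₀ of the earlier actions; the DISPLAYED `j`-th term of B13 p. 8 / (1.24),
B12 (0.29)–(0.30), (3.54); NOT PRINTED as a statement about arbitrary single-scale tables): a table supported on ONE scale
`j < scale X` with entries `≤ E₁·e^{−κd}` displaces the history inserted at `X` by at most `c·ω^{scale X − 1 − j}·E₁`
history margins. [folklore] -/
def InsScaleBound (W : Set (ℕ → ℝ)) (κ E₁ c ω : ℝ) : Prop :=
  ∀ g ∈ W, ∀ (U : C.BgB) (X : C.Dom) (t : C.Dom → ℝ) (j : ℕ), j < C.scale X →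
    (∀ Y, C.scale Y ≠ j → t Y = 0) → (∀ Y, C.scale Y = j → |t Y| ≤ E₁ * Real.exp (-(κ * C.d Y))) →
      ‖M.insA g U X t - M.insA g U X 0‖ ≤ M.ϱHist X * (c * (ω ^ (C.scale X - 1 - j) * E₁))

/-- Blindness is CONTAINED in the discrepancy shape: `InsertionDampedNat ⟹ InsBlind` (all discrepancy levels `0`; no
affinity needed, the shape is already two-table). [folklore] -/
theorem insBlind_of_insertionDampedNat {W : Set (ℕ → ℝ)} {κ c ω : ℝ} (hdamp : M.InsertionDampedNat W κ c ω) :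
    M.InsBlind W := by
  intro g hg U X t t' htt'
  have h := hdamp g hg U X t t' (fun _ => 0) (fun _ _ => le_rfl) fun Y hY => by
    rw [htt' Y hY, sub_self, abs_zero, zero_mul]
  simp only [mul_zero, sum_const_zero] at h
  exact sub_eq_zero.1 (norm_le_zero_iff.1 h)

/-- The displayed single-scale term is CONTAINED in the discrepancy shape: `InsertionDampedNat κ c ω ⟹
InsScaleBoundLevel κ c ω` (second table `0`, discrepancy levels `T·𝟙_{j}`). [folklore] -/
theorem insScaleBoundLevel_of_insertionDampedNat {W : Set (ℕ → ℝ)} {κ c ω : ℝ}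
    (hdamp : M.InsertionDampedNat W κ c ω) : M.InsScaleBoundLevel W κ c ω := by
  intro g hg U X t j T hj hT hsupp hlev
  have h := hdamp g hg U X t 0 (fun i => if i = j then T else 0)
    (fun i _ => by by_cases hi : i = j <;> simp [hi, hT]) fun Y hY => by
      rw [Pi.zero_apply, sub_zero]
      by_cases hYj : C.scale Y = j
      · rw [hYj, if_pos rfl]; exact hlev Y hYj
      · rw [if_neg hYj, zero_mul, hsupp Y hYj, abs_zero]
  simp only [mul_ite, mul_zero, Finset.sum_ite_eq', Finset.mem_range, hj, if_true] at h
  exact h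

/-- Affine insertions have an ADDITIVE table-driven part. [folklore] -/
theorem insAffine_additive {W : Set (ℕ → ℝ)} (haff : M.InsAffine W) {g : ℕ → ℝ} (hg : g ∈ W) (U : C.BgB) (X : C.Dom)
    (a b : C.Dom → ℝ) : M.insA g U X (a + b) - M.insA g U X 0 =
      (M.insA g U X a - M.insA g U X 0) + (M.insA g U X b - M.insA g U X 0) := by
  have h := haff g hg U X (a + b) b
  rw [add_sub_cancel_right] at h
  rw [← h]
  abel

/-- … hence additive over finite sums of tables. [folklore] -/
theorem insAffine_map_sum {W : Set (ℕ → ℝ)} (haff : M.InsAffine W) {g : ℕ → ℝ} (hg : g ∈ W) (U : C.BgB) (X : C.Dom)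
    (s : Finset ℕ) (f : ℕ → C.Dom → ℝ) :
    M.insA g U X (∑ j ∈ s, f j) - M.insA g U X 0 = ∑ j ∈ s, (M.insA g U X (f j) - M.insA g U X 0) := by
  classical
  refine Finset.induction_on s (by simp) ?_
  intro j s hj ih
  rw [sum_insert hj, sum_insert hj, M.insAffine_additive haff hg U X, ih]

/-- **SCALE RESOLUTION OF THE DISCREPANCY SHAPE.**  An affine, blind insertion obeying the single-scale size bound with
levels obeys `InsertionDampedNat`: pass to the difference table (affinity), truncate it below `scale X` (blindness),
resolve the truncation into its scale slices (the sibling's `belowScale_eq_sum_sliceAt`, by name), push the sum through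
the additive table-driven part and add the single-scale bounds.  No sign condition on `c`, `ω`. [folklore] -/
theorem insertionDampedNat_of_scaleBoundLevel {W : Set (ℕ → ℝ)} {κ c ω : ℝ} (haff : M.InsAffine W)
    (hblind : M.InsBlind W) (hlevel : M.InsScaleBoundLevel W κ c ω) : M.InsertionDampedNat W κ c ω := by
  intro g hg U X t t' D hD htt'
  rw [haff g hg U X t t']
  have hbelow : M.insA g U X (t - t') = M.insA g U X (belowScale (C.scale X) (t - t')) :=
    hblind g hg U X (t - t') (belowScale (C.scale X) (t - t')) fun Y hY => (belowScale_apply_of_lt hY).symm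
  rw [hbelow, belowScale_eq_sum_sliceAt, M.insAffine_map_sum haff hg U X, mul_sum, mul_sum]
  refine (norm_sum_le _ _).trans (sum_le_sum fun j hj => ?_)
  have hjk : j < C.scale X := mem_range.1 hj
  refine hlevel g hg U X (sliceAt j (t - t')) j (D j) hjk (hD j hjk) (fun Y hY => sliceAt_apply_of_ne hY) fun Y hY => ?_
  have hYk : C.scale Y < C.scale X := by rw [hY]; exact hjk
  have h := htt' Y hYk
  rw [hY] at h
  rwa [sliceAt_apply_of_eq hY, Pi.sub_apply]

/-- **MI-3a ⟺ BLINDNESS ∧ THE DISPLAYED SINGLE-SCALE TERM** for affine insertions: in the printed age normalisation the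
discrepancy shape `InsertionDampedNat κ c ω` is EQUIVALENT to `InsBlind ∧ InsScaleBoundLevel κ c ω`.  So, granted the
printed structure (affinity), the activity-level face of the cell's located history gap is EXACTLY the single-scale
one-run term with levels — nothing two-run is hidden in it. [folklore] -/
theorem insertionDampedNat_iff_of_affine {W : Set (ℕ → ℝ)} {κ c ω : ℝ} (haff : M.InsAffine W) :
    M.InsertionDampedNat W κ c ω ↔ M.InsBlind W ∧ M.InsScaleBoundLevel W κ c ω :=
  ⟨fun h => ⟨M.insBlind_of_insertionDampedNat h, M.insScaleBoundLevel_of_insertionDampedNat h⟩,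
    fun h => M.insertionDampedNat_of_scaleBoundLevel haff h.1 h.2⟩

/-- The single-scale bound with levels contains the bound at any one level `E₁ ≥ 0`. [folklore] -/
theorem insScaleBound_of_insScaleBoundLevel {W : Set (ℕ → ℝ)} {κ E₁ c ω : ℝ} (hlevel : M.InsScaleBoundLevel W κ c ω)
    (hE₁ : 0 ≤ E₁) : M.InsScaleBound W κ E₁ c ω :=
  fun g hg U X t j hj hsupp hlev => hlevel g hg U X t j E₁ hj hE₁ hsupp hlev

/-- **LEVELS ⟺ ONE LEVEL by homogeneity**: for a real-homogeneous table-driven part the single-scale bound with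
levels is EQUIVALENT to the single-scale bound at ONE positive reference level `E₁` (scale the table by `E₁/T`; `T = 0`
forces the slice to vanish) — the sibling's `StepModel.insScaleBoundLevel_of_homog` is the step-indexed form of the
backward direction. [folklore] -/
theorem insScaleBoundLevel_iff_of_homog {W : Set (ℕ → ℝ)} {κ E₁ c ω : ℝ} (hhom : M.InsHomog W) (hE₁ : 0 < E₁) :
    M.InsScaleBoundLevel W κ c ω ↔ M.InsScaleBound W κ E₁ c ω := by
  refine ⟨fun h => M.insScaleBound_of_insScaleBoundLevel h hE₁.le, fun hunit => ?_⟩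
  intro g hg U X t j T hjk hT hsupp hlev
  rcases hT.eq_or_lt with hT0 | hTpos
  · have ht0 : t = 0 := funext fun Y => by
      by_cases hY : C.scale Y = j
      · have h := hlev Y hY
        rw [← hT0, zero_mul] at h
        exact abs_nonpos_iff.1 h
      · exact hsupp Y hY
    rw [ht0, sub_self, norm_zero, ← hT0, mul_zero, mul_zero, mul_zero]
  · have hq : 0 < T / E₁ := div_pos hTpos hE₁
    have hq' : 0 < E₁ / T := div_pos hE₁ hTpos
    have hone : T / E₁ * (E₁ / T) = 1 := by
      rw [div_mul_div_comm, mul_comm T E₁, div_self (mul_ne_zero hE₁.ne' hTpos.ne')]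
    have hsupp' : ∀ Y, C.scale Y ≠ j → ((E₁ / T) • t) Y = 0 := fun Y hY => by
      rw [Pi.smul_apply, smul_eq_mul, hsupp Y hY, mul_zero]
    have hlev' : ∀ Y, C.scale Y = j → |((E₁ / T) • t) Y| ≤ E₁ * Real.exp (-(κ * C.d Y)) := fun Y hY => by
      rw [Pi.smul_apply, smul_eq_mul, abs_mul, abs_of_pos hq']
      calc E₁ / T * |t Y| ≤ E₁ / T * (T * Real.exp (-(κ * C.d Y))) := mul_le_mul_of_nonneg_left (hlev Y hY) hq'.le
        _ = E₁ * Real.exp (-(κ * C.d Y)) := by rw [← mul_assoc, div_mul_cancel₀ _ hTpos.ne']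
    have hb := hunit g hg U X ((E₁ / T) • t) j hjk hsupp' hlev'
    have hh := hhom g hg U X (T / E₁) ((E₁ / T) • t)
    rw [smul_smul, hone, one_smul] at hh
    rw [hh, norm_smul, Complex.norm_real, Real.norm_eq_abs, abs_of_pos hq]
    calc T / E₁ * ‖M.insA g U X ((E₁ / T) • t) - M.insA g U X 0‖
        ≤ T / E₁ * (M.ϱHist X * (c * (ω ^ (C.scale X - 1 - j) * E₁))) := mul_le_mul_of_nonneg_left hb hq.le
      _ = M.ϱHist X * (c * (ω ^ (C.scale X - 1 - j) * T)) := by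
          have hE : T / E₁ * E₁ = T := div_mul_cancel₀ T hE₁.ne'
          calc T / E₁ * (M.ϱHist X * (c * (ω ^ (C.scale X - 1 - j) * E₁)))
              = T / E₁ * E₁ * (M.ϱHist X * (c * ω ^ (C.scale X - 1 - j))) := by ring
            _ = M.ϱHist X * (c * (ω ^ (C.scale X - 1 - j) * T)) := by rw [hE]; ring

/-- **The activity-level MI-3a from printed STRUCTURE + the displayed single-scale term at one level**:
`InsAffine ∧ InsBlind ∧ InsHomog ∧ InsScaleBound κ E₁ c ω` (`E₁ > 0`) ⟹ `InsertionDampedNat κ c ω`. [folklore] -/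
theorem insertionDampedNat_of_scaleBound {W : Set (ℕ → ℝ)} {κ E₁ c ω : ℝ} (haff : M.InsAffine W)
    (hblind : M.InsBlind W) (hhom : M.InsHomog W) (hunit : M.InsScaleBound W κ E₁ c ω) (hE₁ : 0 < E₁) :
    M.InsertionDampedNat W κ c ω :=
  M.insertionDampedNat_of_scaleBoundLevel haff hblind ((M.insScaleBoundLevel_iff_of_homog hhom hE₁).2 hunit)

/-- **MI-3a ⟺ CAUSALITY ∧ THE DISPLAYED ONE-LEVEL TERM** for affine, real-homogeneous insertions (the printed
structure): `InsertionDampedNat κ c ω ⟺ InsBlind ∧ InsScaleBound κ E₁ c ω` for every reference level `E₁ > 0`.  This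
is the activity route's typed answer to "what exactly is the located history input": granted printed linearity, the
two-table discrepancy shape carries NO content beyond causality and the one-run single-scale term at ONE level (in print:
the inductive level of the earlier actions). [folklore] -/
theorem insertionDampedNat_iff_of_affine_homog {W : Set (ℕ → ℝ)} {κ E₁ c ω : ℝ} (haff : M.InsAffine W)
    (hhom : M.InsHomog W) (hE₁ : 0 < E₁) :
    M.InsertionDampedNat W κ c ω ↔ M.InsBlind W ∧ M.InsScaleBound W κ E₁ c ω := by
  rw [M.insertionDampedNat_iff_of_affine haff, M.insScaleBoundLevel_iff_of_homog hhom hE₁]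

/-- **NE5 (near regime, printed age normalisation) FROM PRINTED STRUCTURE + THE DISPLAYED SINGLE-SCALE TERM** (kernel;
the activity-level twin of the sibling's `StepModel.ne5_of_stepModel_scale_near_nat`): the hypotheses of
`ne5_of_model_near_nat` with `InsertionDampedNat κ c ω` replaced by `InsAffine ∧ InsBlind ∧ InsHomog ∧
InsScaleBound κ E₁ c ω` (`E₁ > 0`).  Same smallness `ω + Ac/(1 − ρ₀) < θ`, same constant
`C₅ = (A(δ + δ′)/(1 − ρ₀) + B)(θ − ω)/(θ − (ω + Ac/(1 − ρ₀)))`.  After this theorem the located history input of the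
activity route is the SINGLE-SCALE ONE-LEVEL term `InsScaleBound` (the activity-level reading of the cell gap
G-ne5p1-3a″), beside the two-species box gap `BoxKP` (G-ne5p2-3) and the input rates `OperatorRate`/`InsertionRate`
(nodes U1b/U2, NE2–NE4). [folklore] -/
theorem ne5_of_model_scale_near_nat {EA : Functional C C.BgA} {EB : Functional C C.BgB} {W : Set (ℕ → ℝ)}
    {m : (ℕ → ℝ) → C.BgB → R.P → ℝ} {a d : R.P → ℝ} {δX : C.Dom → ℝ} {A A₀ E₀ E₁ κ θ δ δ' c ω ρ₀ B : ℝ} {k₀ : ℕ}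
    (hrep : R.Represents EA EB) (hreal : M.Realizes EA EB W) (hbase : M.InBase EB W) (hKP : M.BoxKP W m a d)
    (hdec : R.DecayExtract δX d) (hpin : R.PinBudget a δX A κ)
    (hdA : DecayBound EA W A₀ κ) (hdB : DecayBound EB W E₀ κ)
    (hop : M.OperatorRate W δ θ) (hins : M.InsertionRate W κ E₀ δ' θ)
    (haff : M.InsAffine W) (hblind : M.InsBlind W) (hhom : M.InsHomog W) (hunit : M.InsScaleBound W κ E₁ c ω)
    (hE₁ : 0 < E₁) (hA : 0 ≤ A) (hδ : 0 ≤ δ + δ') (hθ : 0 ≤ θ) (hθ1 : θ ≤ 1) (hc : 0 ≤ c) (hω : 0 < ω) (hρ₀ : ρ₀ < 1)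
    (hnear : (δ + δ') * θ ^ k₀ + c * (A₀ + E₀) / (1 - ω) ≤ ρ₀) (hB : 0 ≤ B)
    (hfirst : ∀ k < k₀, A₀ + E₀ ≤ B * θ ^ k) (hsmall : ω + A / (1 - ρ₀) * c < θ) :
    NE5 EA EB W κ θ ((A / (1 - ρ₀) * (δ + δ') + B) * (θ - ω) / (θ - (ω + A / (1 - ρ₀) * c))) :=
  M.ne5_of_model_near_nat hrep hreal hbase hKP hdec hpin hdA hdB hop hins
    (M.insertionDampedNat_of_scaleBound haff hblind hhom hunit hE₁) hA hδ hθ hθ1 hc hω hρ₀ hnear hB hfirst hsmall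

end InputModel

end ScaleResolution

/-! ## §8 (file v1.3, ADDITIVE) THE LIPSCHITZ CURRENCY AT THE ACTIVITY LEVEL: the analytic box wall `BoxKP` RE-TYPED as
## a one-run majorant AT ADMISSIBLE DATA (`BaseMajorant`, printed kind) ∧ the Kotecký–Preiss condition for the INFLATED
## majorant `(1 + s)m` (`KPInflated`, printed kind) ∧ a two-point ACTIVITY-LIPSCHITZ datum in margin units
## (`ActivityLipschitz Λ ρ₀`, NOT PRINTED, no analyticity); the recursion closed through the ACTIVITY pencil (entire);
## `BoxKP` PRODUCES the datum with `Λ = 1/(1 − ρ₀)` (one-variable Cauchy), so the new wall is implied by the old one -/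

section ActivityLipschitzCurrency

/-! ### §8.1 The generic consumer: ONE-endpoint majorant, INFLATED Kotecký–Preiss condition, activity pencil (entire) -/

section Generic

variable {P : Type*} [DecidableEq P] {inc : P → P → Prop} [DecidableRel inc]

/-- **Pinned Lipschitz bound for localized cluster sums — Lipschitz currency** (kernel; sharpens `T4ActivityLipschitz`'s
`norm_clusterSum_sub_le_of_majorant`: ONE endpoint under the majorant instead of both, KP for the INFLATED majorant
`(1 + s)·m` instead of the doubled one, constant `ε/(s − ε)` instead of `4ε`).  If on the KP volume `L` the activity family
`wB` is under a majorant `m`, `‖wA − wB‖ ≤ ε·m` with `0 ≤ ε < s`, and `(1 + s)·m` satisfies the `d`-weighted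
Kotecký–Preiss hypothesis [KP86, (1)/(S)] with size function `a`, then for every family `𝒞` of clusters in `L` pinned at
`γ ∈ L` and carrying `d`-weight `≥ δ`:  `|E_{wA}(𝒞) − E_{wB}(𝒞)| ≤ a(γ)·(ε/(s − ε))·e^{−δ}`.
Proof: the ACTIVITY pencil `w_z = wB + z(wA − wB)` is entire in `z` and satisfies `‖w_z‖ ≤ (1 + ‖z‖ε)·m ≤ (1 + s)·m` on
the disc `‖z‖ < s/ε`, so the pencil form `norm_clusterSum_sub_le_of_family` applies with `R = s/ε`:
`a(γ)e^{−δ}/(R − 1) = a(γ)e^{−δ}·ε/(s − ε)`; `ε = 0` means equal activities on `L`.  NO analyticity of anything but the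
affine pencil is used: the two activity families are DATA. [folklore] -/
theorem norm_clusterSum_sub_le_of_actLip [Std.Refl inc] [Std.Symm inc] {wA wB : P → ℂ} {m a d : P → ℝ}
    (ha : ∀ γ, 0 ≤ a γ) (hd : ∀ γ, 0 ≤ d γ) {L : Finset P} {ε s : ℝ} (hε : 0 ≤ ε) (hεs : ε < s)
    (hB : ∀ γ ∈ L, ‖wB γ‖ ≤ m γ) (hAB : ∀ γ ∈ L, ‖wA γ - wB γ‖ ≤ ε * m γ)
    (hKP : ∀ γ ∈ L, ∑ γ' ∈ L with inc γ' γ, (1 + s) * m γ' * Real.exp (a γ' + d γ') ≤ a γ)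
    {𝒞 : Finset (Finset P)} {γ : P} (hγ : γ ∈ L) (hsub : ∀ C ∈ 𝒞, C ⊆ L)
    (hpin : ∀ C ∈ 𝒞, KPTouches inc C γ) {δ : ℝ} (hdec : ∀ C ∈ 𝒞, δ ≤ ∑ γ' ∈ C, d γ') :
    ‖clusterSum inc wA 𝒞 - clusterSum inc wB 𝒞‖ ≤ a γ * (ε / (s - ε)) * Real.exp (-δ) := by
  rcases hε.eq_or_lt with h0 | hpos
  · -- ε = 0 : the two families agree on `L`
    have hAB' : clusterSum inc wA 𝒞 = clusterSum inc wB 𝒞 :=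
      clusterSum_congr fun C hC γ' hγ' => by
        have h := hAB γ' (hsub C hC hγ')
        rw [← h0, zero_mul, norm_le_zero_iff, sub_eq_zero] at h
        exact h
    have hz : a γ * (ε / (s - ε)) * Real.exp (-δ) = 0 := by rw [← h0]; simp
    rw [hAB', sub_self, norm_zero, hz]
  · -- 0 < ε < s : the activity pencil on the disc of radius s/ε
    have hR : 1 < s / ε := (one_lt_div hpos).2 hεs
    have hw : ∀ γ' ∈ L, DifferentiableOn ℂ (fun z => activityLine wA wB z γ') (ball (0 : ℂ) (s / ε)) := by
      intro γ' _
      simp only [activityLine_apply]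
      exact ((differentiable_const _).add (differentiable_id.mul (differentiable_const _))).differentiableOn
    have hKPz : ∀ z : ℂ, ‖z‖ < s / ε → ∀ γ₀ ∈ L,
        ∑ γ' ∈ L with inc γ' γ₀, ‖activityLine wA wB z γ'‖ * Real.exp (a γ' + d γ') ≤ a γ₀ := by
      intro z hz γ₀ hγ₀
      refine le_trans (Finset.sum_le_sum fun γ' hγ' => ?_) (hKP γ₀ hγ₀)
      have hγ'L : γ' ∈ L := (Finset.mem_filter.1 hγ').1
      refine mul_le_mul_of_nonneg_right ?_ (Real.exp_nonneg _)
      have hm0 : 0 ≤ m γ' := (norm_nonneg _).trans (hB γ' hγ'L)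
      calc ‖activityLine wA wB z γ'‖ ≤ ‖wB γ'‖ + ‖z‖ * ‖wA γ' - wB γ'‖ := norm_activityLine_le _ _ _ _
        _ ≤ m γ' + (s / ε) * (ε * m γ') :=
            add_le_add (hB γ' hγ'L) (mul_le_mul hz.le (hAB γ' hγ'L) (norm_nonneg _) (by positivity))
        _ = (1 + s) * m γ' := by rw [← mul_assoc, div_mul_cancel₀ s hpos.ne']; ring
    have key := norm_clusterSum_sub_le_of_family (inc := inc) (w := activityLine wA wB) ha hd hR hw hKPz hγ hsub
      hpin hdec
    rw [activityLine_one, activityLine_zero] at key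
    have hsε : s / ε - 1 = (s - ε) / ε := by field_simp
    calc ‖clusterSum inc wA 𝒞 - clusterSum inc wB 𝒞‖ ≤ a γ / (s / ε - 1) * Real.exp (-δ) := key
      _ = a γ * (ε / (s - ε)) * Real.exp (-δ) := by rw [hsε, div_div_eq_mul_div, mul_div_assoc]

end Generic

/-! ### §8.2 The three hypothesis shapes replacing `BoxKP`, the key rate, the recursion and the closures -/

variable {C : Carriers}

/-- HYPOTHESIS SHAPE `KPInflated R W m s a d` (printed KIND, one run; asserted nowhere): the one-run majorant `m`
INFLATED by the factor `1 + s` obeys the `d`-weighted Kotecký–Preiss condition [KP86, (1)/(S)] with size function `a`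
in every step volume, on the window `W`; `a, d ≥ 0`.  Printed one-run SIZE: B13 Lemma 3 (2.38) p. 20 *"|H(Z)| ≤ C₃ε₁
exp(−(1 − 8δ)½Lκ d_{k+1}(Z))"* with p. 20 *"The above lemma implies that sufficient conditions for convergence of the
series (2.12), (2.13) are satisfied"* and the room *"for κ sufficiently large, and ε₁ sufficiently small"* (p. 21) — the
tree certifies (2.38) ⇒ KP in the printed letters (`B13Resummation.kp_condition`); the factor `1 + s` is one more
restriction of ε₁ of the printed kind (`T4ActivityLipschitz`'s `ClusterRep.KPMajorant` is the case `s = 1`).  Tagged `[folklore]` (a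
parametrised binder, not a verbatim printed statement — cross-read convention C-pv08g4-6). [folklore] -/
def KPInflated (R : ClusterRep C) (W : Set (ℕ → ℝ)) (m : (ℕ → ℝ) → C.BgB → R.P → ℝ) (s : ℝ) (a d : R.P → ℝ) :
    Prop :=
  (∀ γ, 0 ≤ a γ) ∧ (∀ γ, 0 ≤ d γ) ∧
    ∀ g ∈ W, ∀ (U : C.BgB) (X : C.Dom), ∀ γ ∈ R.vol X,
      ∑ γ' ∈ R.vol X with R.inc γ' γ, (1 + s) * m g U γ' * Real.exp (a γ' + d γ') ≤ a γ

namespace InputModel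

variable {R : ClusterRep C} {Op Hist : Type*} [NormedAddCommGroup Op] [NormedSpace ℂ Op] [NormedAddCommGroup Hist]
  [NormedSpace ℂ Hist] (M : InputModel R Op Hist)

/-- HYPOTHESIS SHAPE `BaseMajorant W m` (printed KIND, one run — B13 Lemma 3 (2.38) p. 20 bounds the activities `H(Z)`
of ONE run at its own, admissible, data; asserted nowhere): at every ADMISSIBLE input point the activities of the step
volume of `X` are under the one-run majorant `m g U γ`.  No complex neighbourhood, no holomorphy.  (Parametrised binder,
tagged `[folklore]`; the printed locus is the one just named.) [folklore] -/
def BaseMajorant (W : Set (ℕ → ℝ)) (m : (ℕ → ℝ) → C.BgB → R.P → ℝ) : Prop :=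
  ∀ g ∈ W, ∀ (U : C.BgB) (X : C.Dom), ∀ p ∈ M.Base g U X, ∀ γ ∈ R.vol X, ‖M.Ψ g U X γ p‖ ≤ m g U γ

/-- HYPOTHESIS SHAPE `ActivityLipschitz W m Λ ρ₀` (NOT PRINTED — the RE-TYPED located wall of the activity route, cell
G-ne5p2-3′; asserted nowhere): a TWO-POINT datum, with no analyticity in it — around every admissible input point `p`,
every input point `q` within RELATIVE discrepancy `ρ(q, p) = ‖q.1 − p.1‖/ϱOp X + ‖q.2 − p.2‖/ϱHist X ≤ ρ₀` (margin
units) moves each activity of the step volume of `X` by at most `Λ·ρ(q, p)` times the one-run majorant: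
`‖Ψ(q) − Ψ(p)‖ ≤ Λ·ρ(q, p)·m`.  This is the honest consumed currency of the technique "bound output differences by
activity differences via the Kotecký–Preiss criteria": the consumer below needs nothing else of `Ψ`.  B13 prints, for ONE
run, SIZE bounds of the activities ((2.38) p. 20) and, inside their proof, operator-REPLACEMENT error terms ((2.16)–(2.22)
p. 16: *"we replace the operators by the corresponding operators with σ(Z) = 0, 𝐔 = U, 𝐉 = 0, and we estimate the
error"*, p. 15) which are majorisation devices for `|H(Z)|`, NOT a Lipschitz estimate of `H(Z)` in its inputs; a modulus
between the inputs of TWO lattice spacings is printed nowhere.  PRODUCERS: the analytic box wall `BoxKP` gives it with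
`Λ = 1/(1 − ρ₀)` by the one-variable Cauchy estimate (`activityLipschitz_of_boxKP`); a direct kernel-difference bound of
the printed kind (2.16)/(2.21) p. 16 would enter here with its own `Λ`. [folklore] -/
def ActivityLipschitz (W : Set (ℕ → ℝ)) (m : (ℕ → ℝ) → C.BgB → R.P → ℝ) (Λ ρ₀ : ℝ) : Prop :=
  ∀ g ∈ W, ∀ (U : C.BgB) (X : C.Dom), ∀ p ∈ M.Base g U X, ∀ q : Op × Hist,
    relDisc q p (M.ϱOp X) (M.ϱHist X) ≤ ρ₀ →
      ∀ γ ∈ R.vol X, ‖M.Ψ g U X γ q - M.Ψ g U X γ p‖ ≤ Λ * relDisc q p (M.ϱOp X) (M.ϱHist X) * m g U γ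

/-- **Run B's one-run bound in the Lipschitz currency** (kernel; (2.39)–(2.41) in KP form): `Represents` ∧ `Realizes` ∧
`InBase` ∧ `BaseMajorant` ∧ `KPInflated s` (`s ≥ 0`) ∧ DECAY ∧ PIN ⇒ `DecayBound EB W A κ`. [folklore] -/
theorem decayBound_of_baseMajorant {EA : Functional C C.BgA} {EB : Functional C C.BgB} {W : Set (ℕ → ℝ)}
    {m : (ℕ → ℝ) → C.BgB → R.P → ℝ} {a d : R.P → ℝ} {δX : C.Dom → ℝ} {A κ s : ℝ}
    (hrep : R.Represents EA EB) (hreal : M.Realizes EA EB W) (hbase : M.InBase EB W) (hmaj : M.BaseMajorant W m)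
    (hKP : KPInflated R W m s a d) (hs : 0 ≤ s) (hdec : R.DecayExtract δX d) (hpin : R.PinBudget a δX A κ) :
    DecayBound EB W A κ := by
  obtain ⟨ha, hd, hKP'⟩ := hKP
  intro g hg U X
  have hm : ∀ γ ∈ R.vol X, ‖R.ρB g U γ‖ ≤ m g U γ := fun γ hγ => by
    rw [← (hreal g hg U X γ hγ).1]
    exact hmaj g hg U X _ (hbase g hg U X) γ hγ
  have hkp : ∀ γ ∈ R.vol X, ∑ γ' ∈ R.vol X with R.inc γ' γ, m g U γ' * Real.exp (a γ' + d γ') ≤ a γ := by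
    intro γ hγ
    refine le_trans (Finset.sum_le_sum fun γ' hγ' => ?_) (hKP' g hg U X γ hγ)
    have hm0 : 0 ≤ m g U γ' := (norm_nonneg _).trans (hm γ' (Finset.mem_filter.1 hγ').1)
    exact mul_le_mul_of_nonneg_right (by nlinarith) (Real.exp_nonneg _)
  rw [hrep.2 g U X]
  calc |(R.outB g U X).re| ≤ ‖R.outB g U X‖ := Complex.abs_re_le_norm _
    _ ≤ a (R.pin X) * Real.exp (-(δX X)) := norm_clusterSum_clus_le_of_kp R ha hd hm hkp (hdec X)
    _ ≤ A * Real.exp (-(κ * C.d X)) := hpin X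

/-- **THE KEY BOUND in the Lipschitz currency** (kernel): at `(g, U, X)` with run B's point admissible and run A's point
within relative discrepancy `ρ ≤ ρ₀` of it, `Λρ₀ < s`:  `disc ≤ (AΛ/(s − Λρ₀))·ρ·e^{−κd(X)}` — run B's activities are
under `m` (`BaseMajorant`), run A's differ from them by `ε·m`, `ε = Λρ` (`ActivityLipschitz`), and the generic consumer
`norm_clusterSum_sub_le_of_actLip` with the pin budget gives `A e^{−κd}·ε/(s − ε) ≤ (AΛ/(s − Λρ₀))·ρ·e^{−κd}`. [folklore] -/
theorem disc_le_of_actLip {EA : Functional C C.BgA} {EB : Functional C C.BgB} {W : Set (ℕ → ℝ)}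
    {m : (ℕ → ℝ) → C.BgB → R.P → ℝ} {a d : R.P → ℝ} {δX : C.Dom → ℝ} {A κ s Λ ρ₀ : ℝ}
    (hrep : R.Represents EA EB) (hreal : M.Realizes EA EB W) (hbase : M.InBase EB W) (hmaj : M.BaseMajorant W m)
    (hKP : KPInflated R W m s a d) (hlip : M.ActivityLipschitz W m Λ ρ₀)
    (hdec : R.DecayExtract δX d) (hpin : R.PinBudget a δX A κ) (hΛ : 0 ≤ Λ) (hs : Λ * ρ₀ < s)
    {g : ℕ → ℝ} (hg : g ∈ W) (U : C.BgB) (X : C.Dom)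
    (hρ : relDisc (M.pointA EA g U X) (M.pointB EB g U X) (M.ϱOp X) (M.ϱHist X) ≤ ρ₀) :
    disc EA EB g U X ≤ A * Λ / (s - Λ * ρ₀) *
      relDisc (M.pointA EA g U X) (M.pointB EB g U X) (M.ϱOp X) (M.ϱHist X) * Real.exp (-(κ * C.d X)) := by
  obtain ⟨ha, hd, hKP'⟩ := hKP
  have hϱ1 := M.ϱOp_pos X
  have hϱ2 := M.ϱHist_pos X
  have hexp := Real.exp_pos (-(κ * C.d X))
  have henv : 0 ≤ A * Real.exp (-(κ * C.d X)) :=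
    le_trans (mul_nonneg (ha _) (Real.exp_nonneg _)) (hpin X)
  have hA0 : 0 ≤ A := by
    by_contra hneg
    have : A * Real.exp (-(κ * C.d X)) < 0 := mul_neg_of_neg_of_pos (not_le.mp hneg) hexp
    linarith
  set ρ := relDisc (M.pointA EA g U X) (M.pointB EB g U X) (M.ϱOp X) (M.ϱHist X) with hρ_def
  have hρ0 : 0 ≤ ρ := relDisc_nonneg _ _ hϱ1 hϱ2
  have hsρ₀ : 0 < s - Λ * ρ₀ := sub_pos.2 hs
  have hε0 : 0 ≤ Λ * ρ := mul_nonneg hΛ hρ0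
  have hεs : Λ * ρ < s := lt_of_le_of_lt (mul_le_mul_of_nonneg_left hρ hΛ) hs
  -- run B's activities under `m`, run A's within `Λρ·m` of them
  have hB : ∀ γ ∈ R.vol X, ‖R.ρB g U γ‖ ≤ m g U γ := fun γ hγ => by
    rw [← (hreal g hg U X γ hγ).1]
    exact hmaj g hg U X _ (hbase g hg U X) γ hγ
  have hAB : ∀ γ ∈ R.vol X, ‖R.ρA g U γ - R.ρB g U γ‖ ≤ Λ * ρ * m g U γ := fun γ hγ => by
    rw [← (hreal g hg U X γ hγ).1, ← (hreal g hg U X γ hγ).2]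
    exact hlip g hg U X _ (hbase g hg U X) _ hρ γ hγ
  have key := norm_clusterSum_sub_le_of_actLip (inc := R.inc) ha hd hε0 hεs hB hAB (hKP' g hg U X) (R.pin_mem X)
    (R.clus_sub X) (R.clus_pin X) (hdec X)
  have hdisc : disc EA EB g U X ≤ ‖R.outA g U X - R.outB g U X‖ := by
    unfold disc
    rw [hrep.1 g U X, hrep.2 g U X, ← Complex.sub_re]
    exact Complex.abs_re_le_norm _
  have hfrac : Λ * ρ / (s - Λ * ρ) ≤ Λ * ρ / (s - Λ * ρ₀) :=
    div_le_div_of_nonneg_left hε0 hsρ₀ (by nlinarith [mul_le_mul_of_nonneg_left hρ hΛ])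
  calc disc EA EB g U X ≤ ‖R.outA g U X - R.outB g U X‖ := hdisc
    _ ≤ a (R.pin X) * (Λ * ρ / (s - Λ * ρ)) * Real.exp (-(δX X)) := key
    _ = (a (R.pin X) * Real.exp (-(δX X))) * (Λ * ρ / (s - Λ * ρ)) := by ring
    _ ≤ (A * Real.exp (-(κ * C.d X))) * (Λ * ρ / (s - Λ * ρ₀)) :=
        mul_le_mul (hpin X) hfrac (div_nonneg hε0 (sub_pos.2 hεs).le) henv
    _ = A * Λ / (s - Λ * ρ₀) * ρ * Real.exp (-(κ * C.d X)) := by ring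

/-- **THE NEAR-REGIME RECURSION FROM A KEY RATE** (kernel; the bookkeeping of `recursiveRate_of_model_near` with the
analytic block abstracted into ONE hypothesis).  Suppose that at every `(g, U, X)` whose two input points are within
relative discrepancy `ρ ≤ ρ₀`, the output discrepancy is `≤ K·ρ·e^{−κd(X)}` (`hkey`, `K ≥ 0`).  With the operator rate
`δθ^k`, the insertion rate `δ′θ^k`, the damped insertion (`c`, `ω`) and the two one-run decay levels `A₀`, `E₀` capping
the inherited discrepancies, the relative discrepancy at scale `k ≥ k₀` is `≤ (δ + δ′)θ^{k₀} + c(A₀ + E₀)ω/(1 − ω) ≤ ρ₀`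
(`hnear`), the first scales cost the constant `B` (`hfirst`), and
`RecursiveRate EA EB W κ θ ω (K(δ + δ′) + B) (Kc)` follows. [folklore] -/
theorem recursiveRate_of_keyRate {EA : Functional C C.BgA} {EB : Functional C C.BgB} {W : Set (ℕ → ℝ)}
    {A₀ E₀ K κ θ δ δ' c ω ρ₀ B : ℝ} {k₀ : ℕ}
    (hdA : DecayBound EA W A₀ κ) (hdB : DecayBound EB W E₀ κ)
    (hop : M.OperatorRate W δ θ) (hins : M.InsertionRate W κ E₀ δ' θ) (hdamp : M.InsertionDamped W κ c ω)
    (hkey : ∀ g ∈ W, ∀ (U : C.BgB) (X : C.Dom),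
      relDisc (M.pointA EA g U X) (M.pointB EB g U X) (M.ϱOp X) (M.ϱHist X) ≤ ρ₀ →
        disc EA EB g U X ≤ K * relDisc (M.pointA EA g U X) (M.pointB EB g U X) (M.ϱOp X) (M.ϱHist X) *
          Real.exp (-(κ * C.d X)))
    (hK : 0 ≤ K) (hδ : 0 ≤ δ + δ') (hθ : 0 ≤ θ) (hθ1 : θ ≤ 1) (hc : 0 ≤ c) (hω : 0 ≤ ω) (hω1 : ω < 1)
    (hnear : (δ + δ') * θ ^ k₀ + c * (A₀ + E₀) * (ω / (1 - ω)) ≤ ρ₀) (hB : 0 ≤ B)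
    (hfirst : ∀ k < k₀, A₀ + E₀ ≤ B * θ ^ k) :
    RecursiveRate EA EB W κ θ ω (K * (δ + δ') + B) (K * c) := by
  intro k D hD g hg U X hX
  subst hX
  have hϱ1 := M.ϱOp_pos X
  have hϱ2 := M.ϱHist_pos X
  have hexp := Real.exp_pos (-(κ * C.d X))
  -- the one-run levels are nonnegative (read at the point at hand)
  have hEA₀ : 0 ≤ A₀ := by
    by_contra hneg
    have : A₀ * Real.exp (-(κ * C.d X)) < 0 := mul_neg_of_neg_of_pos (not_le.mp hneg) hexp
    linarith [abs_nonneg (EA g (C.transport U) X), hdA g hg (C.transport U) X]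
  have hE₀ : 0 ≤ E₀ := by
    by_contra hneg
    have : E₀ * Real.exp (-(κ * C.d X)) < 0 := mul_neg_of_neg_of_pos (not_le.mp hneg) hexp
    linarith [abs_nonneg (EB g U X), hdB g hg U X]
  have hθk : 0 ≤ θ ^ C.scale X := pow_nonneg hθ _
  set L := A₀ + E₀ with hL
  have hL0 : 0 ≤ L := add_nonneg hEA₀ hE₀
  -- operator discrepancy in margin units (NE2 ∧ NE3 by name)
  have hxd : ‖(M.pointA EA g U X).1 - (M.pointB EB g U X).1‖ ≤ δ * θ ^ C.scale X * M.ϱOp X := hop g hg U X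
  -- the inherited levels, capped by the one-run levels, and the two history sums
  set S := ∑ j ∈ range (C.scale X), ω ^ (C.scale X - j) * D j with hS
  set S' := ∑ j ∈ range (C.scale X), ω ^ (C.scale X - j) * min (D j) L with hS'
  have hS0 : 0 ≤ S := sum_nonneg fun j hj => mul_nonneg (pow_nonneg hω _) (hD j (mem_range.1 hj)).1
  have hS'S : S' ≤ S :=
    sum_le_sum fun j _ => mul_le_mul_of_nonneg_left (min_le_left _ _) (pow_nonneg hω _)
  have hS'L : S' ≤ L * (ω / (1 - ω)) :=
    calc S' ≤ ∑ j ∈ range (C.scale X), ω ^ (C.scale X - j) * L :=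
          sum_le_sum fun j _ => mul_le_mul_of_nonneg_left (min_le_right _ _) (pow_nonneg hω _)
      _ = (∑ j ∈ range (C.scale X), ω ^ (C.scale X - j)) * L := by rw [sum_mul]
      _ ≤ ω / (1 - ω) * L := mul_le_mul_of_nonneg_right (sum_pow_age_le hω hω1 _) hL0
      _ = L * (ω / (1 - ω)) := mul_comm _ _
  -- the two runs' tables differ by the given levels AND by the one-run levels
  have htab : ∀ Y, C.scale Y < C.scale X →
      |tableA EA g U Y - tableB EB g U Y| ≤ min (D (C.scale Y)) L * Real.exp (-(κ * C.d Y)) := by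
    intro Y hY
    have h1 : |tableA EA g U Y - tableB EB g U Y| ≤ D (C.scale Y) * Real.exp (-(κ * C.d Y)) :=
      (hD (C.scale Y) hY).2 g hg U Y rfl
    have h2 : |tableA EA g U Y - tableB EB g U Y| ≤ L * Real.exp (-(κ * C.d Y)) :=
      calc |tableA EA g U Y - tableB EB g U Y| ≤ |tableA EA g U Y| + |tableB EB g U Y| := abs_sub _ _
        _ ≤ A₀ * Real.exp (-(κ * C.d Y)) + E₀ * Real.exp (-(κ * C.d Y)) :=
            add_le_add (hdA g hg (C.transport U) Y) (hdB g hg U Y)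
        _ = L * Real.exp (-(κ * C.d Y)) := by rw [hL]; ring
    rw [min_mul_of_nonneg _ _ (Real.exp_nonneg _)]
    exact le_min h1 h2
  have hdamp' := hdamp g hg U X (tableA EA g U) (tableB EB g U) (fun j => min (D j) L)
    (fun j hj => le_min (hD j hj).1 hL0) htab
  have hins' := hins g hg U X (tableB EB g U) (fun Y => hdB g hg U Y)
  have hyd : ‖(M.pointA EA g U X).2 - (M.pointB EB g U X).2‖ ≤ (c * S' + δ' * θ ^ C.scale X) * M.ϱHist X :=
    calc ‖(M.pointA EA g U X).2 - (M.pointB EB g U X).2‖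
        ≤ ‖M.insA g U X (tableA EA g U) - M.insA g U X (tableB EB g U)‖ +
            ‖M.insA g U X (tableB EB g U) - M.insB g U X (tableB EB g U)‖ :=
          norm_sub_le_norm_sub_add_norm_sub _ _ _
      _ ≤ M.ϱHist X * (c * S') + δ' * θ ^ C.scale X * M.ϱHist X := add_le_add hdamp' hins'
      _ = (c * S' + δ' * θ ^ C.scale X) * M.ϱHist X := by ring
  -- the relative discrepancy and its two budgets (capped: a-priori size; uncapped: the recursion's currency)
  set ρ := relDisc (M.pointA EA g U X) (M.pointB EB g U X) (M.ϱOp X) (M.ϱHist X) with hρ_def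
  have hρ0 : 0 ≤ ρ := relDisc_nonneg _ _ hϱ1 hϱ2
  have hρβ' : ρ ≤ (δ + δ') * θ ^ C.scale X + c * S' := by
    have h1 : ‖(M.pointA EA g U X).1 - (M.pointB EB g U X).1‖ / M.ϱOp X ≤ δ * θ ^ C.scale X := by
      rw [div_le_iff₀ hϱ1]; exact hxd
    have h2 : ‖(M.pointA EA g U X).2 - (M.pointB EB g U X).2‖ / M.ϱHist X ≤ c * S' + δ' * θ ^ C.scale X := by
      rw [div_le_iff₀ hϱ2]; exact hyd
    have h12 : ρ ≤ δ * θ ^ C.scale X + (c * S' + δ' * θ ^ C.scale X) := add_le_add h1 h2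
    linarith
  have hρβ : ρ ≤ (δ + δ') * θ ^ C.scale X + c * S :=
    hρβ'.trans (by nlinarith [mul_le_mul_of_nonneg_left hS'S hc])
  -- the target is monotone in what we prove: it suffices to bound by K((δ+δ′)θ^k + cS) + Bθ^k
  have hsum : ∑ j ∈ range (C.scale X), K * c * ω ^ (C.scale X - j) * D j = K * c * S := by
    rw [hS, mul_sum]
    exact sum_congr rfl fun j _ => by ring
  have htarget : (K * ((δ + δ') * θ ^ C.scale X + c * S) + B * θ ^ C.scale X) * Real.exp (-(κ * C.d X)) =
      ((K * (δ + δ') + B) * θ ^ C.scale X +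
        ∑ j ∈ range (C.scale X), K * c * ω ^ (C.scale X - j) * D j) * Real.exp (-(κ * C.d X)) := by
    rw [hsum]; ring
  rw [← htarget]
  by_cases hk : C.scale X < k₀
  · -- first scales: the two one-run bounds, paid by the constant B
    calc disc EA EB g U X ≤ |EA g (C.transport U) X| + |EB g U X| := abs_sub _ _
      _ ≤ A₀ * Real.exp (-(κ * C.d X)) + E₀ * Real.exp (-(κ * C.d X)) := add_le_add (hdA g hg _ X) (hdB g hg U X)
      _ = L * Real.exp (-(κ * C.d X)) := by rw [hL]; ring
      _ ≤ B * θ ^ C.scale X * Real.exp (-(κ * C.d X)) := mul_le_mul_of_nonneg_right (hfirst _ hk) hexp.le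
      _ ≤ (K * ((δ + δ') * θ ^ C.scale X + c * S) + B * θ ^ C.scale X) * Real.exp (-(κ * C.d X)) := by
          have h0 : 0 ≤ K * ((δ + δ') * θ ^ C.scale X + c * S) :=
            mul_nonneg hK (add_nonneg (mul_nonneg hδ hθk) (mul_nonneg hc hS0))
          exact mul_le_mul_of_nonneg_right (le_add_of_nonneg_left h0) hexp.le
  · -- scales k ≥ k₀: the a-priori near regime ρ ≤ ρ₀, then the key rate
    push Not at hk
    have hρρ₀ : ρ ≤ ρ₀ :=
      calc ρ ≤ (δ + δ') * θ ^ C.scale X + c * S' := hρβ'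
        _ ≤ (δ + δ') * θ ^ k₀ + c * (L * (ω / (1 - ω))) :=
            add_le_add (mul_le_mul_of_nonneg_left (pow_le_pow_of_le_one hθ hθ1 hk) hδ)
              (mul_le_mul_of_nonneg_left hS'L hc)
        _ = (δ + δ') * θ ^ k₀ + c * (A₀ + E₀) * (ω / (1 - ω)) := by rw [hL]; ring
        _ ≤ ρ₀ := hnear
    calc disc EA EB g U X ≤ K * ρ * Real.exp (-(κ * C.d X)) := hkey g hg U X hρρ₀
      _ ≤ K * ((δ + δ') * θ ^ C.scale X + c * S) * Real.exp (-(κ * C.d X)) :=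
          mul_le_mul_of_nonneg_right (mul_le_mul_of_nonneg_left hρβ hK) hexp.le
      _ ≤ (K * ((δ + δ') * θ ^ C.scale X + c * S) + B * θ ^ C.scale X) * Real.exp (-(κ * C.d X)) :=
          mul_le_mul_of_nonneg_right (le_add_of_nonneg_right (mul_nonneg hB hθk)) hexp.le

/-- **THE STEP IN THE LIPSCHITZ CURRENCY** (kernel).  The data and bookkeeping of `recursiveRate_of_model_near` with the
analytic box wall `BoxKP` REPLACED by `BaseMajorant` (one-run majorant at admissible data) ∧ `KPInflated s` (KP for
`(1 + s)m`) ∧ `ActivityLipschitz Λ ρ₀` (two-point activity datum in margin units), `0 ≤ Λ`, `Λρ₀ < s`: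
`RecursiveRate EA EB W κ θ ω (AΛ(δ + δ′)/(s − Λρ₀) + B) (AΛc/(s − Λρ₀))` — the near-regime constant `A/(1 − ρ₀)` of §6
becomes `AΛ/(s − Λρ₀)`.  No holomorphy of the activities in anything is used; the only analytic object is the entire
activity pencil inside `norm_clusterSum_sub_le_of_actLip`. [folklore] -/
theorem recursiveRate_of_model_actLip {EA : Functional C C.BgA} {EB : Functional C C.BgB} {W : Set (ℕ → ℝ)}
    {m : (ℕ → ℝ) → C.BgB → R.P → ℝ} {a d : R.P → ℝ} {δX : C.Dom → ℝ} {A A₀ E₀ κ θ δ δ' c ω s Λ ρ₀ B : ℝ} {k₀ : ℕ}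
    (hrep : R.Represents EA EB) (hreal : M.Realizes EA EB W) (hbase : M.InBase EB W) (hmaj : M.BaseMajorant W m)
    (hKP : KPInflated R W m s a d) (hlip : M.ActivityLipschitz W m Λ ρ₀)
    (hdec : R.DecayExtract δX d) (hpin : R.PinBudget a δX A κ)
    (hdA : DecayBound EA W A₀ κ) (hdB : DecayBound EB W E₀ κ)
    (hop : M.OperatorRate W δ θ) (hins : M.InsertionRate W κ E₀ δ' θ) (hdamp : M.InsertionDamped W κ c ω)
    (hA : 0 ≤ A) (hΛ : 0 ≤ Λ) (hs : Λ * ρ₀ < s) (hδ : 0 ≤ δ + δ') (hθ : 0 ≤ θ) (hθ1 : θ ≤ 1) (hc : 0 ≤ c)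
    (hω : 0 ≤ ω) (hω1 : ω < 1) (hnear : (δ + δ') * θ ^ k₀ + c * (A₀ + E₀) * (ω / (1 - ω)) ≤ ρ₀) (hB : 0 ≤ B)
    (hfirst : ∀ k < k₀, A₀ + E₀ ≤ B * θ ^ k) :
    RecursiveRate EA EB W κ θ ω (A * Λ / (s - Λ * ρ₀) * (δ + δ') + B) (A * Λ / (s - Λ * ρ₀) * c) :=
  M.recursiveRate_of_keyRate hdA hdB hop hins hdamp
    (fun _ hg U X hρ => M.disc_le_of_actLip hrep hreal hbase hmaj hKP hlip hdec hpin hΛ hs hg U X hρ)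
    (div_nonneg (mul_nonneg hA hΛ) (sub_pos.2 hs).le) hδ hθ hθ1 hc hω hω1 hnear hB hfirst

/-- **NE5 FROM THE MODEL IN THE LIPSCHITZ CURRENCY** (kernel; model normalisation of the history gain).  Smallness
`(1 + AΛc/(s − Λρ₀))ω < θ`; constant `C₅ = (AΛ(δ + δ′)/(s − Λρ₀) + B)(θ − ω)/(θ − (1 + AΛc/(s − Λρ₀))ω)` by the
sibling's renewal closure `ne5_of_recursiveRate`. [folklore] -/
theorem ne5_of_model_actLip {EA : Functional C C.BgA} {EB : Functional C C.BgB} {W : Set (ℕ → ℝ)}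
    {m : (ℕ → ℝ) → C.BgB → R.P → ℝ} {a d : R.P → ℝ} {δX : C.Dom → ℝ} {A A₀ E₀ κ θ δ δ' c ω s Λ ρ₀ B : ℝ} {k₀ : ℕ}
    (hrep : R.Represents EA EB) (hreal : M.Realizes EA EB W) (hbase : M.InBase EB W) (hmaj : M.BaseMajorant W m)
    (hKP : KPInflated R W m s a d) (hlip : M.ActivityLipschitz W m Λ ρ₀)
    (hdec : R.DecayExtract δX d) (hpin : R.PinBudget a δX A κ)
    (hdA : DecayBound EA W A₀ κ) (hdB : DecayBound EB W E₀ κ)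
    (hop : M.OperatorRate W δ θ) (hins : M.InsertionRate W κ E₀ δ' θ) (hdamp : M.InsertionDamped W κ c ω)
    (hA : 0 ≤ A) (hΛ : 0 ≤ Λ) (hs : Λ * ρ₀ < s) (hδ : 0 ≤ δ + δ') (hθ : 0 ≤ θ) (hθ1 : θ ≤ 1) (hc : 0 ≤ c)
    (hω : 0 ≤ ω) (hnear : (δ + δ') * θ ^ k₀ + c * (A₀ + E₀) * (ω / (1 - ω)) ≤ ρ₀) (hB : 0 ≤ B)
    (hfirst : ∀ k < k₀, A₀ + E₀ ≤ B * θ ^ k) (hsmall : (1 + A * Λ / (s - Λ * ρ₀) * c) * ω < θ) :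
    NE5 EA EB W κ θ ((A * Λ / (s - Λ * ρ₀) * (δ + δ') + B) * (θ - ω) /
      (θ - (1 + A * Λ / (s - Λ * ρ₀) * c) * ω)) := by
  have hK : 0 ≤ A * Λ / (s - Λ * ρ₀) := div_nonneg (mul_nonneg hA hΛ) (sub_pos.2 hs).le
  have hb : 0 ≤ A * Λ / (s - Λ * ρ₀) * c := mul_nonneg hK hc
  have hω1 : ω < 1 := by nlinarith [mul_nonneg hb hω]
  exact ne5_of_recursiveRate (add_nonneg (mul_nonneg hK hδ) hB) hb hω hsmall
    (M.recursiveRate_of_model_actLip hrep hreal hbase hmaj hKP hlip hdec hpin hdA hdB hop hins hdamp hA hΛ hs hδ hθ hθ1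
      hc hω hω1 hnear hB hfirst)

/-- **NE5 FROM THE MODEL IN THE LIPSCHITZ CURRENCY, PRINTED AGE NORMALISATION** (kernel).  Natural history gain `c`
(newest previous action undamped, B13 p. 8 / [I] (0.30)) at damping `ω > 0`: near hypothesis
`(δ + δ′)θ^{k₀} + c(A₀ + E₀)/(1 − ω) ≤ ρ₀`, load-bearing smallness `ω + AΛc/(s − Λρ₀) < θ`, constant
`C₅ = (AΛ(δ + δ′)/(s − Λρ₀) + B)(θ − ω)/(θ − (ω + AΛc/(s − Λρ₀)))`. [folklore] -/
theorem ne5_of_model_actLip_nat {EA : Functional C C.BgA} {EB : Functional C C.BgB} {W : Set (ℕ → ℝ)}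
    {m : (ℕ → ℝ) → C.BgB → R.P → ℝ} {a d : R.P → ℝ} {δX : C.Dom → ℝ} {A A₀ E₀ κ θ δ δ' c ω s Λ ρ₀ B : ℝ} {k₀ : ℕ}
    (hrep : R.Represents EA EB) (hreal : M.Realizes EA EB W) (hbase : M.InBase EB W) (hmaj : M.BaseMajorant W m)
    (hKP : KPInflated R W m s a d) (hlip : M.ActivityLipschitz W m Λ ρ₀)
    (hdec : R.DecayExtract δX d) (hpin : R.PinBudget a δX A κ)
    (hdA : DecayBound EA W A₀ κ) (hdB : DecayBound EB W E₀ κ)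
    (hop : M.OperatorRate W δ θ) (hins : M.InsertionRate W κ E₀ δ' θ) (hdamp : M.InsertionDampedNat W κ c ω)
    (hA : 0 ≤ A) (hΛ : 0 ≤ Λ) (hs : Λ * ρ₀ < s) (hδ : 0 ≤ δ + δ') (hθ : 0 ≤ θ) (hθ1 : θ ≤ 1) (hc : 0 ≤ c)
    (hω : 0 < ω) (hnear : (δ + δ') * θ ^ k₀ + c * (A₀ + E₀) / (1 - ω) ≤ ρ₀) (hB : 0 ≤ B)
    (hfirst : ∀ k < k₀, A₀ + E₀ ≤ B * θ ^ k) (hsmall : ω + A * Λ / (s - Λ * ρ₀) * c < θ) :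
    NE5 EA EB W κ θ ((A * Λ / (s - Λ * ρ₀) * (δ + δ') + B) * (θ - ω) /
      (θ - (ω + A * Λ / (s - Λ * ρ₀) * c))) := by
  have hdamp' : M.InsertionDamped W κ (c / ω) ω := fun g hg U X t t' D hD htt' => by
    have := hdamp g hg U X t t' D hD htt'
    rwa [mul_sum_age_shift hω.ne' c D] at this
  have h1 : (1 + A * Λ / (s - Λ * ρ₀) * (c / ω)) * ω = ω + A * Λ / (s - Λ * ρ₀) * c := by
    rw [add_mul, one_mul, mul_assoc (A * Λ / (s - Λ * ρ₀)), div_mul_cancel₀ c hω.ne']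
  have h2 : c / ω * (A₀ + E₀) * (ω / (1 - ω)) = c * (A₀ + E₀) / (1 - ω) := by
    rw [← mul_div_assoc, div_mul_eq_mul_div, div_mul_cancel₀ _ hω.ne']
  have key := M.ne5_of_model_actLip hrep hreal hbase hmaj hKP hlip hdec hpin hdA hdB hop hins hdamp' hA hΛ hs hδ hθ hθ1
    (div_nonneg hc hω.le) hω.le (by rw [h2]; exact hnear) hB hfirst (by rw [h1]; exact hsmall)
  rwa [h1] at key

/-- **NE5 FROM PRINTED-KIND ONE-RUN DATA + THE TWO LOCATED TWO-RUN INPUTS** (kernel; the closure of the activity route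
in its honest currency): `ne5_of_model_actLip_nat` with the discrepancy shape `InsertionDampedNat` resolved by §7 into
`InsAffine ∧ InsBlind ∧ InsHomog` (printed structure) `∧ InsScaleBound κ E₁ c ω` (`E₁ > 0`, the single-scale one-level
term).  After this theorem the hypotheses of the activity route that are NOT of printed kind are exactly: the two-run
bookkeeping `Represents ∧ Realizes` (MI-R), the activity-Lipschitz datum `ActivityLipschitz` (G-ne5p2-3′), the input
rates `OperatorRate` (NE2 ∧ NE3) and `InsertionRate`, and the single-scale term `InsScaleBound` (G-ne5p1-3a″); same
smallness and constant as `ne5_of_model_actLip_nat`. [folklore] -/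
theorem ne5_of_model_actLip_scale_nat {EA : Functional C C.BgA} {EB : Functional C C.BgB} {W : Set (ℕ → ℝ)}
    {m : (ℕ → ℝ) → C.BgB → R.P → ℝ} {a d : R.P → ℝ} {δX : C.Dom → ℝ} {A A₀ E₀ E₁ κ θ δ δ' c ω s Λ ρ₀ B : ℝ}
    {k₀ : ℕ}
    (hrep : R.Represents EA EB) (hreal : M.Realizes EA EB W) (hbase : M.InBase EB W) (hmaj : M.BaseMajorant W m)
    (hKP : KPInflated R W m s a d) (hlip : M.ActivityLipschitz W m Λ ρ₀)
    (hdec : R.DecayExtract δX d) (hpin : R.PinBudget a δX A κ)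
    (hdA : DecayBound EA W A₀ κ) (hdB : DecayBound EB W E₀ κ)
    (hop : M.OperatorRate W δ θ) (hins : M.InsertionRate W κ E₀ δ' θ)
    (haff : M.InsAffine W) (hblind : M.InsBlind W) (hhom : M.InsHomog W) (hunit : M.InsScaleBound W κ E₁ c ω)
    (hE₁ : 0 < E₁) (hA : 0 ≤ A) (hΛ : 0 ≤ Λ) (hs : Λ * ρ₀ < s) (hδ : 0 ≤ δ + δ') (hθ : 0 ≤ θ) (hθ1 : θ ≤ 1)
    (hc : 0 ≤ c) (hω : 0 < ω) (hnear : (δ + δ') * θ ^ k₀ + c * (A₀ + E₀) / (1 - ω) ≤ ρ₀) (hB : 0 ≤ B)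
    (hfirst : ∀ k < k₀, A₀ + E₀ ≤ B * θ ^ k) (hsmall : ω + A * Λ / (s - Λ * ρ₀) * c < θ) :
    NE5 EA EB W κ θ ((A * Λ / (s - Λ * ρ₀) * (δ + δ') + B) * (θ - ω) /
      (θ - (ω + A * Λ / (s - Λ * ρ₀) * c))) :=
  M.ne5_of_model_actLip_nat hrep hreal hbase hmaj hKP hlip hdec hpin hdA hdB hop hins
    (M.insertionDampedNat_of_scaleBound haff hblind hhom hunit hE₁) hA hΛ hs hδ hθ hθ1 hc hω hnear hB hfirst hsmall

/-! ### §8.3 The analytic box wall PRODUCES the Lipschitz currency (one-variable Cauchy estimate): new wall ⇐ old wall -/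

/-- `BoxKP ⟹ BaseMajorant` (the centre of an admissible box is in the box). [folklore] -/
theorem baseMajorant_of_boxKP {W : Set (ℕ → ℝ)} {m : (ℕ → ℝ) → C.BgB → R.P → ℝ} {a d : R.P → ℝ}
    (hKP : M.BoxKP W m a d) : M.BaseMajorant W m :=
  fun g hg U X p hp γ hγ => ((hKP.2.2 g hg U X).1 p hp).2 p (M.mem_box_self X p) γ hγ

/-- `BoxKP ⟹ KPInflated 0` (the UNINFLATED clause; the consumer of §8.2 needs `s > Λρ₀ > 0`, i.e. the printed-kind
inflation is a genuine extra input relative to §2's `BoxKP`, whose input pencil stays under `m` itself). [folklore] -/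
theorem kpInflated_zero_of_boxKP {W : Set (ℕ → ℝ)} {m : (ℕ → ℝ) → C.BgB → R.P → ℝ} {a d : R.P → ℝ}
    (hKP : M.BoxKP W m a d) : KPInflated R W m 0 a d := by
  refine ⟨hKP.1, hKP.2.1, fun g hg U X γ hγ => ?_⟩
  simpa only [add_zero, one_mul] using (hKP.2.2 g hg U X).2 γ hγ

/-- **`BoxKP ⟹ ActivityLipschitz (1/(1 − ρ₀)) ρ₀` for every `ρ₀ < 1`** (kernel; Dimock's *analyticity ⇒ Lipschitz*
through the two-margin box): for `p` admissible and `q` at relative discrepancy `0 < ρ ≤ ρ₀`, the input pencil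
`p + z(q − p)` stays in the box around `p` for `‖z‖ < 1/ρ` (`inputPencil_mem_box_of_relDisc`), each activity is
holomorphic and under `m` along it, and the one-variable Cauchy bound `norm_sub_le_div_of_ball` gives
`‖Ψ(q) − Ψ(p)‖ ≤ m/(1/ρ − 1) = m·ρ/(1 − ρ) ≤ (1/(1 − ρ₀))·ρ·m`; `ρ = 0` means `q = p`.  So §2's analytic wall implies
the re-typed wall with modulus `1/(1 − ρ₀)`, and the closures of §8.2 contain those of §6 up to the constants (KP for
`(1 + s)m`, `s > ρ₀/(1 − ρ₀)`, in place of KP for `m`). [folklore] -/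
theorem activityLipschitz_of_boxKP {W : Set (ℕ → ℝ)} {m : (ℕ → ℝ) → C.BgB → R.P → ℝ} {a d : R.P → ℝ} {ρ₀ : ℝ}
    (hKP : M.BoxKP W m a d) (hρ₀ : ρ₀ < 1) : M.ActivityLipschitz W m (1 / (1 - ρ₀)) ρ₀ := by
  intro g hg U X p hp q hq γ hγ
  obtain ⟨hdiff, hbd⟩ := (hKP.2.2 g hg U X).1 p hp
  have hϱ1 := M.ϱOp_pos X
  have hϱ2 := M.ϱHist_pos X
  have h1ρ₀ : 0 < 1 - ρ₀ := by linarith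
  set ρ := relDisc q p (M.ϱOp X) (M.ϱHist X) with hρ_def
  have hρ0 : 0 ≤ ρ := relDisc_nonneg _ _ hϱ1 hϱ2
  have hm0 : 0 ≤ m g U γ := (norm_nonneg _).trans (hbd p (M.mem_box_self X p) γ hγ)
  rcases hρ0.eq_or_lt with h0 | hpos
  · have hqp : q = p := eq_of_relDisc_eq_zero hϱ1 hϱ2 h0.symm
    rw [hqp, sub_self, norm_zero, ← h0, mul_zero, zero_mul]
  · have hρ1 : ρ < 1 := hq.trans_lt hρ₀
    have hRz : 1 < ρ⁻¹ := (one_lt_inv₀ hpos).2 hρ1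
    have hmem : ∀ z : ℂ, ‖z‖ < ρ⁻¹ → inputPencil q p z ∈ M.box X p :=
      fun z hz => inputPencil_mem_box_of_relDisc hϱ1 hϱ2 hpos hz
    have hhol : DifferentiableOn ℂ (fun z : ℂ => M.Ψ g U X γ (inputPencil q p z)) (ball (0 : ℂ) ρ⁻¹) :=
      (hdiff γ hγ).comp (differentiable_inputPencil _ _).differentiableOn fun z hz => hmem z (mem_ball_zero_iff.1 hz)
    have hmaj : ∀ z : ℂ, ‖z‖ < ρ⁻¹ → ‖M.Ψ g U X γ (inputPencil q p z)‖ ≤ m g U γ :=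
      fun z hz => hbd _ (hmem z hz) γ hγ
    have key := norm_sub_le_div_of_ball hRz hhol hmaj
    simp only [inputPencil_one, inputPencil_zero] at key
    have hinv : ρ⁻¹ - 1 = (1 - ρ) / ρ := by field_simp
    have h1ρ : 0 < 1 - ρ := by linarith
    calc ‖M.Ψ g U X γ q - M.Ψ g U X γ p‖ ≤ m g U γ / (ρ⁻¹ - 1) := key
      _ = m g U γ * ρ / (1 - ρ) := by rw [hinv, div_div_eq_mul_div]
      _ ≤ m g U γ * ρ / (1 - ρ₀) := div_le_div_of_nonneg_left (mul_nonneg hm0 hρ0) h1ρ₀ (by linarith)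
      _ = 1 / (1 - ρ₀) * ρ * m g U γ := by ring

/-- **OLD WALL ∧ INFLATION ⟹ THE NEW RECURSION** (kernel; the comparison of §6 and §8): `BoxKP` together with the
printed-kind inflated clause `KPInflated s`, `ρ₀ < 1`, `ρ₀/(1 − ρ₀) < s`, gives the recursion of
`recursiveRate_of_model_actLip` with `Λ = 1/(1 − ρ₀)` — constant `A(1/(1 − ρ₀))/(s − ρ₀/(1 − ρ₀))` against §6's
`A/(1 − ρ₀)` (which used KP for `m` only, the INPUT pencil staying under `m`; here Cauchy is spent on the datum and the
activity pencil pays the inflation). [folklore] -/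
theorem recursiveRate_of_boxKP_inflated {EA : Functional C C.BgA} {EB : Functional C C.BgB} {W : Set (ℕ → ℝ)}
    {m : (ℕ → ℝ) → C.BgB → R.P → ℝ} {a d : R.P → ℝ} {δX : C.Dom → ℝ} {A A₀ E₀ κ θ δ δ' c ω s ρ₀ B : ℝ} {k₀ : ℕ}
    (hrep : R.Represents EA EB) (hreal : M.Realizes EA EB W) (hbase : M.InBase EB W) (hKP : M.BoxKP W m a d)
    (hKPs : KPInflated R W m s a d) (hdec : R.DecayExtract δX d) (hpin : R.PinBudget a δX A κ)
    (hdA : DecayBound EA W A₀ κ) (hdB : DecayBound EB W E₀ κ)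
    (hop : M.OperatorRate W δ θ) (hins : M.InsertionRate W κ E₀ δ' θ) (hdamp : M.InsertionDamped W κ c ω)
    (hA : 0 ≤ A) (hρ₀ : ρ₀ < 1) (hs : 1 / (1 - ρ₀) * ρ₀ < s) (hδ : 0 ≤ δ + δ') (hθ : 0 ≤ θ) (hθ1 : θ ≤ 1)
    (hc : 0 ≤ c) (hω : 0 ≤ ω) (hω1 : ω < 1) (hnear : (δ + δ') * θ ^ k₀ + c * (A₀ + E₀) * (ω / (1 - ω)) ≤ ρ₀)
    (hB : 0 ≤ B) (hfirst : ∀ k < k₀, A₀ + E₀ ≤ B * θ ^ k) :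
    RecursiveRate EA EB W κ θ ω (A * (1 / (1 - ρ₀)) / (s - 1 / (1 - ρ₀) * ρ₀) * (δ + δ') + B)
      (A * (1 / (1 - ρ₀)) / (s - 1 / (1 - ρ₀) * ρ₀) * c) :=
  M.recursiveRate_of_model_actLip hrep hreal hbase (M.baseMajorant_of_boxKP hKP) hKPs
    (M.activityLipschitz_of_boxKP hKP hρ₀) hdec hpin hdA hdB hop hins hdamp hA
    (div_nonneg zero_le_one (by linarith)) hs hδ hθ hθ1 hc hω hω1 hnear hB hfirst

end InputModel

end ActivityLipschitzCurrency

/-! ## §9 (file v1.4, ADDITIVE) THE LIPSCHITZ CURRENCY IN B13's PRINTED LETTERS, and the TWO-SPECIES datum reduced to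
## §8 by an operator-margin REGAUGE (only the history modulus meets the feedback gain) -/

section PrintedLettersLipschitz

/-! ### §9.1 The final statement of the activity route in the printed letters: every letter printed except ONE number,
### the relative two-run activity discrepancy `ε` -/

open Literature.MathematicalPhysics.QuantumFieldTheory.Balaban1983to89.B13FamilySum (Ineq126 VolBound Ineq227)
open Literature.MathematicalPhysics.QuantumFieldTheory.Balaban1983to89.B13Resummation (locE locE_congr)

variable {Dom Cube : Type*} [DecidableEq Dom] [DecidableEq Cube] [Fintype Dom]
variable (ι : Dom → Dom → Prop) [DecidableRel ι]

/-- **(2.41) for TWO activity families, Lipschitz currency, printed letters** (kernel; the third member of the family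
`T4ActivityLipschitz.norm_locE_sub_locE_le_of_small` (v1: BOTH families under the (2.38)-majorant, Kotecký–Preiss for
the DOUBLED majorant `2A e^{b+1}K₀νc₁ ≤ 1`, constant `8ε`) and `T4ActivityLipschitz.norm_locE_sub_locE_le_of_pencil_small`
(v2: a holomorphic pencil of families under the majorant up to radius `Rz`, constant `1/(Rz − 1)`)).  Hypotheses, all in
B13's letters: the footprint-local incompatibility (`reach`, `ν`), (1.26) (`κ₀`, `K₀`), the volume bound (2.30) (`c₁`),
(2.27) for the covering families of the nonempty union `X` (`dX`, `c`), cost `b ≥ r₁c`, rate `r₁ + 2κ₀ + 2 ≤ R`; ONE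
family `wB` under the (2.38)-type envelope `A e^{−R d(Z)}` on the polymers inside `X` (printed KIND, one run: Lemma 3
(2.38) p. 20); the other family within RELATIVE discrepancy `ε` of it in that envelope, `0 ≤ ε < s` — the ONE number of
the statement that is NOT PRINTED (no two-run statement is; cell G-ne5p2-3′ supplies it as `Λ·ρ` from the
activity-Lipschitz datum); and the one-run smallness for the INFLATED envelope `(1 + s)A e^{b+1}K₀νc₁ ≤ 1` ("ε₁
sufficiently small", p. 21, one more restriction of the printed kind).  Conclusion:
`|E^{(k+1)}_{wA}(X) − E^{(k+1)}_{wB}(X)| ≤ (e ν c₁ K₀²)(1 + s)A e^{−r₁ d(X)} · ε/(s − ε)` — the (2.41)-type envelope of the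
inflated majorant times `ε/(s − ε)`.  Proof: `norm_locE_sub_locE_le_of_pencil_small` along the ENTIRE activity pencil
`w_z = wB + z(wA − wB)`, which stays under `(1 + s)A e^{−Rd}` for `‖z‖ < s/ε`; no holomorphy of anything else.  The
two-run statement itself is NOT PRINTED; printed locus of the one-run envelope: (2.41) p. 21. [folklore] -/
theorem norm_locE_sub_locE_le_of_actLip_small [Std.Refl ι] [Std.Symm ι] {cubes reach : Dom → Finset Cube}
    {d : Dom → ℝ} {wA wB : Dom → ℂ} {A R r₁ κ₀ K₀ c₁ c b ν dX ε s : ℝ} {X : Finset Cube}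
    (hloc : ∀ Z Z', ι Z' Z → ∃ q ∈ reach Z, q ∈ cubes Z')
    (hreach : ∀ Z, ((reach Z).card : ℝ) ≤ ν * (cubes Z).card)
    (hd : ∀ Z, 0 ≤ d Z) (hA : 0 ≤ A) (hK₀ : 0 ≤ K₀) (hc₁ : 0 ≤ c₁) (hν : 0 ≤ ν) (hκ₀ : 0 ≤ κ₀)
    (hr₁ : 0 ≤ r₁) (hc : 0 ≤ c) (hb : r₁ * c ≤ b) (hε : 0 ≤ ε) (hεs : ε < s)
    (hwB : ∀ Z, cubes Z ⊆ X → ‖wB Z‖ ≤ A * Real.exp (-(R * d Z)))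
    (hAB : ∀ Z, cubes Z ⊆ X → ‖wA Z - wB Z‖ ≤ ε * (A * Real.exp (-(R * d Z))))
    (h126 : Ineq126 (Finset.univ : Finset Dom) cubes d κ₀ K₀)
    (hvol : VolBound (Finset.univ : Finset Dom) cubes d c₁)
    (h227 : Ineq227 (Finset.univ : Finset Dom) cubes d X dX c)
    (hrate : r₁ + 2 * κ₀ + 2 ≤ R) (hsmall : (1 + s) * A * Real.exp (b + 1) * K₀ * ν * c₁ ≤ 1) (hX : X.Nonempty) :
    ‖locE ι cubes wA X - locE ι cubes wB X‖ ≤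
      (Real.exp 1 * ν * c₁ * K₀ ^ 2 * ((1 + s) * A) * Real.exp (-(r₁ * dX))) * (ε / (s - ε)) := by
  rcases hε.eq_or_lt with h0 | hpos
  · -- ε = 0 : the two families agree on the polymers inside `X`
    have hAB' : locE ι cubes wA X = locE ι cubes wB X :=
      locE_congr ι fun Z hZ => by
        have h := hAB Z hZ
        rw [← h0, zero_mul, norm_le_zero_iff, sub_eq_zero] at h
        exact h
    rw [hAB', sub_self, norm_zero, ← h0, zero_div, mul_zero]
  · -- 0 < ε < s : the entire activity pencil on the disc of radius s/ε, under the envelope (1 + s)·A e^{−R d}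
    have hR : 1 < s / ε := (one_lt_div hpos).2 hεs
    have hA' : 0 ≤ (1 + s) * A := mul_nonneg (by linarith) hA
    have hhol : ∀ Z, cubes Z ⊆ X →
        DifferentiableOn ℂ (fun z => activityLine wA wB z Z) (ball (0 : ℂ) (s / ε)) := by
      intro Z _
      simp only [activityLine_apply]
      exact ((differentiable_const _).add (differentiable_id.mul (differentiable_const _))).differentiableOn
    have hw : ∀ z : ℂ, ‖z‖ < s / ε → ∀ Z, cubes Z ⊆ X →
        ‖activityLine wA wB z Z‖ ≤ (1 + s) * A * Real.exp (-(R * d Z)) := by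
      intro z hz Z hZ
      have hm0 : 0 ≤ A * Real.exp (-(R * d Z)) := mul_nonneg hA (Real.exp_nonneg _)
      calc ‖activityLine wA wB z Z‖ ≤ ‖wB Z‖ + ‖z‖ * ‖wA Z - wB Z‖ := norm_activityLine_le _ _ _ _
        _ ≤ A * Real.exp (-(R * d Z)) + (s / ε) * (ε * (A * Real.exp (-(R * d Z)))) :=
            add_le_add (hwB Z hZ) (mul_le_mul hz.le (hAB Z hZ) (norm_nonneg _) (by positivity))
        _ = (1 + s) * A * Real.exp (-(R * d Z)) := by rw [← mul_assoc, div_mul_cancel₀ s hpos.ne']; ring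
    have key := norm_locE_sub_locE_le_of_pencil_small ι (w := activityLine wA wB) hloc hreach hd hA' hK₀ hc₁ hν hκ₀
      hr₁ hc hb hR hhol hw h126 hvol h227 hrate hsmall hX
    rw [activityLine_one, activityLine_zero] at key
    have hsε : s / ε - 1 = (s - ε) / ε := by field_simp
    calc ‖locE ι cubes wA X - locE ι cubes wB X‖
        ≤ (Real.exp 1 * ν * c₁ * K₀ ^ 2 * ((1 + s) * A) * Real.exp (-(r₁ * dX))) / (s / ε - 1) := key
      _ = (Real.exp 1 * ν * c₁ * K₀ ^ 2 * ((1 + s) * A) * Real.exp (-(r₁ * dX))) * (ε / (s - ε)) := by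
          rw [hsε, div_div_eq_mul_div, mul_div_assoc]

/-- **The case `s = 1`: v1's smallness, a quarter of v1's constant, one endpoint** (kernel): under EXACTLY the smallness
`2A e^{b+1}K₀νc₁ ≤ 1` of `T4ActivityLipschitz.norm_locE_sub_locE_le_of_small` and with only `wB` asked to lie under the
envelope, `|E^{(k+1)}_{wA}(X) − E^{(k+1)}_{wB}(X)| ≤ (e ν c₁ K₀²)·2A·e^{−r₁ d(X)} · ε/(1 − ε)` for `0 ≤ ε < 1` — against
v1's `8ε·(e ν c₁ K₀²)·A·e^{−r₁ d(X)}`: the factor `2ε/(1 − ε)` replaces `8ε` (smaller for every `ε < 3/4`, next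
`example`). [folklore] -/
theorem norm_locE_sub_locE_le_of_actLip_one [Std.Refl ι] [Std.Symm ι] {cubes reach : Dom → Finset Cube}
    {d : Dom → ℝ} {wA wB : Dom → ℂ} {A R r₁ κ₀ K₀ c₁ c b ν dX ε : ℝ} {X : Finset Cube}
    (hloc : ∀ Z Z', ι Z' Z → ∃ q ∈ reach Z, q ∈ cubes Z')
    (hreach : ∀ Z, ((reach Z).card : ℝ) ≤ ν * (cubes Z).card)
    (hd : ∀ Z, 0 ≤ d Z) (hA : 0 ≤ A) (hK₀ : 0 ≤ K₀) (hc₁ : 0 ≤ c₁) (hν : 0 ≤ ν) (hκ₀ : 0 ≤ κ₀)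
    (hr₁ : 0 ≤ r₁) (hc : 0 ≤ c) (hb : r₁ * c ≤ b) (hε : 0 ≤ ε) (hε1 : ε < 1)
    (hwB : ∀ Z, cubes Z ⊆ X → ‖wB Z‖ ≤ A * Real.exp (-(R * d Z)))
    (hAB : ∀ Z, cubes Z ⊆ X → ‖wA Z - wB Z‖ ≤ ε * (A * Real.exp (-(R * d Z))))
    (h126 : Ineq126 (Finset.univ : Finset Dom) cubes d κ₀ K₀)
    (hvol : VolBound (Finset.univ : Finset Dom) cubes d c₁)
    (h227 : Ineq227 (Finset.univ : Finset Dom) cubes d X dX c)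
    (hrate : r₁ + 2 * κ₀ + 2 ≤ R) (hsmall : 2 * A * Real.exp (b + 1) * K₀ * ν * c₁ ≤ 1) (hX : X.Nonempty) :
    ‖locE ι cubes wA X - locE ι cubes wB X‖ ≤
      (Real.exp 1 * ν * c₁ * K₀ ^ 2 * (2 * A) * Real.exp (-(r₁ * dX))) * (ε / (1 - ε)) := by
  have hsmall' : (1 + 1) * A * Real.exp (b + 1) * K₀ * ν * c₁ ≤ 1 := by rw [one_add_one_eq_two]; exact hsmall
  have h := norm_locE_sub_locE_le_of_actLip_small ι hloc hreach hd hA hK₀ hc₁ hν hκ₀ hr₁ hc hb hε hε1 hwB hAB h126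
    hvol h227 hrate hsmall' hX
  rwa [one_add_one_eq_two] at h

/-- The comparison of the two constants at v1's smallness: `2·ε/(1 − ε) ≤ 8ε` for `0 ≤ ε ≤ 3/4`. [folklore] -/
example {ε : ℝ} (hε : 0 ≤ ε) (hε34 : ε ≤ 3 / 4) : 2 * (ε / (1 - ε)) ≤ 8 * ε := by
  have h1 : 0 < 1 - ε := by linarith
  rw [mul_div_assoc', div_le_iff₀ h1]
  nlinarith

end PrintedLettersLipschitz

/-! ### §9.2 TWO SPECIES of activity sensitivity (operator modulus `Λop`, history modulus `Λhist`) and their reduction to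
### §8 by REGAUGING the operator margin: the single-modulus recursion applied to the regauged model separates the species
### for free — only `Λhist` meets the feedback gain `c`, `Λop` enters the constant and the near condition -/

section Species

variable {C : Carriers}

namespace InputModel

variable {R : ClusterRep C} {Op Hist : Type*} [NormedAddCommGroup Op] [NormedSpace ℂ Op] [NormedAddCommGroup Hist]
  [NormedSpace ℂ Hist] (M : InputModel R Op Hist)

/-- The OPERATOR-MARGIN REGAUGE of an input model: the same data with the operator margin multiplied by `l > 0` (a
choice of unit for operator discrepancies; nothing else changes — activities, input points, insertions, admissible class,
history margin).  Only the products *sensitivity × discrepancy-per-margin* are unit-free; this is the activity-level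
reading of the sibling's margin gauge (`T4InputCauchyRateSpecies` §4, `StepModel.regauge`), which is not restated.
[folklore] -/
def regaugeOp (l : ℝ) (hl : 0 < l) : InputModel R Op Hist :=
  { M with ϱOp := fun X => l * M.ϱOp X, ϱOp_pos := fun X => mul_pos hl (M.ϱOp_pos X) }

/-- The regauged operator margin. [folklore] -/
@[simp] theorem regaugeOp_ϱOp (l : ℝ) (hl : 0 < l) (X : C.Dom) : (M.regaugeOp l hl).ϱOp X = l * M.ϱOp X := rfl

/-- The history margin is unchanged by the regauge. [folklore] -/
@[simp] theorem regaugeOp_ϱHist (l : ℝ) (hl : 0 < l) (X : C.Dom) : (M.regaugeOp l hl).ϱHist X = M.ϱHist X := rfl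

/-- HYPOTHESIS SHAPE `ActivityLipschitz₂ W m Λop Λhist ρ₀` (NOT PRINTED — the TWO-SPECIES form of the re-typed wall
G-ne5p2-3′; asserted nowhere): around every admissible input point `p`, every input point `q` within relative
discrepancy `ρ(q, p) ≤ ρ₀` (margin units) moves each activity of the step volume of `X` by at most
`(Λop·‖q.1 − p.1‖/ϱOp X + Λhist·‖q.2 − p.2‖/ϱHist X)·m` — separate moduli for the OPERATOR displacement (the undamped
species: the two runs' operators differ at the fixed rate `δθ^k`, NE2 ∧ NE3) and for the inserted-HISTORY displacement
(the species fed back through the earlier output discrepancies).  `ActivityLipschitz Λ ρ₀` is the case `Λop = Λhist = Λ`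
(`activityLipschitz₂_of_activityLipschitz`); conversely the species datum gives the single one with `max Λop Λhist`
(`activityLipschitz_of_activityLipschitz₂`) and, sharper, the single one with modulus `Λhist` for the REGAUGED model
(`activityLipschitz_regaugeOp_of_activityLipschitz₂`).  Printed material bearing on the two species separately, ONE run:
the operator-replacement error terms (2.16)–(2.22) p. 16 and the τ-circles (2.18) p. 16 of the complex parameters of the
inserted potentials in (2.14) p. 15; a two-run modulus of either species is printed nowhere. [folklore] -/
def ActivityLipschitz₂ (W : Set (ℕ → ℝ)) (m : (ℕ → ℝ) → C.BgB → R.P → ℝ) (Λop Λhist ρ₀ : ℝ) : Prop :=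
  ∀ g ∈ W, ∀ (U : C.BgB) (X : C.Dom), ∀ p ∈ M.Base g U X, ∀ q : Op × Hist,
    relDisc q p (M.ϱOp X) (M.ϱHist X) ≤ ρ₀ →
      ∀ γ ∈ R.vol X, ‖M.Ψ g U X γ q - M.Ψ g U X γ p‖ ≤
        (Λop * (‖q.1 - p.1‖ / M.ϱOp X) + Λhist * (‖q.2 - p.2‖ / M.ϱHist X)) * m g U γ

/-- The single datum is the species datum with equal moduli. [folklore] -/
theorem activityLipschitz₂_of_activityLipschitz {W : Set (ℕ → ℝ)} {m : (ℕ → ℝ) → C.BgB → R.P → ℝ} {Λ ρ₀ : ℝ}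
    (h : M.ActivityLipschitz W m Λ ρ₀) : M.ActivityLipschitz₂ W m Λ Λ ρ₀ := by
  intro g hg U X p hp q hq γ hγ
  have := h g hg U X p hp q hq γ hγ
  simpa only [relDisc, mul_add] using this

/-- The species datum gives the single datum with the larger modulus (granted a majorant at the base point, so that
`m ≥ 0` on the step volume). [folklore] -/
theorem activityLipschitz_of_activityLipschitz₂ {W : Set (ℕ → ℝ)} {m : (ℕ → ℝ) → C.BgB → R.P → ℝ}
    {Λop Λhist ρ₀ : ℝ} (h : M.ActivityLipschitz₂ W m Λop Λhist ρ₀) (hm : M.BaseMajorant W m) :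
    M.ActivityLipschitz W m (max Λop Λhist) ρ₀ := by
  intro g hg U X p hp q hq γ hγ
  have hϱ1 := M.ϱOp_pos X
  have hϱ2 := M.ϱHist_pos X
  have hm0 : 0 ≤ m g U γ := (norm_nonneg _).trans (hm g hg U X p hp γ hγ)
  have h1 : 0 ≤ ‖q.1 - p.1‖ / M.ϱOp X := div_nonneg (norm_nonneg _) hϱ1.le
  have h2 : 0 ≤ ‖q.2 - p.2‖ / M.ϱHist X := div_nonneg (norm_nonneg _) hϱ2.le
  calc ‖M.Ψ g U X γ q - M.Ψ g U X γ p‖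
      ≤ (Λop * (‖q.1 - p.1‖ / M.ϱOp X) + Λhist * (‖q.2 - p.2‖ / M.ϱHist X)) * m g U γ := h g hg U X p hp q hq γ hγ
    _ ≤ (max Λop Λhist * (‖q.1 - p.1‖ / M.ϱOp X) + max Λop Λhist * (‖q.2 - p.2‖ / M.ϱHist X)) * m g U γ := by
        gcongr
        · exact le_max_left _ _
        · exact le_max_right _ _
    _ = max Λop Λhist * relDisc q p (M.ϱOp X) (M.ϱHist X) * m g U γ := by simp only [relDisc]; ring

/-- The relative discrepancy in the regauged margins: the operator term is divided by `l`. [folklore] -/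
theorem relDisc_regaugeOp (l : ℝ) (hl : 0 < l) (q p : Op × Hist) (X : C.Dom) :
    relDisc q p ((M.regaugeOp l hl).ϱOp X) ((M.regaugeOp l hl).ϱHist X) =
      l⁻¹ * (‖q.1 - p.1‖ / M.ϱOp X) + ‖q.2 - p.2‖ / M.ϱHist X := by
  simp only [relDisc, regaugeOp_ϱOp, regaugeOp_ϱHist]
  rw [mul_comm l, ← div_div, div_eq_inv_mul _ l]

/-- The original relative discrepancy is at most `max l 1` times the regauged one (reach conversion). [folklore] -/
theorem relDisc_le_max_mul_relDisc_regaugeOp (l : ℝ) (hl : 0 < l) (q p : Op × Hist) (X : C.Dom) :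
    relDisc q p (M.ϱOp X) (M.ϱHist X) ≤
      max l 1 * relDisc q p ((M.regaugeOp l hl).ϱOp X) ((M.regaugeOp l hl).ϱHist X) := by
  rw [relDisc_regaugeOp, relDisc]
  have h1 : 0 ≤ ‖q.1 - p.1‖ / M.ϱOp X := div_nonneg (norm_nonneg _) (M.ϱOp_pos X).le
  have h2 : 0 ≤ ‖q.2 - p.2‖ / M.ϱHist X := div_nonneg (norm_nonneg _) (M.ϱHist_pos X).le
  have hmax1 : 1 ≤ max l 1 := le_max_right _ _
  have hmaxl : l ≤ max l 1 := le_max_left _ _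
  have hA : ‖q.1 - p.1‖ / M.ϱOp X ≤ max l 1 * (l⁻¹ * (‖q.1 - p.1‖ / M.ϱOp X)) := by
    rw [← mul_assoc]
    have : 1 ≤ max l 1 * l⁻¹ := by
      rw [le_mul_inv_iff₀ hl, one_mul]; exact hmaxl
    nlinarith
  have hB : ‖q.2 - p.2‖ / M.ϱHist X ≤ max l 1 * (‖q.2 - p.2‖ / M.ϱHist X) := by nlinarith
  calc ‖q.1 - p.1‖ / M.ϱOp X + ‖q.2 - p.2‖ / M.ϱHist X
      ≤ max l 1 * (l⁻¹ * (‖q.1 - p.1‖ / M.ϱOp X)) + max l 1 * (‖q.2 - p.2‖ / M.ϱHist X) := add_le_add hA hB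
    _ = max l 1 * (l⁻¹ * (‖q.1 - p.1‖ / M.ϱOp X) + ‖q.2 - p.2‖ / M.ϱHist X) := by ring

/-- **THE SPECIES DATUM IS THE SINGLE DATUM OF THE REGAUGED MODEL** (kernel): with operator margins multiplied by
`l = Λhist/Λop`, `Λop·ρop + Λhist·ρhist = Λhist·(ρop/l + ρhist) = Λhist·ρ′`, `ρ′` the regauged relative discrepancy;
the reach converts by `ρ ≤ max(l, 1)·ρ′`, so reach `ρ₀′` with `max(Λhist/Λop, 1)·ρ₀′ ≤ ρ₀` suffices.  Hence
`ActivityLipschitz₂ Λop Λhist ρ₀ ⟹ (regauged model).ActivityLipschitz Λhist ρ₀′`: the species split costs no new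
recursion. [folklore] -/
theorem activityLipschitz_regaugeOp_of_activityLipschitz₂ {W : Set (ℕ → ℝ)} {m : (ℕ → ℝ) → C.BgB → R.P → ℝ}
    {Λop Λhist ρ₀ ρ₀' : ℝ} (h : M.ActivityLipschitz₂ W m Λop Λhist ρ₀) (hop : 0 < Λop) (hhist : 0 < Λhist)
    (hρ : max (Λhist / Λop) 1 * ρ₀' ≤ ρ₀) :
    (M.regaugeOp (Λhist / Λop) (div_pos hhist hop)).ActivityLipschitz W m Λhist ρ₀' := by
  intro g hg U X p hp q hq γ hγ
  have hl : 0 < Λhist / Λop := div_pos hhist hop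
  have hreach : relDisc q p (M.ϱOp X) (M.ϱHist X) ≤ ρ₀ := by
    refine le_trans (M.relDisc_le_max_mul_relDisc_regaugeOp (Λhist / Λop) hl q p X) (le_trans ?_ hρ)
    exact mul_le_mul_of_nonneg_left hq (le_trans zero_le_one (le_max_right _ _))
  have key := h g hg U X p hp q hreach γ hγ
  rw [relDisc_regaugeOp]
  calc ‖M.Ψ g U X γ q - M.Ψ g U X γ p‖
      ≤ (Λop * (‖q.1 - p.1‖ / M.ϱOp X) + Λhist * (‖q.2 - p.2‖ / M.ϱHist X)) * m g U γ := key
    _ = Λhist * ((Λhist / Λop)⁻¹ * (‖q.1 - p.1‖ / M.ϱOp X) + ‖q.2 - p.2‖ / M.ϱHist X) * m g U γ := by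
        rw [inv_div, mul_add, ← mul_assoc, mul_div_cancel₀ _ hhist.ne']

/-- The operator rate in regauged margins: `δ` operator margins are `δ/l` regauged ones. [folklore] -/
theorem operatorRate_regaugeOp {W : Set (ℕ → ℝ)} {δ θ : ℝ} (h : M.OperatorRate W δ θ) (l : ℝ) (hl : 0 < l) :
    (M.regaugeOp l hl).OperatorRate W (δ / l) θ := by
  intro g hg U X
  have := h g hg U X
  rw [regaugeOp_ϱOp]
  calc ‖(M.regaugeOp l hl).opA g U X - (M.regaugeOp l hl).opB g U X‖ = ‖M.opA g U X - M.opB g U X‖ := rfl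
    _ ≤ δ * θ ^ C.scale X * M.ϱOp X := this
    _ = δ / l * θ ^ C.scale X * (l * M.ϱOp X) := by field_simp

/-- **NE5 FROM THE TWO-SPECIES DATUM** (kernel; §8's `ne5_of_model_actLip_scale_nat` applied to the model regauged by
`l = Λhist/Λop` — every other shape of the model is literally unchanged by the regauge, the operator rate becomes
`δ/l = δΛop/Λhist`).  With reach `ρ₀′`, `max(Λhist/Λop, 1)·ρ₀′ ≤ ρ₀`, inflation `s > Λhist·ρ₀′`, near condition
`(δΛop/Λhist + δ′)θ^{k₀} + c(A₀ + E₀)/(1 − ω) ≤ ρ₀′`: load-bearing smallness **`ω + AΛhist·c/(s − Λhist ρ₀′) < θ`** —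
ONLY the history modulus meets the feedback gain `c`; the operator modulus enters the constant,
`C₅ = ((A/(s − Λhist ρ₀′))(Λop δ + Λhist δ′) + B)(θ − ω)/(θ − (ω + AΛhist c/(s − Λhist ρ₀′)))` (the displayed form
rewritten in the next `example`), and the near condition (through `k₀`).  This is the activity-level counterpart of the
sibling's species form (`T4InputCauchyRateSpecies`, exponent-critical census `{θ_op, ω, A·Ghist·c}`); here the KP
inflation `s` is the one extra letter.  No new wall: `ActivityLipschitz₂` is G-ne5p2-3′ read with two moduli. [folklore] -/
theorem ne5_of_model_actLip₂_scale_nat {EA : Functional C C.BgA} {EB : Functional C C.BgB} {W : Set (ℕ → ℝ)}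
    {m : (ℕ → ℝ) → C.BgB → R.P → ℝ} {a d : R.P → ℝ} {δX : C.Dom → ℝ}
    {A A₀ E₀ E₁ κ θ δ δ' c ω s Λop Λhist ρ₀ ρ₀' B : ℝ} {k₀ : ℕ}
    (hrep : R.Represents EA EB) (hreal : M.Realizes EA EB W) (hbase : M.InBase EB W) (hmaj : M.BaseMajorant W m)
    (hKP : KPInflated R W m s a d) (hlip : M.ActivityLipschitz₂ W m Λop Λhist ρ₀)
    (hdec : R.DecayExtract δX d) (hpin : R.PinBudget a δX A κ)
    (hdA : DecayBound EA W A₀ κ) (hdB : DecayBound EB W E₀ κ)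
    (hop : M.OperatorRate W δ θ) (hins : M.InsertionRate W κ E₀ δ' θ)
    (haff : M.InsAffine W) (hblind : M.InsBlind W) (hhom : M.InsHomog W) (hunit : M.InsScaleBound W κ E₁ c ω)
    (hE₁ : 0 < E₁) (hA : 0 ≤ A) (hΛop : 0 < Λop) (hΛhist : 0 < Λhist) (hρ : max (Λhist / Λop) 1 * ρ₀' ≤ ρ₀)
    (hs : Λhist * ρ₀' < s) (hδ : 0 ≤ δ) (hδ' : 0 ≤ δ') (hθ : 0 ≤ θ) (hθ1 : θ ≤ 1)
    (hc : 0 ≤ c) (hω : 0 < ω) (hnear : (δ / (Λhist / Λop) + δ') * θ ^ k₀ + c * (A₀ + E₀) / (1 - ω) ≤ ρ₀')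
    (hB : 0 ≤ B) (hfirst : ∀ k < k₀, A₀ + E₀ ≤ B * θ ^ k) (hsmall : ω + A * Λhist / (s - Λhist * ρ₀') * c < θ) :
    NE5 EA EB W κ θ ((A * Λhist / (s - Λhist * ρ₀') * (δ / (Λhist / Λop) + δ') + B) * (θ - ω) /
      (θ - (ω + A * Λhist / (s - Λhist * ρ₀') * c))) :=
  (M.regaugeOp (Λhist / Λop) (div_pos hΛhist hΛop)).ne5_of_model_actLip_scale_nat hrep hreal hbase hmaj hKP
    (M.activityLipschitz_regaugeOp_of_activityLipschitz₂ hlip hΛop hΛhist hρ) hdec hpin hdA hdB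
    (M.operatorRate_regaugeOp hop _ _) hins haff hblind hhom hunit hE₁ hA hΛhist.le hs
    (add_nonneg (div_nonneg hδ (div_pos hΛhist hΛop).le) hδ') hθ hθ1 hc hω hnear hB hfirst hsmall

/-- The species constant's first factor rewritten: `(AΛhist/(s − Λhist ρ₀′))(δ/(Λhist/Λop) + δ′) =
(A/(s − Λhist ρ₀′))(Λop δ + Λhist δ′)`. [folklore] -/
example {A s Λop Λhist ρ₀' δ δ' : ℝ} (hhist : 0 < Λhist) :
    A * Λhist / (s - Λhist * ρ₀') * (δ / (Λhist / Λop) + δ') = A / (s - Λhist * ρ₀') * (Λop * δ + Λhist * δ') := by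
  rw [div_div_eq_mul_div]
  field_simp

end InputModel

end Species

end Literature.MathematicalPhysics.QuantumFieldTheory.Balaban1983to89.T4ActivityRecursion
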